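import Literature.Combinatorics.Additive.TwoAtomsOfSmallSumsets
import Literature.Combinatorics.Additive.LevSmeliansky

/-!
# The Hamidoune–Rødseth theorem for abelian groups (Hamidoune–Serra–Zémor 2008, §§6–8):
# atoms of small sets (Lemmas 23, 24, 27), progressions and quasi-progressions transferred across a
# small sumset in a cyclic group (Lemmas 25, 26), and Theorem 28

Topic `Literature/Combinatorics/Additive`.  Cell `mm-stpp` (D-0046), seat `mm-stpp-lit` (gen 16);
continuation of `IsoperimetricMethod.lean` / `HamidouneCriticalPairAbelian.lean` /
`TwoAtomsOfSmallSumsets.lean` (imported: `conn`, `IsFragment`, `IsAtom`, `layer_step`,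
`fainting_three`, Lemma 4 for every `k` (`IsAtom.add_erase_eq_of_lt_card`), the run decomposition
`eq_filter_union_biUnion_apFinset`, `apFinset`/`IsAP`) and of `LevSmeliansky.lean` (imported:
`lev_smeliansky_inverse`, Nathanson's Theorem 4.8, for Lemma 26).  Everything here is PROVED (0 `sorry`,
0 named facts), for FINITE ABELIAN groups in additive notation.

## Source (read at the page this session)

Y. O. Hamidoune, O. Serra, G. Zémor, *On the critical pair theory in abelian groups: beyond
Chowla's theorem*, Combinatorica 28 (2008) 441–467 = arXiv:math/0603478 [HamidouneSerraZemor2008]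
— held as `paper:arxiv-math_0603478` (LaTeX source, 17 chunks), §§6–8 read in full (chunks
p0011–p0015 of the held text):

* §6 **Lemma 23** (p0011: "Let `S` be a `4`-separable generating subset of a finite abelian group
  such that `0 ∈ S` and `κ₄(S) = |S| = 3`.  Let `0 ∈ A` be a `4`-atom of `S`.  Then `|A| = 4`.")
  — `IsAtom.card_eq_four_of_conn_four_eq_three`, PROVED as printed (Lemma 4 gives
  `A + S = A + {0, z} = A ∪ (A + z)`, so `N₁(A,S) − S* ⊆ A`; Lemma 17 (`layer_step`) lifts it to
  `N₂ − S* ⊆ N₁`; the Fainting Lemma for `|Y| = 3`, `m = 0` (`fainting_three`) gives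
  `|G| ≤ |A| + 6`, against `|A + S| = |A| + 3 ≤ |G| − 4`).
* §7 (p0012), the transfer of an arithmetic progression across a sumset one above the
  Cauchy–Davenport bound, in a CYCLIC group `G = ⟨r⟩` of any order ("`A` is a progression and thus
  `S` is a quasi-progression", used throughout §8; this is [HamidouneRodseth2000, Lemma 1] beyond
  prime order): `subset_apFinset_of_isAP_of_card_add_le_of_zmultiples` (`B` an `r`-progression
  with `|B| ≥ 3`, `A ≠ ∅`, `|A + B| ≤ |A| + |B|`, `|A + B| < |G|` ⇒ `A ⊆ {a, a + r, …, a + |A| r}`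
  for some `a`), by the argument of `subset_apFinset_of_isAP_of_card_add_le` (the `ℤ/pℤ` version
  in `IsoperimetricMethod.lean`) with the cyclic-group lemmas `addOrderOf_eq_card_of_zmultiples_eq_top`,
  `card_apFinset_of_le_addOrderOf`, `eq_univ_of_vadd_eq_of_zmultiples_eq_top`,
  `one_le_card_vadd_sdiff_of_zmultiples_eq_top`,
  `exists_eq_apFinset_of_card_vadd_sdiff_le_one_of_zmultiples_eq_top`.
* §7 **Lemma 25** (p0012: "Let `0 ∈ S` be a quasi-progression with difference `r` in the cyclic
  group `ℤ_n`.  Suppose that `S` generates `ℤ_n` and `|S| ≥ 3`.  Let `T ⊂ ℤ_n` be such that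
  `|T| ≥ 3` and `|S + T| ≤ |S| + |T| ≤ n − 4`.  Then one of the following conditions holds:
  (i) `T` is either a quasi-progression with difference `r` or a progression with difference `r`.
  (ii) `n = 12` and `T` is a coset of order `4`.") — for `n ≠ 12`:
  `subset_apFinset_of_card_add_le_of_not_isAP` (`S ⊆ {a, …, a + |S| r}` not an `r`-progression,
  `|S| ≥ 3`, `|T| ≥ 3`, `|T + S| ≤ |T| + |S|`, `|T| + |S| + 4 ≤ |G|` ⇒ `T ⊆ {b, …, b + |T| r}`),
  over the oriented core `subset_apFinset_of_card_add_quasi_le_core` (removed term of index `j`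
  with `|S| ≤ 2j`; the other orientation by `S, T ↦ −S, −T`), and, merged with the progression
  case, `subset_apFinset_of_card_add_le_of_subset_apFinset`.  PROOF: the printed Cases 1/2
  ("there is a connected component `C₁` of `T̄` with `|C₁| ≥ |S|`" / "for every connected
  component `C` of `T̄`, `|C| < |S|`"), organized through the maximal `r`-runs of `G ∖ T`
  ([Hamidoune2000, Lemma 6.1] = `eq_filter_union_biUnion_apFinset`, with
  `disjoint_apFinset_of_sub_notMem`, `card_apFinset_of_le_of_card_apFinset_eq`,
  `filter_vadd_apFinset_subset_eq_empty`, `univ_sdiff_apFinset_of_zmultiples`): with `ℓ_s` the gap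
  lengths, `T_k = T + {0, …, k r}` and `D = T_k ∖ (T + S)`, every point of `D` is `u + j r` for an
  isolated `u ∈ T` followed by a gap of length `≥ j` and preceded by one of length `≥ k − j`,
  `|T_k| ≥ |T| + Σ_s min(ℓ_s, k)` so `Σ_s min(ℓ_s, k) ≤ k + |D|` with at least `|D|` gaps of
  length `≥ j ≥ 2`; Case 1 leaves at most two gaps, the short one of length `1`, so `T` lies in
  the complement of one run; Case 2 forces `j = 2`, `k = 4`, four gaps of length `2`, `|T| = 4`,
  `n = 12`.
* §7 **Lemma 26** (p0012: "Let `S` and `T` be subsets of `ℤ` such that `|S| = 3`, `|T| = 4` and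
  `|S + T| = 7`.  Then `S` is either a progression or a quasi-progression.  The proof is an easy
  exercise.") — `exists_forall_eq_add_mul_of_card_add_le_seven` (`S ⊆ {c, c + d, c + 2d, c + 3d}`,
  `d > 0`, `c = min S`), PROVED here from Nathanson's Theorem 4.8 (Lev–Smeliansky;
  `lev_smeliansky_inverse` of `LevSmeliansky.lean`, applied to `(S, T)` or `(T, S)` according to
  the diameters).
* §7 **Lemma 27** (p0012–p0013: "Let `S` be a `4`-separable generating subset of an abelian group
  `G` of order `n` such that `0 ∈ S`, `|S| = 3` and `κ₄(S) = |S| = 3`.  Assume moreover that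
  `gcd(n, 6) = 1`.  Then `G` is a cyclic group and `S` is a quasi-progression.") —
  `exists_subset_apFinset_of_conn_four_eq_three` (conclusion: `S ⊆ {a, a + r, a + 2r, a + 3r}` for
  a generator `r` of `G`), PROVED along the printed lines: a `4`-atom `A ∋ 0` has `|A| = 4`
  (Lemma 23) and generates; with `S = {0, x, y}`, either `A` is a `(y − x)`-progression
  (`subset_apFinset_four_of_card_vadd_sdiff_le_one`, then the progression transfer), or
  `|A ∩ (A + x)| ≥ 2` up to `x ↔ y` (`exists_subset_apFinset_four_of_two_le_card_inter`): then `x`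
  generates `G` (`zmultiples_eq_top_of_card_union_vadd_le` — the printed "every element of
  `S ∖ {0}` generates `G`", here by a direct two-coset count using `gcd(|G|, 6) = 1` through
  `five_le_addOrderOf_of_coprime_six` and `mem_of_add_self_mem_of_odd_card`), `A` lies in an
  `x`-window of length `≤ (n+3)/2` (`exists_subset_apFinset_short_of_card_vadd_sdiff_le_two`, with
  `card_vadd_univ_sdiff_sdiff`), and either `S = {0, x, t x}` fits in a window of length `≤ (n−1)/2`
  — then the sum is rectified to `ℤ` (`card_add_eq_card_index_add`: "the sum `A + S` in `ℤ_n` has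
  the same cardinality as the sum `A + S` in `ℤ`") and Lemma 26 applies — or `2t ∈ {n−1, n+1, n+3}`
  and `S` lies in a `4`-term progression of difference `2⁻¹ x` ("we are done").
* §6 **Lemma 24** (p0011: "Let `0 ∈ S` be a `3`-separable generating subset of a finite abelian
  group `G` such that `κ₃(S) = |S| = 4`.  Assume `gcd(|G|, 6) = 1`.  Let `A` be a `3`-atom of `S`
  such that `0 ∈ A`.  Then `|A| = 3`.") — `IsAtom.card_eq_three_of_conn_three_eq_four`, PROVED
  as printed: `A` not a subgroup (`|A| ∣ 4`), Corollary 9 (`IsAtom.card_inter_vadd_lt_of_forall_ne`),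
  `|A| ≤ 5` by three translates, `A` generates, the `2`-atom `B ∋ 0` of `A` is a subgroup or a pair
  (Theorem 21, `IsAtom.exists_addSubgroup_or_card_eq_two_of_conn_le_add`) forcing `|A| = 4`,
  `|G| ≥ 13` via the dual fragment (`IsFragment.dual`), then **Claim 1** ("`S*` is an arithmetic
  progression", `isAP_erase_zero_of_layers`: the layers `N_i(A, S)` and the sets `N_i^X`,
  (eq:nx1), `N_i^{x} = ∅`, `|N_1^{S*∖x}| ≤ 2`, `|N_2^X| + 1 ≤ |N_1^X|`, `N_3^X = ∅`,
  `|N_2^{S*}| + 2 ≤ |N_1|`, and the dichotomy `|N_2^{S*}| = 2` ⇒ critical pair ⇒ progression /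
  `|N_2^{S*}| ≤ 1` ⇒ `A + 3S = G` with `≤ 12` points), applied to `S` and to `S − a − d`, and the
  final "`{0, d, 2d}` is a `3`-atom of `S`" (`isFragment_three_of_eq_zero_two_three_four`).  The
  Chowla counts "`κ₁(Z) = |Z| − 1` for `|Z| ≤ 3`" are replaced by the Kneser consequence
  `card_add_card_le_card_add_succ_of_card_add_lt` (`|W + T| ≥ |W| + |T| − 1` whenever
  `|W + T|` is below every non-zero order).
* §8 **Theorem 28** (p0013: "Let `S` be a generating subset of an abelian group `G` of order `n`
  such that `0 ∈ S`, `gcd(n, 6) = 1` and `4 ≤ |S| ≤ n − 7`.  Suppose that `S` is `3`-separable and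
  `κ₃(S) = |S|`.  Also assume that every element of `S ∖ 0` has order `≥ |S| + 1`.  Then either `S*`
  is quasi-periodic or `S` is a quasi-progression."), **Cases 1 and 2 of the printed proof** (a
  generating `3`-atom `A ∋ 0` with `|A| ≤ 4`; conclusion "`S` is a progression or a
  quasi-progression of a generator `r`", `S ⊆ {a, …, a + |S| r}`):
  `exists_subset_apFinset_of_isAtom_three_of_card_le_four`, PROVED as printed from Theorem 14
  (`exists_isAP_of_conn_lt_card`: "Theorem 14 implies that `A` is a progression"), Lemma 27,
  Lemma 24, the progression transfer and Lemma 25 (twice in Case 2); and **Claim 2 of the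
  printed proof** ("The result holds if `A` generates a proper subgroup `K` of `G`"; conclusion
  "`S* = S ∖ {0}` is quasi-periodic", rendered as `S* ⊆ P`, `|P| = |S|`, `q + P = P` for some
  `q ≠ 0`): `exists_periodic_superset_erase_zero_of_closure_ne_top`, PROVED as printed
  (`A = K`: `|A| ∣ |S + A|`, `S ∩ A = {0}`; `A ≠ K`: Corollary 9, `S` modulo `K`, Lemma 10 in `K`
  (`card_add_card_le_succ_of_subset_closure`), one deficient coset, `P = S* + K`); and **Case 3** (a generating `3`-atom
  `A ∋ 0` with `|A| ≥ 5`; conclusion "`S*` is quasi-periodic"):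
  `exists_periodic_superset_erase_zero_of_five_le_card`, PROVED as printed (Corollary 9, the
  `2`-atom `B ∋ 0` of `A` is a subgroup by Theorem 21, `|A| = |B| = 5`, `A = A_0 ∪ A_1` over two
  cosets with `|A_0| = 3` w.l.o.g., `|S| ≥ 5` by Lemma 24, `S ∩ B = {0}`, `|A + S| ≤ |G| − 5` by
  the dual fragment, then the decomposition of `S` modulo `B`:
  `exists_periodic_superset_erase_zero_of_two_cosets`), whence the full **Theorem 28**
  `exists_subset_apFinset_or_periodic_of_conn_three_eq_card`.

## Deviations from print

As in the sibling files, `κ_k(S)` is computed in the ambient group `G` and "`S` generating" is the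
explicit hypothesis `AddSubgroup.closure S = ⊤`; "`4`-separable" in Lemma 23 is implied by the
existence of the `4`-atom and not repeated.  "Cyclic group `ℤ_n`" is rendered as a finite abelian
group with a distinguished generator `r` (`AddSubgroup.zmultiples r = ⊤`), progressions of
difference `r` as `apFinset a r n`, and "`A` is a progression or a quasi-progression of difference
`r`" as the almost-progression inclusion `A ⊆ apFinset a r (|A| + 1)`.  In Lemma 25 the
hypothesis "`S` generating" is automatic (`S` contains two consecutive terms `a + i r, a + (i+1) r`
only when `|S| ≥ 3`; here `⟨r⟩ = G` is the standing assumption), the printed alternative (ii)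
(`n = 12`, `T` a coset of order `4`) is excluded by the hypothesis `|G| ≠ 12` rather than listed,
`|S| + 1 ≤ |G|` is implied by `|T| + |S| + 4 ≤ |G|`, and the printed normalizations ("`j ≥ ⌈|S|/2⌉`
and `a = 0`", "`d = 1`") are the reduction to the oriented core by translation and `x ↦ −x`.  In Lemma 27 the
conclusion "`G` is cyclic and `S` is a quasi-progression" is rendered as "`S ⊆ {a, …, a + 3r}` with
`⟨r⟩ = G`" (that `S` is not a genuine progression follows from `κ₄(S) = 3` and is not recorded);
the printed first step ("every element of `S ∖ {0}` generates `G`", by the decomposition of `A`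
modulo `⟨x⟩` and of `A + S` modulo `⟨x⟩` through `G/⟨x⟩`) is proved only where it is used (for the
element `x` with `|A ∩ (A + x)| ≥ 2`) and by a two-coset count instead of the quotient; the printed
normalizations "`t ≤ (n+1)/2`" (by `x ↦ −x`) and "`A` … in an interval of length `≤ (n+1)/2`" are
replaced by choosing the window of `S` from `0` or from `t x` and the bound `(n+3)/2` for the window
of `A`, which suffice for the rectification; Lemma 26 is obtained from the tree's Lev–Smeliansky
theorem (Nathanson Thm 4.8) rather than as an exercise.  In Lemma 24, "`A` generates `G`"
is proved by splitting `S` along `⟨A⟩` (both parts of `A + S` would be single translates of `A`)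
instead of the printed appeal to Lemma 10 in `⟨A⟩`, "`3`-separable" is implied by the atom, and
the sets `N_i^X` are realised as the fibres of `u ↦ {s ∈ S : u − s ∈ A + (i−1)S}` over the pairs
`S* ∖ {x}` and `S*`.  In Theorem 28 (Cases 1–2) the hypotheses "`S` generating", "`3`-separable"
and the order condition on `S ∖ 0` are not used (the atom `A` is given and generating) and are
not repeated; the room `|S| + |A| ≤ n − 4` for the final appeal to Lemma 25 when `|A| = 4`, not
discussed in print, is supplied by the dual fragment.  In Claim 2 the hypothesis `gcd(|G|, 6) = 1`
is weakened to "every non-zero element has order `≥ 3`" (what Corollary 9 with `k = 3` uses),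
`4 ≤ |S| ≤ n − 7` and "`3`-separable" are not used, and the printed ordering
"`|S_1 + A| ≤ |S_2 + A| ≤ ⋯`" with `0 ∈ S_1` is replaced by comparing the coset of `0` with the
coset of an element of `S` outside `K` (which gives `|S| ≥ |K|` directly).  In Case 3 the
Chowla counts in the cosets of `B` are the Kneser consequence above, "`|V| ≤ 2`" versus "`|V| ≥ 3`"
is the chain `5 ≤ |G ∖ (A+S)| ≤ Σ (5 − |S_i + A_0|) ≤ Σ 2·[|S_i + A_0| < 5] ≤ Σ (|S_i + A_0| − |S_i|)
≤ 5` (even middle term), and "it follows easily that `S ∖ {0}` is periodic or quasi-periodic" is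
the count `|S* + A_0| ≤ |S*| + 1 ⇒ |S* + B| ≤ |S*| + 1`.  Theorem 28 records the inclusions only
(not that `S` is not a genuine progression, resp. that `S*` is not periodic).
Census-silent Literature shelf: no row, bracket, threshold or verdict word of the cell moves; no `ω`.
-/

namespace Literature.Combinatorics.Additive

open Finset
open scoped Pointwise

namespace Isoperimetric

variable {G : Type*} [AddCommGroup G] [Fintype G] [DecidableEq G] {B : Finset G}

/-! ### §6, Lemma 23: the `4`-atoms of a `3`-set with `κ₄ = 3` have four elements -/

omit [Fintype G] in
/-- A `3`-set containing `0` is `{0, a, b}` with `a, b ≠ 0`, `a ≠ b`. [folklore] -/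
private theorem exists_eq_triple_of_card_eq_three {S : Finset G} (h0 : (0 : G) ∈ S)
    (hS3 : #S = 3) : ∃ a b : G, a ≠ 0 ∧ b ≠ 0 ∧ a ≠ b ∧ S = {0, a, b} := by
  obtain ⟨x, y, z, hxy, hxz, hyz, hxyz⟩ := card_eq_three.1 hS3
  have h0' := h0
  rw [hxyz, mem_insert, mem_insert, mem_singleton] at h0'
  rcases h0' with h | h | h
  · exact ⟨y, z, fun e => hxy (h.symm.trans e.symm), fun e => hxz (h.symm.trans e.symm), hyz,
      by rw [hxyz, h]⟩
  · refine ⟨x, z, fun e => hxy (e.trans h), fun e => hyz (h.symm.trans e.symm), hxz, ?_⟩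
    rw [hxyz, ← h]
    exact insert_comm _ _ _
  · refine ⟨x, y, fun e => hxz (e.trans h), fun e => hyz (e.trans h), hxy, ?_⟩
    rw [hxyz, ← h]
    ext v; simp only [mem_insert, mem_singleton]; tauto

/-- **[HamidouneSerraZemor2008, §6, Lemma 23]:** "Let `S` be a `4`-separable generating subset of a
finite abelian group such that `0 ∈ S` and `κ₄(S) = |S| = 3`.  Let `0 ∈ A` be a `4`-atom of `S`.
Then `|A| = 4`."  Proof as printed: if `|A| > 4`, Lemma 4 gives `A + S = A + {0, z} = A ∪ (A + z)`
for each `z ∈ S*`, so `N₁(A, S) − S* ⊆ A`, Lemma 17 lifts this to `N₂(A, S) − S* ⊆ N₁`, and the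
Fainting Lemma (`|Y| = 3`, `m = 0`) gives `|G| ≤ |A| + 6`, against `|A + S| = |A| + 3 ≤ |G| − 4`.
[cite: HamidouneSerraZemor2008, §6, Lemma 23] -/
theorem IsAtom.card_eq_four_of_conn_four_eq_three {S : Finset G} (h0 : (0 : G) ∈ S)
    (hgen : AddSubgroup.closure (S : Set G) = ⊤) (hS3 : #S = 3) (hκ : conn 4 S = 3)
    {A : Finset G} (hA : IsAtom 4 S A) (h0A : (0 : G) ∈ A) : #A = 4 := by
  classical
  have hAa := hA.1.1
  unfold IsAdm at hAa
  have hAf := hA.1.2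
  by_contra hA4
  have hlt : 4 < #A := by omega
  obtain ⟨a, b, ha, hb, hab, hSeq⟩ := exists_eq_triple_of_card_eq_three h0 hS3
  have hAS : #(A + S) = #A + 3 + 0 := by
    have := card_le_card_add h0 A
    omega
  -- `A + S = A + S*`
  have hii : A + S = A + S.erase 0 := (hA.add_erase_eq_of_lt_card h0 hlt 0).symm
  have hSe : S.erase 0 = {a, b} := by
    rw [hSeq, erase_insert]
    simp only [mem_insert, mem_singleton, not_or]
    exact ⟨ha.symm, hb.symm⟩
  -- `N₁(A, S) − z ⊆ A` for `z ∈ S*`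
  have hP : ∀ x ∈ (A + S) \ A, ∀ z ∈ S.erase 0, x + -z ∈ A := by
    intro x hx z hz
    rw [mem_sdiff] at hx
    rw [mem_erase] at hz
    -- the other non-zero element `z'`, and `A + S = A + {0, z}`
    obtain ⟨z', hz'S, hSzz⟩ : ∃ z' ∈ S, S.erase z' = {0, z} := by
      rw [hSeq, mem_insert, mem_insert, mem_singleton] at hz
      rcases hz.2 with h | h | h
      · exact absurd h hz.1
      · refine ⟨b, by rw [hSeq]; simp, ?_⟩
        rw [hSeq, h]
        ext v
        simp only [mem_erase, mem_insert, mem_singleton]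
        constructor
        · rintro ⟨h1, h2 | h2 | h2⟩
          · exact Or.inl h2
          · exact Or.inr h2
          · exact absurd h2 h1
        · rintro (h1 | h1)
          · exact ⟨by rw [h1]; exact hb.symm, Or.inl h1⟩
          · exact ⟨by rw [h1]; exact hab, Or.inr (Or.inl h1)⟩
      · refine ⟨a, by rw [hSeq]; simp, ?_⟩
        rw [hSeq, h]
        ext v
        simp only [mem_erase, mem_insert, mem_singleton]
        constructor
        · rintro ⟨h1, h2 | h2 | h2⟩
          · exact Or.inl h2
          · exact absurd h2 h1
          · exact Or.inr h2
        · rintro (h1 | h1)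
          · exact ⟨by rw [h1]; exact ha.symm, Or.inl h1⟩
          · exact ⟨by rw [h1]; exact fun e => hab e.symm, Or.inr (Or.inr h1)⟩
    have h1 : A + S = A + {0, z} := by rw [← hSzz, hA.add_erase_eq_of_lt_card h0 hlt z']
    have hx' : x ∈ A + {0, z} := by rw [← h1]; exact hx.1
    obtain ⟨a', ha', w, hw, rfl⟩ := mem_add.1 hx'
    rw [mem_insert, mem_singleton] at hw
    rcases hw with rfl | rfl
    · exact absurd (by rwa [add_zero]) hx.2
    · rw [add_neg_cancel_right]; exact ha'
  have hN := layer_step hP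
  subst hSeq
  have hfaint := fainting_three h0A ha hb hgen hAS (by rw [hii, hSe]) hN
  norm_num at hfaint
  omega

/-! ### Cyclic groups: a distinguished generator `r`, runs and progressions of difference `r` -/

omit [DecidableEq G] in
/-- In a finite abelian group generated by `r`, the order of `r` is `|G|`.
[cite: HamidouneSerraZemor2008, §7 (proof of Lemma 25: "`ℤ_n = ⟨S⟩ = ⟨d⟩`")] -/
theorem addOrderOf_eq_card_of_zmultiples_eq_top {r : G} (hr : AddSubgroup.zmultiples r = ⊤) :
    addOrderOf r = Fintype.card G := by
  rw [← Nat.card_eq_fintype_card]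
  exact addOrderOf_eq_card_of_forall_mem_zmultiples fun x => by rw [hr]; exact AddSubgroup.mem_top x

omit [Fintype G] in
/-- A progression of difference `d` with at most `o(d)` terms has exactly that many elements.
[cite: Nathanson1996, §2.5 ("the order of the group element `d` in `G` must be at least `k`")] -/
theorem card_apFinset_of_le_addOrderOf (a d : G) {n : ℕ} (hn : n ≤ addOrderOf d) :
    #(apFinset a d n) = n := by
  have : apFinset a d n = (range n).image fun i : ℕ => a + i • d := rfl
  rw [this, card_image_of_injOn, card_range]
  intro i hi j hj hij
  have hi' : i < addOrderOf d := lt_of_lt_of_le (mem_range.1 (mem_coe.1 hi)) hn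
  have hj' : j < addOrderOf d := lt_of_lt_of_le (mem_range.1 (mem_coe.1 hj)) hn
  have hij' : i • d = j • d := add_left_cancel hij
  exact nsmul_injOn_Iio_addOrderOf (Set.mem_Iio.2 hi') (Set.mem_Iio.2 hj') hij'

/-- In `G = ⟨r⟩` a nonempty `r`-invariant set is everything. [cite: HamidouneSerraZemor2008, §7
(proof of Lemma 25, Case 2: "a union of cosets modulo the subgroup generated by …")] -/
theorem eq_univ_of_vadd_eq_of_zmultiples_eq_top {r : G} (hr : AddSubgroup.zmultiples r = ⊤)
    {P : Finset G} (hP : P.Nonempty) (h : r +ᵥ P = P) : P = univ := by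
  refine eq_univ_of_add_eq_of_closure_eq_top hP (Y := {r}) ?_ ?_
  · rw [coe_singleton, ← AddSubgroup.zmultiples_eq_closure, hr]
  · rw [add_comm, singleton_add]; exact h

/-- In `G = ⟨r⟩` a nonempty proper subset `X` has at least one run-end in direction `r`:
`|(r + X) ∖ X| ≥ 1`. [cite: HamidouneSerraZemor2008, §7 (connected components of a proper subset
of `ℤ_n`)] -/
theorem one_le_card_vadd_sdiff_of_zmultiples_eq_top {r : G} (hr : AddSubgroup.zmultiples r = ⊤)
    {X : Finset G} (hX : X.Nonempty) (hXu : X ≠ univ) : 1 ≤ #((r +ᵥ X) \ X) := by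
  rw [Nat.one_le_iff_ne_zero]
  intro h0
  rw [card_eq_zero, sdiff_eq_empty_iff_subset] at h0
  have heq : r +ᵥ X = X := eq_of_subset_of_card_le h0 (by rw [card_vadd_finset])
  exact hXu (eq_univ_of_vadd_eq_of_zmultiples_eq_top hr hX heq)

/-- In `G = ⟨r⟩` a proper subset with at most one run-end in direction `r` IS an `r`-progression:
`X = {s, s + r, …, s + (|X| − 1) r}`.  Via [Hamidoune2000, Lemma 6.1]
(`exists_eq_filter_union_apFinset_of_card_vadd_sdiff_eq_one`), the periodic part being empty.
[cite: HamidouneSerraZemor2008, §7 ("connected components … maximal arithmetic progressions with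
difference 1")] -/
theorem exists_eq_apFinset_of_card_vadd_sdiff_le_one_of_zmultiples_eq_top {r : G}
    (hr : AddSubgroup.zmultiples r = ⊤) {X : Finset G} (hXu : X ≠ univ)
    (h1 : #((r +ᵥ X) \ X) ≤ 1) : ∃ s : G, X = apFinset s r #X := by
  classical
  rcases X.eq_empty_or_nonempty with rfl | hX
  · exact ⟨0, by rw [card_empty, apFinset_zero]⟩
  have h1' : #((r +ᵥ X) \ X) = 1 :=
    le_antisymm h1 (one_le_card_vadd_sdiff_of_zmultiples_eq_top hr hX hXu)
  obtain ⟨s, -, ℓ, -, hXeq, hPinv, hAPcard, -⟩ :=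
    exists_eq_filter_union_apFinset_of_card_vadd_sdiff_eq_one h1'
  set P := X.filter fun x => x +ᵥ apFinset (0 : G) r (addOrderOf r) ⊆ X
  rcases P.eq_empty_or_nonempty with hP0 | hPne
  · refine ⟨s, ?_⟩
    have hX' : X = apFinset s r ℓ := by rw [hXeq, hP0, empty_union]
    have : #X = ℓ := by rw [hX', hAPcard]
    rw [this]; exact hX'
  · exfalso
    have hPu := eq_univ_of_vadd_eq_of_zmultiples_eq_top hr hPne hPinv
    apply hXu
    exact eq_univ_of_forall fun x => by
      rw [hXeq]; exact mem_union_left _ (by rw [hPu]; exact mem_univ x)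

/-! ### §7: an arithmetic progression is transferred, as an almost-progression with the SAME
difference, across a sumset one above the Cauchy–Davenport bound (cyclic groups of any order) -/

/-- **A progression forces an almost-progression with the same difference, in any cyclic group**
([HamidouneRodseth2000, Lemma 1] beyond prime order; the step "`A` is a progression and thus `S` is
a quasi-progression" of [HamidouneSerraZemor2008, §8]): in `G = ⟨r⟩`, if `B` is an `r`-progression
with `|B| ≥ 3`, `A ≠ ∅`, `|A + B| ≤ |A| + |B|` and `|A + B| < |G|`, then
`A ⊆ {a, a + r, …, a + |A| r}` for some `a`.  Proof as for `subset_apFinset_of_isAP_of_card_add_le`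
(the `ℤ/pℤ` case): the chain `R j = A + {0, r, …, j r}` grows by at least one at each step while
proper, so `h(A) + h(R 1) ≤ 3` for `h(X) = |(r + X) ∖ X|`; one run, or two runs merging after one
step. [cite: HamidouneSerraZemor2008, §8, proof of Theorem 28, Cases 1–2 ("`A` is a progression and
thus `S` is a quasi-progression")] [cite: HamidouneRodseth2000, §2, Lemma 1] -/
theorem subset_apFinset_of_isAP_of_card_add_le_of_zmultiples {r : G}
    (hr : AddSubgroup.zmultiples r = ⊤) {A B : Finset G} (hB : IsAP B r) (hB3 : 3 ≤ #B)
    (hA : A.Nonempty) (hAB : #(A + B) ≤ #A + #B) (hABn : #(A + B) < Fintype.card G) :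
    ∃ a : G, A ⊆ apFinset a r (#A + 1) := by
  classical
  have hord : addOrderOf r = Fintype.card G := addOrderOf_eq_card_of_zmultiples_eq_top hr
  obtain ⟨b₀, hBeq⟩ := hB
  set ℓ := #B with hℓ
  set P : Finset G := apFinset 0 r ℓ with hP
  have hBP : B = b₀ +ᵥ P := by rw [hBeq, hP, apFinset_eq_vadd]
  have hABP : A + B = b₀ +ᵥ (A + P) := by rw [hBP, add_comm A, vadd_add_assoc, add_comm P A]
  have hcardAP : #(A + P) = #(A + B) := by rw [hABP, card_vadd_finset]
  -- iterated one-step sumsets `R j = A + {0, r, …, j r}`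
  obtain ⟨R, hR0, hRs⟩ : ∃ R : ℕ → Finset G, R 0 = A ∧ ∀ j, R (j + 1) = R j + {0, r} :=
    ⟨fun n => Nat.rec A (fun _ X => X + {0, r}) n, rfl, fun _ => rfl⟩
  have hRsub : ∀ j, R j ⊆ A + apFinset 0 r (j + 1) := by
    intro j
    induction j with
    | zero =>
      rw [hR0]
      intro x hx
      exact mem_add.2 ⟨x, hx, 0, mem_apFinset.2 ⟨0, by omega, by simp⟩, by simp⟩
    | succ j ih =>
      rw [hRs]
      calc R j + {0, r} ⊆ A + apFinset 0 r (j + 1) + {0, r} := add_subset_add_right ih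
        _ = A + (apFinset 0 r (j + 1) + {0, r}) := add_assoc _ _ _
        _ ⊆ A + apFinset 0 r (j + 1 + 1) := add_subset_add_left (apFinset_add_pair_zero_subset 0 r _)
  have hRAP : ∀ j, j + 1 ≤ ℓ → R j ⊆ A + P := fun j hj =>
    (hRsub j).trans (add_subset_add_left (apFinset_mono 0 r hj))
  have hRmono : ∀ j, R j ⊆ R (j + 1) := fun j => by
    rw [hRs]; exact subset_add_left _ (by simp)
  have hRne : ∀ j, (R j).Nonempty := by
    intro j
    induction j with
    | zero => rw [hR0]; exact hA
    | succ j ih => exact ih.mono (hRmono j)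
  have hRnu : ∀ j, j + 1 ≤ ℓ → R j ≠ univ := by
    intro j hj hu
    have := card_le_card (hRAP j hj)
    rw [hu, card_univ, hcardAP] at this
    omega
  have hRcard : ∀ j, #(R (j + 1)) = #(R j) + #((r +ᵥ R j) \ R j) := fun j => by
    rw [hRs, card_add_pair_zero_eq]
  have hRgrow : ∀ j, j + 1 ≤ ℓ → #(R j) + 1 ≤ #(R (j + 1)) := fun j hj => by
    rw [hRcard]
    have := one_le_card_vadd_sdiff_of_zmultiples_eq_top hr (hRne j) (hRnu j hj)
    omega
  -- `|R (ℓ-1)| ≥ |R 2| + (ℓ - 3)`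
  have hchain : ∀ j, 2 ≤ j → j + 1 ≤ ℓ → #(R 2) + (j - 2) ≤ #(R j) := by
    intro j hj2 hjℓ
    induction j with
    | zero => omega
    | succ j ih =>
      rcases Nat.eq_or_lt_of_le hj2 with h | h
      · rw [← h]; simp
      · have h1 := ih (by omega) (by omega)
        have h2 := hRgrow j (by omega)
        omega
  have htop : #(R (ℓ - 1)) ≤ #A + ℓ := by
    have := card_le_card (hRAP (ℓ - 1) (by omega))
    rw [hcardAP] at this
    omega
  have hR2 : #(R 2) = #A + #((r +ᵥ A) \ A) + #((r +ᵥ R 1) \ R 1) := by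
    rw [show (2 : ℕ) = 1 + 1 from rfl, hRcard, show (1 : ℕ) = 0 + 1 from rfl, hRcard, hR0]
  have hkey : #((r +ᵥ A) \ A) + #((r +ᵥ R 1) \ R 1) ≤ 3 := by
    have := hchain (ℓ - 1) (by omega) (by omega)
    omega
  have h1R1 : 1 ≤ #((r +ᵥ R 1) \ R 1) :=
    one_le_card_vadd_sdiff_of_zmultiples_eq_top hr (hRne 1) (hRnu 1 (by omega))
  have hAnu : A ≠ univ := by rw [← hR0]; exact hRnu 0 (by omega)
  -- case `A` has one run: `A` is a progression
  by_cases hA1 : #((r +ᵥ A) \ A) ≤ 1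
  · obtain ⟨s, hAs⟩ := exists_eq_apFinset_of_card_vadd_sdiff_le_one_of_zmultiples_eq_top hr hAnu hA1
    exact ⟨s, (subset_of_eq hAs).trans (apFinset_mono s r (by omega))⟩
  -- case `A` has two runs which merge after one step: `A ∪ (r + A)` is one run of length `|A| + 2`
  · have hA2 : #((r +ᵥ A) \ A) = 2 := by omega
    have hR1one : #((r +ᵥ R 1) \ R 1) ≤ 1 := by omega
    obtain ⟨s, hR1s⟩ :=
      exists_eq_apFinset_of_card_vadd_sdiff_le_one_of_zmultiples_eq_top hr (hRnu 1 (by omega)) hR1one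
    have hR1card : #(R 1) = #A + 2 := by
      rw [show (1 : ℕ) = 0 + 1 from rfl, hRcard, hR0, hA2]
    have hR1lt : #(R 1) < Fintype.card G := by
      have := card_lt_card (ssubset_univ_iff.2 (hRnu 1 (by omega)))
      rwa [card_univ] at this
    set n := #(R 1) with hn
    -- the last point of the run `R 1` is not in `A`
    have hAR1 : A ⊆ R 1 := by rw [← hR0]; exact hRmono 0
    have hdA : r +ᵥ A ⊆ R 1 := by
      rw [show (1 : ℕ) = 0 + 1 from rfl, hRs, hR0]
      intro x hx
      obtain ⟨a, ha, rfl⟩ := mem_vadd_finset.1 hx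
      exact mem_add.2 ⟨a, ha, r, by simp, by rw [vadd_eq_add, add_comm]⟩
    have hlast : s + (n - 1) • r ∉ A := by
      intro hmem
      have h1 : s + (n - 1) • r + r ∈ R 1 := by
        apply hdA
        exact mem_vadd_finset.2 ⟨_, hmem, by rw [vadd_eq_add, add_comm]⟩
      rw [hR1s, mem_apFinset] at h1
      obtain ⟨i, hi, he⟩ := h1
      -- `s + i r = s + n r` with `i < n < |G| = o(r)`: impossible
      have e1 : s + (n - 1) • r + r = s + n • r := by
        rw [show n = (n - 1) + 1 from by omega, succ_nsmul]
        simp only [Nat.add_sub_cancel]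
        abel
      rw [e1] at he
      have he' : i • r = n • r := add_left_cancel he
      have hi' : i < addOrderOf r := by rw [hord]; omega
      have hn' : n < addOrderOf r := by rw [hord]; exact hR1lt
      have := nsmul_injOn_Iio_addOrderOf (Set.mem_Iio.2 hi') (Set.mem_Iio.2 hn') he'
      omega
    refine ⟨s, fun x hx => ?_⟩
    have hxR : x ∈ R 1 := hAR1 hx
    rw [hR1s, mem_apFinset] at hxR
    obtain ⟨i, hi, rfl⟩ := hxR
    have hine : i ≠ n - 1 := by
      rintro rfl
      exact hlast hx
    exact mem_apFinset.2 ⟨i, by omega, rfl⟩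

/-! ### Runs in a cyclic group: disjointness of maximal runs, sub-runs, complements of progressions -/

omit [Fintype G] in
/-- Two maximal `d`-runs of `B` issued from distinct run-starts are disjoint (with `ℓ` any length
function whose runs stay inside `B`, as produced by `eq_filter_union_biUnion_apFinset`).
[cite: Hamidoune2000, §6, Lemma 6.1 ("`B` is a disjoint union of `T + K, P₁, …, P_j`")] -/
theorem disjoint_apFinset_of_sub_notMem {B : Finset G} {d : G} {ℓ : G → ℕ}
    (hsub : ∀ s, apFinset s d (ℓ s) ⊆ B) {s s' : G} (hs : s - d ∉ B) (hs' : s' - d ∉ B)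
    (hne : s ≠ s') : Disjoint (apFinset s d (ℓ s)) (apFinset s' d (ℓ s')) := by
  -- the one-sided statement
  have key : ∀ s s' : G, s - d ∉ B → s ≠ s' → ∀ i i' : ℕ, i ≤ i' → i' < ℓ s' →
      s' + i' • d = s + i • d → False := by
    intro s s' hs hne i i' hii' hi' he
    obtain ⟨m, rfl⟩ : ∃ m, i' = i + m := ⟨i' - i, by omega⟩
    rcases Nat.eq_zero_or_pos m with rfl | hm
    · apply hne
      rw [add_zero] at he
      exact (add_right_cancel he).symm
    · obtain ⟨m', rfl⟩ : ∃ m', m = m' + 1 := ⟨m - 1, by omega⟩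
      have e2 : s = s' + d + m' • d := by
        apply add_right_cancel (b := i • d)
        rw [← he, add_nsmul, add_nsmul, one_nsmul]
        abel
      apply hs
      have : s - d = s' + m' • d := by rw [e2]; abel
      rw [this]
      exact hsub s' (mem_apFinset.2 ⟨m', by omega, rfl⟩)
  rw [disjoint_left]
  intro x hx hx'
  obtain ⟨i, hi, rfl⟩ := mem_apFinset.1 hx
  obtain ⟨i', hi', he⟩ := mem_apFinset.1 hx'
  rcases le_or_gt i i' with h | h
  · exact key s s' hs hne i i' h hi' he
  · exact key s' s hs' hne.symm i' i h.le hi he.symm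

omit [Fintype G] in
/-- A run with `L` distinct points has `m` distinct points among its first `m ≤ L`.
[cite: Nathanson1996, §2.5 (arithmetic progressions)] -/
theorem card_apFinset_of_le_of_card_apFinset_eq {s d : G} {L : ℕ} (hL : #(apFinset s d L) = L)
    {m : ℕ} (hm : m ≤ L) : #(apFinset s d m) = m := by
  have hdef : ∀ n, apFinset s d n = (range n).image fun i : ℕ => s + i • d := fun n => rfl
  have hinj : Set.InjOn (fun i : ℕ => s + i • d) (range L) :=
    card_image_iff.1 (by rw [card_range, ← hdef]; exact hL)
  rw [hdef m, card_image_of_injOn (hinj.mono (coe_subset.2 (range_subset_range.2 hm))), card_range]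

/-- In `G = ⟨r⟩` the subgroup finset `{0, r, 2r, …}` is everything.
[cite: HamidouneSerraZemor2008, §7 (proof of Lemma 25: "`ℤ_n = ⟨S⟩ = ⟨d⟩`")] -/
theorem apFinset_zero_addOrderOf_eq_univ {r : G} (hr : AddSubgroup.zmultiples r = ⊤) :
    apFinset (0 : G) r (addOrderOf r) = univ := by
  rw [← coe_inj, ← coe_zmultiples_eq_coe_apFinset r, hr, coe_univ]; rfl

/-- In `G = ⟨r⟩` a proper subset contains no `⟨r⟩`-coset: the periodic part of
[Hamidoune2000, Lemma 6.1] is empty. [cite: Hamidoune2000, §6, Lemma 6.1] -/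
theorem filter_vadd_apFinset_subset_eq_empty {r : G} (hr : AddSubgroup.zmultiples r = ⊤)
    {X : Finset G} (hXu : X ≠ univ) :
    X.filter (fun x => x +ᵥ apFinset (0 : G) r (addOrderOf r) ⊆ X) = ∅ := by
  rw [filter_eq_empty_iff]
  intro x _ hsub
  rw [apFinset_zero_addOrderOf_eq_univ hr, vadd_finset_univ] at hsub
  exact hXu (univ_subset_iff.1 hsub)

/-- In `G = ⟨r⟩`, `|G| = n`: the complement of the `r`-progression `{a, …, a + (ℓ−1) r}` (`ℓ ≤ n`)
is the `r`-progression `{a + ℓ r, …, a + (n−1) r}` of length `n − ℓ`.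
[cite: HamidouneSerraZemor2008, §7 (proof of Lemma 25, Case 1: the components of `ℤ_n ∖ T`)] -/
theorem univ_sdiff_apFinset_of_zmultiples {r : G} (hr : AddSubgroup.zmultiples r = ⊤) (a : G)
    {ℓ : ℕ} (hℓ : ℓ ≤ Fintype.card G) :
    univ \ apFinset a r ℓ = apFinset (a + ℓ • r) r (Fintype.card G - ℓ) := by
  classical
  have hord : addOrderOf r = Fintype.card G := addOrderOf_eq_card_of_zmultiples_eq_top hr
  set n := Fintype.card G with hn
  have hfullcard : #(apFinset a r n) = n := card_apFinset_of_le_addOrderOf a r (by rw [hord])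
  have hfull : apFinset a r n = univ := eq_univ_of_card _ hfullcard
  have hsplit : apFinset a r n = apFinset a r ℓ ∪ apFinset (a + ℓ • r) r (n - ℓ) := by
    rw [← apFinset_add_eq_union, Nat.add_sub_cancel' hℓ]
  have h1 : #(apFinset a r ℓ) = ℓ := card_apFinset_of_le_addOrderOf a r (by rw [hord]; exact hℓ)
  have h2 : #(apFinset (a + ℓ • r) r (n - ℓ)) = n - ℓ :=
    card_apFinset_of_le_addOrderOf _ r (by rw [hord]; omega)
  have hdisj : Disjoint (apFinset a r ℓ) (apFinset (a + ℓ • r) r (n - ℓ)) := by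
    rw [disjoint_iff_inter_eq_empty, ← card_eq_zero]
    have := card_union_add_card_inter (apFinset a r ℓ) (apFinset (a + ℓ • r) r (n - ℓ))
    rw [← hsplit, hfullcard, h1, h2] at this
    omega
  ext x
  rw [mem_sdiff]
  simp only [mem_univ, true_and]
  constructor
  · intro hx
    have : x ∈ apFinset a r n := by rw [hfull]; exact mem_univ x
    rw [hsplit, mem_union] at this
    exact this.resolve_left hx
  · intro hx
    exact disjoint_right.1 hdisj hx

/-! ### §7, Lemma 25: a quasi-progression is transferred, as an almost-progression with the SAME
difference, across a sumset one above the Cauchy–Davenport bound -/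

/-- **[HamidouneSerraZemor2008, §7, Lemma 25] — oriented core.**  In `G = ⟨r⟩` (`|G| = n ≠ 12`),
let `S' = {0, r, …, (j−1) r} ∪ {(j+1) r, …, k r}` (`k ≥ 3` points of the progression
`{0, …, k r}` with the interior point `j r` removed, `j + 1 ≤ k ≤ 2j`, `k + 1 ≤ n`), and let `T`
have `|T| ≥ 3`, `|T + S'| ≤ |T| + k` and `|T| + k + 4 ≤ n`.  Then `T ⊆ {b, b + r, …, b + |T| r}`
for some `b` (i.e. `T` is an `r`-progression or an `r`-quasi-progression).  Proof (the printed
Cases 1/2, organized through the runs of `G ∖ T`): with `ℓ_s` the lengths of the maximal `r`-runs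
of `G ∖ T` (the "connected components of `T̄`"), `T_k = T + {0, …, k r}` and
`D = T_k ∖ (T + S')`, every `x ∈ D` is `u + j r` for an isolated point `u` of `T` followed by a gap
of length `≥ j` and preceded by one of length `≥ k − j`; `|T_k| ≥ |T| + Σ_s min(ℓ_s, k)` gives
`Σ_s min(ℓ_s, k) ≤ k + |D|` while at least `|D|` gaps have length `≥ j ≥ 2`.  Case 1 (a gap of
length `≥ k`): at most two gaps, the other of length `1`, so `T` lies in the complement of one run,
a progression of length `≤ |T| + 1`.  Case 2 (all gaps `< k`): `T_k = G`, `|D| ≥ 4`, forcing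
`j = 2`, `k = 4`, four gaps of length `2` and `|T| = 4`, i.e. `n = 12` (the printed exception (ii),
"`n = 12` and `T` is a coset of order `4`"), excluded.
[cite: HamidouneSerraZemor2008, §7, Lemma 25] -/
theorem subset_apFinset_of_card_add_quasi_le_core {r : G} (hr : AddSubgroup.zmultiples r = ⊤)
    {k j : ℕ} (hk3 : 3 ≤ k) (hjk : j + 1 ≤ k) (h2j : k ≤ 2 * j) (hkn : k + 1 ≤ Fintype.card G)
    (h12 : Fintype.card G ≠ 12) {T : Finset G} (hT3 : 3 ≤ #T)
    (hTS : #(T + (apFinset 0 r j ∪ apFinset ((j + 1) • r) r (k - j))) ≤ #T + k)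
    (hroom : #T + k + 4 ≤ Fintype.card G) : ∃ b : G, T ⊆ apFinset b r (#T + 1) := by
  classical
  have hord : addOrderOf r = Fintype.card G := addOrderOf_eq_card_of_zmultiples_eq_top hr
  set n := Fintype.card G with hn
  have hj2 : 2 ≤ j := by omega
  set U := T + (apFinset 0 r j ∪ apFinset ((j + 1) • r) r (k - j)) with hU
  set Tk := T + apFinset (0 : G) r (k + 1) with hTk
  have hTne : T.Nonempty := card_pos.1 (by omega)
  have hTnu : T ≠ univ := by
    intro h
    rw [h, card_univ] at hroom
    omega
  have hcTne : univ \ T ≠ univ := by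
    intro h
    obtain ⟨t, ht⟩ := hTne
    have : t ∈ univ \ T := by rw [h]; exact mem_univ t
    exact (mem_sdiff.1 this).2 ht
  -- Step 0: `U ⊆ Tk`, `T ⊆ Tk`
  have hUTk : U ⊆ Tk := by
    apply add_subset_add_left
    apply union_subset
    · exact apFinset_mono 0 r (by omega)
    · intro x hx
      obtain ⟨i, hi, rfl⟩ := mem_apFinset.1 hx
      exact mem_apFinset.2 ⟨j + 1 + i, by omega, by rw [zero_add, add_nsmul]⟩
  have hTTk : T ⊆ Tk := fun x hx =>
    mem_add.2 ⟨x, hx, 0, mem_apFinset.2 ⟨0, by omega, by rw [zero_nsmul, add_zero]⟩, add_zero x⟩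
  have hUcard : #U ≤ #T + k := hTS
  -- membership criteria for the two halves of `S'`
  have hmemT1 : ∀ x, x ∉ T + apFinset 0 r j → ∀ i < j, x - i • r ∉ T := by
    intro x hx i hi hmem
    exact hx (mem_add.2 ⟨x - i • r, hmem, i • r, mem_apFinset.2 ⟨i, hi, by rw [zero_add]⟩,
      by rw [sub_add_cancel]⟩)
  have hmemT2 : ∀ x, x ∉ T + apFinset ((j + 1) • r) r (k - j) →
      ∀ i < k - j, x - (j + 1 + i) • r ∉ T := by
    intro x hx i hi hmem
    exact hx (mem_add.2 ⟨_, hmem, (j + 1) • r + i • r, mem_apFinset.2 ⟨i, hi, rfl⟩,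
      by rw [add_nsmul, sub_add_cancel]⟩)
  -- Step 1: the points of `D = Tk ∖ U`
  set D := Tk \ U with hD
  have hDcard : #D + #U = #Tk := card_sdiff_add_card_eq_card hUTk
  have hDpt : ∀ x ∈ D, x - j • r ∈ T ∧ (∀ i, 1 ≤ i → i ≤ j → x - j • r + i • r ∉ T) ∧
      (∀ i, 1 ≤ i → i ≤ k - j → x - j • r - i • r ∉ T) := by
    intro x hx
    rw [hD, mem_sdiff, hU, add_union, mem_union, not_or] at hx
    obtain ⟨hxTk, hx1, hx2⟩ := hx
    have h1 := hmemT1 x hx1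
    have h2 := hmemT2 x hx2
    refine ⟨?_, ?_, ?_⟩
    · obtain ⟨v, hv, y, hy, rfl⟩ := mem_add.1 hxTk
      obtain ⟨i, hi, hyi⟩ := mem_apFinset.1 hy
      rw [zero_add] at hyi
      subst hyi
      rcases Nat.lt_trichotomy i j with h | h | h
      · have := h1 i h
        rw [add_sub_cancel_right] at this
        exact absurd hv this
      · rw [h, add_sub_cancel_right]; exact hv
      · have := h2 (i - j - 1) (by omega)
        rw [show j + 1 + (i - j - 1) = i from by omega, add_sub_cancel_right] at this
        exact absurd hv this
    · intro i hi1 hij hmem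
      apply h1 (j - i) (by omega)
      have : x - (j - i) • r = x - j • r + i • r := by
        rw [sub_nsmul _ hij]; abel
      rw [this]; exact hmem
    · intro i hi1 hik hmem
      apply h2 (i - 1) (by omega)
      have : x - (j + 1 + (i - 1)) • r = x - j • r - i • r := by
        rw [show j + 1 + (i - 1) = j + i from by omega, add_nsmul]; abel
      rw [this]; exact hmem
  -- the runs of `G ∖ T` (gaps of `T`) and of `T`
  obtain ⟨ℓ, hcov, -, hStcard, hrunsub, hrun⟩ := eq_filter_union_biUnion_apFinset (univ \ T) r
  rw [filter_vadd_apFinset_subset_eq_empty hr hcTne, empty_union] at hcov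
  set St := (univ \ T).filter (fun s => s - r ∉ univ \ T) with hSt
  have hmemSt : ∀ s, s ∈ St ↔ s ∉ T ∧ s - r ∈ T := by
    intro s
    rw [hSt, mem_filter, mem_sdiff, mem_sdiff]
    simp only [mem_univ, true_and, not_not]
  have hrun' : ∀ s ∈ St, 1 ≤ ℓ s ∧ #(apFinset s r (ℓ s)) = ℓ s ∧ s + ℓ s • r ∈ T := by
    intro s hs
    have hs' := (hmemSt s).1 hs
    obtain ⟨h1, h2, h3, -⟩ := hrun s (mem_sdiff.2 ⟨mem_univ _, hs'.1⟩)
      (fun h => (mem_sdiff.1 h).2 hs'.2)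
    refine ⟨h1, h2, ?_⟩
    by_contra h
    exact h3 (mem_sdiff.2 ⟨mem_univ _, h⟩)
  have hrunsub' : ∀ s, ∀ x ∈ apFinset s r (ℓ s), x ∉ T := fun s x hx =>
    (mem_sdiff.1 (hrunsub s hx)).2
  have hdisjrun : ∀ s ∈ St, ∀ s' ∈ St, s ≠ s' →
      Disjoint (apFinset s r (ℓ s)) (apFinset s' r (ℓ s')) := by
    intro s hs s' hs' hne
    exact disjoint_apFinset_of_sub_notMem hrunsub (mem_filter.1 hs).2 (mem_filter.1 hs').2 hne
  -- the run-starts of `T` and the run-start map `s ↦ s + ℓ_s r`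
  obtain ⟨μ, hcovT, -, -, hrunsubT, hrunT⟩ := eq_filter_union_biUnion_apFinset T r
  rw [filter_vadd_apFinset_subset_eq_empty hr hTnu, empty_union] at hcovT
  set StT := T.filter (fun w => w - r ∉ T) with hStT
  have hStT_sub : StT ⊆ St.image (fun s => s + ℓ s • r) := by
    intro w hw
    rw [hStT, mem_filter] at hw
    have hw' : w - r ∈ univ \ T := mem_sdiff.2 ⟨mem_univ _, hw.2⟩
    rw [hcov, mem_biUnion] at hw'
    obtain ⟨s, hs, hws⟩ := hw'
    obtain ⟨i, hi, he⟩ := mem_apFinset.1 hws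
    refine mem_image.2 ⟨s, hs, ?_⟩
    have hw_eq : w = s + (i + 1) • r := by rw [succ_nsmul, ← add_assoc, he, sub_add_cancel]
    by_contra hne
    have hi1 : i + 1 < ℓ s := by
      by_contra hge
      exact hne (by rw [hw_eq, show i + 1 = ℓ s from by omega])
    exact hrunsub' s w (mem_apFinset.2 ⟨i + 1, hi1, hw_eq.symm⟩) hw.1
  have hStT_card : #StT ≤ #St := (card_le_card hStT_sub).trans card_image_le
  have hTcov_card : #T ≤ ∑ w ∈ StT, μ w := by
    calc #T = #(StT.biUnion fun w => apFinset w r (μ w)) := by rw [← hcovT]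
      _ ≤ ∑ w ∈ StT, #(apFinset w r (μ w)) := card_biUnion_le
      _ = ∑ w ∈ StT, μ w := by
          refine sum_congr rfl fun w hw => ?_
          rw [hStT, mem_filter] at hw
          exact (hrunT w hw.1 hw.2).2.1
  -- if the run-starts of `T` are no more numerous than `D`, they are all isolated points
  have hTsmall : #StT ≤ #D → #T ≤ #StT := by
    intro hle
    set Dp := D.image (fun x => x - j • r) with hDp
    have hDp_card : #Dp = #D := card_image_of_injective _ (sub_left_injective)
    have hDp_sub : Dp ⊆ StT := by
      intro u hu
      obtain ⟨x, hx, rfl⟩ := mem_image.1 hu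
      obtain ⟨huT, -, hleft⟩ := hDpt x hx
      rw [hStT, mem_filter]
      exact ⟨huT, by simpa using hleft 1 le_rfl (by omega)⟩
    have hDp_eq : Dp = StT := eq_of_subset_of_card_le hDp_sub (by rw [hDp_card]; exact hle)
    have hμ1 : ∀ w ∈ StT, μ w = 1 := by
      intro w hw
      have hw' := hw
      rw [← hDp_eq] at hw'
      obtain ⟨x, hx, rfl⟩ := mem_image.1 hw'
      obtain ⟨-, hright, -⟩ := hDpt x hx
      rw [hStT, mem_filter] at hw
      obtain ⟨h1, -, -, -⟩ := hrunT _ hw.1 hw.2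
      by_contra hne
      have h2 : 2 ≤ μ (x - j • r) := by omega
      have : x - j • r + 1 • r ∈ T :=
        hrunsubT _ (mem_apFinset.2 ⟨1, h2, rfl⟩)
      exact hright 1 le_rfl (by omega) this
    calc #T ≤ ∑ w ∈ StT, μ w := hTcov_card
      _ = ∑ w ∈ StT, 1 := sum_congr rfl hμ1
      _ = #StT := by rw [card_eq_sum_ones]
  -- Step 2: the map `x ↦ x − j r + r` sends `D` into the run-starts of `G ∖ T` with `ℓ ≥ j`
  set StJ := St.filter (fun s => j ≤ ℓ s) with hStJ
  have hDStJ : #D ≤ #StJ := by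
    refine card_le_card_of_injOn (fun x => x - j • r + r) (fun x hx => ?_) ?_
    · obtain ⟨huT, hright, -⟩ := hDpt x (mem_coe.1 hx)
      have hs : x - j • r + r ∈ St := by
        rw [hmemSt]
        refine ⟨by simpa using hright 1 le_rfl (by omega), by rwa [add_sub_cancel_right]⟩
      simp only [mem_coe]
      rw [hStJ, mem_filter]
      refine ⟨hs, ?_⟩
      by_contra hlt
      push Not at hlt
      obtain ⟨-, -, hend⟩ := hrun' _ hs
      have : x - j • r + r + ℓ (x - j • r + r) • r = x - j • r + (ℓ (x - j • r + r) + 1) • r := by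
        rw [succ_nsmul]; abel
      rw [this] at hend
      exact hright _ (by omega) (by omega) hend
    · intro x _ y _ hxy
      simpa using hxy
  have hStJ_le : #StJ ≤ #St := card_le_card (filter_subset _ _)
  -- Step 3: the truncated gaps inside `Tk`
  set Q : G → Finset G := fun s => apFinset s r (min (ℓ s) k) with hQ
  have hQsub : ∀ s, Q s ⊆ apFinset s r (ℓ s) := fun s => apFinset_mono s r (min_le_left _ _)
  have hQcard : ∀ s ∈ St, #(Q s) = min (ℓ s) k := fun s hs =>
    card_apFinset_of_le_of_card_apFinset_eq (hrun' s hs).2.1 (min_le_left _ _)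
  have hQTk : ∀ s ∈ St, Q s ⊆ Tk := by
    intro s hs x hx
    obtain ⟨i, hi, rfl⟩ := mem_apFinset.1 hx
    have hi' : i < k := lt_of_lt_of_le hi (min_le_right _ _)
    refine mem_add.2 ⟨s - r, ((hmemSt s).1 hs).2, (i + 1) • r,
      mem_apFinset.2 ⟨i + 1, by omega, by rw [zero_add]⟩, ?_⟩
    rw [succ_nsmul]; abel
  have hQdisj : ∀ s ∈ St, ∀ s' ∈ St, s ≠ s' → Disjoint (Q s) (Q s') := fun s hs s' hs' hne =>
    (hdisjrun s hs s' hs' hne).mono (hQsub s) (hQsub s')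
  have hTkcard : #T + ∑ s ∈ St, min (ℓ s) k ≤ #Tk := by
    have hdisjT : Disjoint T (St.biUnion Q) := by
      rw [disjoint_right]
      intro x hx
      obtain ⟨s, -, hxs⟩ := mem_biUnion.1 hx
      exact hrunsub' s x (hQsub s hxs)
    calc #T + ∑ s ∈ St, min (ℓ s) k = #T + ∑ s ∈ St, #(Q s) := by
          rw [sum_congr rfl hQcard]
      _ = #T + #(St.biUnion Q) := by rw [card_biUnion hQdisj]
      _ = #(T ∪ St.biUnion Q) := (card_union_of_disjoint hdisjT).symm
      _ ≤ #Tk := card_le_card (union_subset hTTk (biUnion_subset.2 hQTk))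
  -- (★): `Σ_s min(ℓ_s, k) ≤ k + |D|`
  have hstar : ∑ s ∈ St, min (ℓ s) k ≤ k + #D := by omega
  -- `|G ∖ T| ≤ Σ_s ℓ_s`
  have hcT_card : n - #T ≤ ∑ s ∈ St, ℓ s := by
    calc n - #T = #(univ \ T) := by rw [card_univ_sdiff]
      _ = #(St.biUnion fun s => apFinset s r (ℓ s)) := by rw [← hcov]
      _ ≤ ∑ s ∈ St, #(apFinset s r (ℓ s)) := card_biUnion_le
      _ = ∑ s ∈ St, ℓ s := sum_congr rfl fun s hs => (hrun' s hs).2.1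
  have hℓn : ∀ s ∈ St, ℓ s ≤ n := fun s hs => by
    rw [← (hrun' s hs).2.1]; exact card_le_univ _
  -- Case distinction on a long gap
  by_cases hlong : ∃ s0 ∈ St, k ≤ ℓ s0
  · -- Case 1
    obtain ⟨s0, hs0, hks0⟩ := hlong
    set E := St.erase s0 with hE
    have hsum_split : ∑ s ∈ St, min (ℓ s) k = k + ∑ s ∈ E, min (ℓ s) k := by
      rw [hE, ← add_sum_erase St _ hs0, min_eq_right hks0]
    have hEsum_ge : #E + #(E.filter fun s => j ≤ ℓ s) ≤ ∑ s ∈ E, min (ℓ s) k := by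
      rw [card_eq_sum_ones E, card_filter, ← sum_add_distrib]
      refine sum_le_sum fun s hs => ?_
      have h1 := (hrun' s (mem_of_mem_erase hs)).1
      split_ifs with h
      · have : 2 ≤ min (ℓ s) k := le_min (by omega) (by omega)
        omega
      · have : 1 ≤ min (ℓ s) k := le_min h1 (by omega)
        omega
    have hEfilter : #StJ - 1 ≤ #(E.filter fun s => j ≤ ℓ s) := by
      rw [hE, filter_erase]
      exact pred_card_le_card_erase
    have hEcard : #E ≤ 1 := by omega
    -- all other gaps have length `1`
    have hEℓ : ∀ s ∈ E, ℓ s = 1 := by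
      intro s1 hs1
      have h1 := (hrun' s1 (mem_of_mem_erase hs1)).1
      by_contra hne
      have h2 : 2 ≤ min (ℓ s1) k := le_min (by omega) (by omega)
      have hD2 : 2 ≤ #D := by
        have : min (ℓ s1) k ≤ ∑ s ∈ E, min (ℓ s) k :=
          single_le_sum (f := fun s => min (ℓ s) k) (fun _ _ => Nat.zero_le _) hs1
        omega
      have hSt2 : #St ≤ 2 := by
        have := card_erase_add_one hs0
        rw [← hE] at this
        omega
      have := hTsmall (by omega)
      omega
    have hsumℓ : ∑ s ∈ St, ℓ s ≤ ℓ s0 + 1 := by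
      rw [hE] at hEcard hEℓ
      rw [← add_sum_erase St _ hs0]
      have : ∑ s ∈ St.erase s0, ℓ s = ∑ s ∈ St.erase s0, 1 := sum_congr rfl hEℓ
      rw [this, ← card_eq_sum_ones]
      omega
    -- `T` lies in the complement of the long run, a progression of length `n − ℓ s0 ≤ |T| + 1`
    refine ⟨s0 + ℓ s0 • r, ?_⟩
    have hTsub : T ⊆ univ \ apFinset s0 r (ℓ s0) := by
      intro x hx
      rw [mem_sdiff]
      exact ⟨mem_univ x, fun h => hrunsub' s0 x h hx⟩
    rw [univ_sdiff_apFinset_of_zmultiples hr s0 (hℓn s0 hs0)] at hTsub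
    exact hTsub.trans (apFinset_mono _ r (by omega))
  · -- Case 2: all gaps shorter than `k`
    push Not at hlong
    have hmin : ∀ s ∈ St, min (ℓ s) k = ℓ s := fun s hs => min_eq_left (hlong s hs).le
    have hstar' : ∑ s ∈ St, ℓ s ≤ k + #D := by
      rw [← sum_congr rfl hmin]; exact hstar
    -- `Tk = G`
    have hTk_univ : Tk = univ := by
      apply eq_univ_of_forall
      intro x
      by_cases hxT : x ∈ T
      · exact hTTk hxT
      · have hx' : x ∈ univ \ T := mem_sdiff.2 ⟨mem_univ x, hxT⟩
        rw [hcov, mem_biUnion] at hx'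
        obtain ⟨s, hs, hxs⟩ := hx'
        apply hQTk s hs
        rw [hQ]
        simp only
        rw [hmin s hs]
        exact hxs
    have hD4 : 4 ≤ #D := by
      rw [hTk_univ, card_univ] at hDcard
      omega
    -- the length count
    have hsum_ge : #St + (j - 1) * #StJ ≤ ∑ s ∈ St, ℓ s := by
      rw [card_eq_sum_ones St, hStJ, card_filter, mul_sum, ← sum_add_distrib]
      refine sum_le_sum fun s hs => ?_
      have h1 := (hrun' s hs).1
      split_ifs with h
      · rw [mul_one]; omega
      · rw [mul_zero]; omega
    have hprod : (j - 1) * 4 ≤ (j - 1) * #StJ := Nat.mul_le_mul_left _ (by omega)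
    have hj' : j = 2 := by
      set X := (j - 1) * #StJ
      omega
    subst hj'
    have hk4 : k = 4 := by
      norm_num at hsum_ge
      omega
    subst hk4
    have hD4' : #D = 4 := by norm_num at hsum_ge; omega
    have hSt4 : #St = 4 := by norm_num at hsum_ge; omega
    have hsum8 : ∑ s ∈ St, ℓ s ≤ 8 := by omega
    have hT4 : #T ≤ 4 := (hTsmall (by omega)).trans (by omega)
    -- `|T| ≥ |D| = 4`
    have hT4' : 4 ≤ #T := by
      have : #(D.image fun x => x - 2 • r) ≤ #T :=
        card_le_card fun u hu => by
          obtain ⟨x, hx, rfl⟩ := mem_image.1 hu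
          exact (hDpt x hx).1
      rw [card_image_of_injective _ (sub_left_injective)] at this
      omega
    exfalso
    apply h12
    omega

omit [Fintype G] in
/-- **A `k`-subset of a `(k+1)`-term progression is the progression with one term removed:**
`S ⊆ {a, …, a + k r}`, `|S| = k`, `k + 1 ≤ o(r)` ⇒ for some `j ≤ k`, `a + j r ∉ S` and
`S = a + ({0, …, (j−1) r} ∪ {(j+1) r, …, k r})`. [cite: HamidouneSerraZemor2008, §7 (definition
of a quasi-progression: "obtained by deleting an element of an arithmetic progression")] -/
theorem exists_eq_vadd_two_runs_of_subset_apFinset {r : G} {S : Finset G} {a : G} {k : ℕ}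
    (hSk : #S = k) (hSsub : S ⊆ apFinset a r (k + 1)) (hk : k + 1 ≤ addOrderOf r) :
    ∃ j, j ≤ k ∧ a + j • r ∉ S ∧
      S = a +ᵥ (apFinset 0 r j ∪ apFinset ((j + 1) • r) r (k - j)) := by
  classical
  have hP : #(apFinset a r (k + 1)) = k + 1 := card_apFinset_of_le_addOrderOf a r hk
  have hdiff : #(apFinset a r (k + 1) \ S) = 1 := by
    have := card_sdiff_add_card_eq_card hSsub
    omega
  obtain ⟨p, hp⟩ := card_eq_one.1 hdiff
  have hpP : p ∈ apFinset a r (k + 1) ∧ p ∉ S := by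
    have : p ∈ apFinset a r (k + 1) \ S := by rw [hp]; exact mem_singleton_self p
    exact mem_sdiff.1 this
  obtain ⟨j, hj, hpj⟩ := mem_apFinset.1 hpP.1
  refine ⟨j, by omega, by rw [hpj]; exact hpP.2, ?_⟩
  apply eq_of_subset_of_card_le
  · intro x hx
    obtain ⟨i, hi, rfl⟩ := mem_apFinset.1 (hSsub hx)
    refine mem_vadd_finset.2 ⟨i • r, ?_, rfl⟩
    rcases Nat.lt_trichotomy i j with h | h | h
    · exact mem_union_left _ (mem_apFinset.2 ⟨i, h, by rw [zero_add]⟩)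
    · exfalso; rw [h, hpj] at hx; exact hpP.2 hx
    · refine mem_union_right _ (mem_apFinset.2 ⟨i - j - 1, by omega, ?_⟩)
      rw [← add_nsmul]; congr 1; omega
  · calc #(a +ᵥ (apFinset 0 r j ∪ apFinset ((j + 1) • r) r (k - j)))
          = #(apFinset 0 r j ∪ apFinset ((j + 1) • r) r (k - j)) := card_vadd_finset _ _
      _ ≤ #(apFinset (0 : G) r j) + #(apFinset ((j + 1) • r) r (k - j)) := card_union_le _ _
      _ ≤ j + (k - j) := add_le_add (card_apFinset_le _ _ _) (card_apFinset_le _ _ _)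
      _ = #S := by omega

omit [Fintype G] in
/-- From the two-runs form, membership of the progression points: `a + i r ∈ S` for `i ≤ k`,
`i ≠ j`. [cite: HamidouneSerraZemor2008, §7 (quasi-progressions)] -/
theorem add_nsmul_mem_of_eq_vadd_two_runs {r : G} {S : Finset G} {a : G} {k j : ℕ} (hjk : j ≤ k)
    (hS : S = a +ᵥ (apFinset 0 r j ∪ apFinset ((j + 1) • r) r (k - j))) {i : ℕ} (hik : i ≤ k)
    (hij : i ≠ j) : a + i • r ∈ S := by
  rw [hS]
  refine mem_vadd_finset.2 ⟨i • r, ?_, rfl⟩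
  rcases Nat.lt_or_gt_of_ne hij with h | h
  · exact mem_union_left _ (mem_apFinset.2 ⟨i, h, by rw [zero_add]⟩)
  · refine mem_union_right _ (mem_apFinset.2 ⟨i - j - 1, by omega, ?_⟩)
    rw [← add_nsmul]; congr 1; omega

/-- **Lemma 25, oriented, with an arbitrary first term.** [cite: HamidouneSerraZemor2008, §7,
Lemma 25] -/
theorem subset_apFinset_of_card_add_quasi_le_vadd {r : G} (hr : AddSubgroup.zmultiples r = ⊤)
    {k j : ℕ} (hk3 : 3 ≤ k) (hjk : j + 1 ≤ k) (h2j : k ≤ 2 * j) (hkn : k + 1 ≤ Fintype.card G)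
    (h12 : Fintype.card G ≠ 12) {S T : Finset G} {a : G}
    (hS : S = a +ᵥ (apFinset 0 r j ∪ apFinset ((j + 1) • r) r (k - j))) (hT3 : 3 ≤ #T)
    (hTS : #(T + S) ≤ #T + k) (hroom : #T + k + 4 ≤ Fintype.card G) :
    ∃ b : G, T ⊆ apFinset b r (#T + 1) := by
  have hTS' : #(T + (apFinset 0 r j ∪ apFinset ((j + 1) • r) r (k - j))) ≤ #T + k := by
    have : T + S = a +ᵥ (T + (apFinset 0 r j ∪ apFinset ((j + 1) • r) r (k - j))) := by
      rw [hS, add_comm T, vadd_add_assoc, add_comm]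
    rwa [this, card_vadd_finset] at hTS
  exact subset_apFinset_of_card_add_quasi_le_core hr hk3 hjk h2j hkn h12 hT3 hTS' hroom

/-- **[HamidouneSerraZemor2008, §7, Lemma 25] (quasi-progressions are transferred across a small
sumset).**  "Let `0 ∈ S` be a quasi-progression with difference `r` in the cyclic group `ℤ_n`.
Suppose that `S` generates `ℤ_n` and `|S| ≥ 3`.  Let `T ⊂ ℤ_n` be such that `|T| ≥ 3` and
`|S + T| ≤ |S| + |T| ≤ n − 4`.  Then one of the following conditions holds: (i) `T` is either a
quasi-progression with difference `r` or a progression with difference `r`. (ii) `n = 12` and `T`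
is a coset of order `4`."  Here in `G = ⟨r⟩` with `|G| ≠ 12` (so that (ii) is absent), for `S`
contained in an `r`-progression of length `|S| + 1` but not itself an `r`-progression; the
conclusion is `T ⊆ {b, …, b + |T| r}`.  Reduction to the oriented core
(`subset_apFinset_of_card_add_quasi_le_core`): the removed term `a + j r` has `1 ≤ j ≤ |S| − 1`, and
if `2j < |S|` one passes to `(−S, −T)`, whose removed term has index `|S| − j`.
[cite: HamidouneSerraZemor2008, §7, Lemma 25] -/
theorem subset_apFinset_of_card_add_le_of_not_isAP {r : G} (hr : AddSubgroup.zmultiples r = ⊤)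
    (h12 : Fintype.card G ≠ 12) {S T : Finset G} {a : G} (hS3 : 3 ≤ #S)
    (hSsub : S ⊆ apFinset a r (#S + 1)) (hSnot : ¬ IsAP S r) (hT3 : 3 ≤ #T)
    (hTS : #(T + S) ≤ #T + #S) (hroom : #T + #S + 4 ≤ Fintype.card G) :
    ∃ b : G, T ⊆ apFinset b r (#T + 1) := by
  classical
  have hord : addOrderOf r = Fintype.card G := addOrderOf_eq_card_of_zmultiples_eq_top hr
  set k := #S with hk
  have hkn : k + 1 ≤ Fintype.card G := by omega
  obtain ⟨j, hjk, hhole, hSeq⟩ :=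
    exists_eq_vadd_two_runs_of_subset_apFinset hk.symm hSsub (by rw [hord]; exact hkn)
  -- the removed term is interior
  have hj0 : j ≠ 0 := by
    rintro rfl
    apply hSnot
    have hS' : S = apFinset (a + r) r k := by
      rw [hSeq, apFinset_zero, empty_union, zero_add, one_nsmul, vadd_apFinset, Nat.sub_zero]
    exact ⟨a + r, by rw [← hk]; exact hS'⟩
  have hjk' : j ≠ k := by
    rintro rfl
    apply hSnot
    have hS' : S = apFinset a r #S := by
      rw [← hk]
      conv_lhs => rw [hSeq, Nat.sub_self, apFinset_zero, union_empty, vadd_apFinset, add_zero]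
    exact ⟨a, hS'⟩
  by_cases h2j : k ≤ 2 * j
  · exact subset_apFinset_of_card_add_quasi_le_vadd hr hS3 (by omega) h2j hkn h12 hSeq hT3 hTS
      hroom
  · -- reflect: `−S ⊆ {−a − k r, …}` with the term of index `k − j` removed
    have hnegsub : -S ⊆ apFinset (-a - k • r) r (k + 1) := by
      rw [← neg_apFinset]; exact neg_subset_neg hSsub
    have hnegcard : #(-S) = k := by rw [card_neg]
    obtain ⟨j', hj'k, hhole', hSeq'⟩ :=
      exists_eq_vadd_two_runs_of_subset_apFinset hnegcard hnegsub (by rw [hord]; exact hkn)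
    -- `j' = k − j`
    have hj' : j' = k - j := by
      by_contra hne
      apply hhole'
      rw [mem_neg']
      have : -(-a - k • r + j' • r) = a + (k - j') • r := by
        rw [sub_nsmul _ hj'k]; abel
      rw [this]
      exact add_nsmul_mem_of_eq_vadd_two_runs hjk hSeq (by omega) (by omega)
    subst hj'
    have hT3' : 3 ≤ #(-T) := by rwa [card_neg]
    have hTS' : #(-T + -S) ≤ #(-T) + k := by rwa [← neg_add, card_neg, card_neg]
    have hroom' : #(-T) + k + 4 ≤ Fintype.card G := by rwa [card_neg]
    obtain ⟨b, hb⟩ := subset_apFinset_of_card_add_quasi_le_vadd hr hS3 (by omega) (by omega) hkn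
      h12 hSeq' hT3' hTS' hroom'
    refine ⟨-b - #T • r, ?_⟩
    rw [card_neg] at hb
    rw [← neg_apFinset]
    have := neg_subset_neg hb
    rwa [neg_neg] at this

/-- **Progressions and quasi-progressions are transferred across a sumset one above the
Cauchy–Davenport bound** (Lemma 25 together with the progression case): in `G = ⟨r⟩` with
`|G| ≠ 12`, if `S ⊆ {a, …, a + |S| r}` with `|S| ≥ 3`, `|T| ≥ 3`, `|T + S| ≤ |T| + |S|` and
`|T| + |S| + 4 ≤ |G|`, then `T ⊆ {b, …, b + |T| r}` for some `b`.
[cite: HamidouneSerraZemor2008, §7, Lemma 25 and §8 (proof of Theorem 28, Cases 1–2)] -/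
theorem subset_apFinset_of_card_add_le_of_subset_apFinset {r : G}
    (hr : AddSubgroup.zmultiples r = ⊤) (h12 : Fintype.card G ≠ 12) {S T : Finset G} {a : G}
    (hS3 : 3 ≤ #S) (hSsub : S ⊆ apFinset a r (#S + 1)) (hT3 : 3 ≤ #T)
    (hTS : #(T + S) ≤ #T + #S) (hroom : #T + #S + 4 ≤ Fintype.card G) :
    ∃ b : G, T ⊆ apFinset b r (#T + 1) := by
  by_cases hAP : IsAP S r
  · exact subset_apFinset_of_isAP_of_card_add_le_of_zmultiples hr hAP hS3 (card_pos.1 (by omega))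
      hTS (by omega)
  · exact subset_apFinset_of_card_add_le_of_not_isAP hr h12 hS3 hSsub hAP hT3 hTS hroom

/-! ### §7, towards Lemma 27: a generating `4`-set with two `x`-runs and one extra `y`-translate
forces `⟨x⟩ = G` (odd order) -/

omit [DecidableEq G] in
/-- In a group of odd order, `z + z ∈ K ⇒ z ∈ K` for a subgroup `K` (`z = (|G|+1)/2 · 2z`).
[cite: HamidouneSerraZemor2008, §7 (proof of Lemma 27: "`n/2` is not a unit if `n` is even";
`2` is invertible for odd `n`)] -/
theorem mem_of_add_self_mem_of_odd_card (hodd : Odd (Fintype.card G)) (K : AddSubgroup G) {z : G}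
    (hz : z + z ∈ K) : z ∈ K := by
  obtain ⟨m, hm⟩ := hodd
  have h1 : (m + 1) • (z + z) = (Fintype.card G + 1) • z := by
    rw [nsmul_add, ← add_nsmul, hm]; congr 1; ring
  have h2 : (Fintype.card G + 1) • z = z := by rw [succ_nsmul, card_nsmul_eq_zero, zero_add]
  rw [← h2, ← h1]
  exact K.nsmul_mem hz _

/-- **The key step of [HamidouneSerraZemor2008, Lemma 27] ("every element of `S ∖ {0}` generates
`G`"), in the form used here.**  Let `|G|` be odd with every non-zero element of order `≥ 5`, let
`A ∋ 0` be a generating `4`-set, `x ≠ 0`, `{0, x, y}` generating, `|A ∪ (x + A)| = 6` and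
`|A ∪ (x + A) ∪ (y + A)| ≤ 7`.  Then `x` generates `G`.  Proof (ours, replacing the printed count
over the decomposition of `A` modulo `K = ⟨x⟩`): if `K ≠ G`, every `K`-coset met by `A` carries a
run-end of `A` in direction `x`, so `A ⊆ K ∪ (s₂ + K)` meets two cosets; `y ∉ K`, `2y ∉ K`, and
the translate `y + A` brings at least two points outside `A ∪ (x + A)`, against `7 − 6 = 1`.
[cite: HamidouneSerraZemor2008, §7, Lemma 27 (proof, first part)] -/
theorem zmultiples_eq_top_of_card_union_vadd_le {A : Finset G} {x y : G} (h0A : (0 : G) ∈ A)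
    (hgenA : AddSubgroup.closure (A : Set G) = ⊤) (hA4 : #A = 4)
    (hgenS : AddSubgroup.closure (({0, x, y} : Finset G) : Set G) = ⊤)
    (hodd : Odd (Fintype.card G)) (hord5 : ∀ g : G, g ≠ 0 → 5 ≤ addOrderOf g) (hx : x ≠ 0)
    (h6 : #(A ∪ (x +ᵥ A)) = 6) (h7 : #(A ∪ (x +ᵥ A) ∪ (y +ᵥ A)) ≤ 7) :
    AddSubgroup.zmultiples x = ⊤ := by
  classical
  by_contra hK
  set K := AddSubgroup.zmultiples x with hKdef
  set Kf := apFinset (0 : G) x (addOrderOf x) with hKfdef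
  have hKf : ∀ g, g ∈ Kf ↔ g ∈ K := fun g => by
    rw [← mem_coe, ← coe_zmultiples_eq_coe_apFinset x, SetLike.mem_coe]
  have hKf5 : 5 ≤ #Kf := by
    rw [hKfdef, card_apFinset_of_le_addOrderOf 0 x le_rfl]; exact hord5 x hx
  have hxK : x ∈ K := AddSubgroup.mem_zmultiples x
  -- `y ∉ K`
  have hyK : y ∉ K := by
    intro hy
    apply hK
    rw [eq_top_iff, ← hgenS, AddSubgroup.closure_le]
    intro g hg
    rw [mem_coe, mem_insert, mem_insert, mem_singleton] at hg
    rcases hg with rfl | rfl | rfl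
    · exact K.zero_mem
    · exact hxK
    · exact hy
  have htwo : ∀ z : G, z + z ∈ K → z ∈ K := fun z hz => mem_of_add_self_mem_of_odd_card hodd K hz
  -- `A ⊄ K`
  obtain ⟨s2, hs2A, hs2K⟩ : ∃ s2 ∈ A, s2 ∉ K := by
    by_contra h
    push Not at h
    apply hK
    rw [eq_top_iff, ← hgenA, AddSubgroup.closure_le]
    exact fun g hg => h g (mem_coe.1 hg)
  -- each coset met by `A` carries a run-end in direction `x`
  have hrunend : ∀ s ∈ A, ∃ a ∈ A, a - s ∈ K ∧ x + a ∉ A := by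
    intro s hs
    by_contra h
    push Not at h
    have hall : ∀ i : ℕ, s + i • x ∈ A := by
      intro i
      induction i with
      | zero => rw [zero_nsmul, add_zero]; exact hs
      | succ i ih =>
        have := h _ ih (by rw [add_sub_cancel_left]; exact K.nsmul_mem hxK i)
        rw [succ_nsmul, ← add_assoc]
        rwa [add_comm] at this
    have hsub : s +ᵥ Kf ⊆ A := by
      intro u hu
      obtain ⟨v, hv, rfl⟩ := mem_vadd_finset.1 hu
      rw [hKfdef, mem_apFinset] at hv
      obtain ⟨i, -, rfl⟩ := hv
      rw [vadd_eq_add, zero_add]; exact hall i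
    have := card_le_card hsub
    rw [card_vadd_finset] at this
    omega
  -- `|(x + A) ∖ A| = 2`
  have hxA2 : #((x +ᵥ A) \ A) = 2 := by
    have : #(A ∪ (x +ᵥ A)) = #A + #((x +ᵥ A) \ A) := by
      rw [← union_sdiff_self_eq_union, card_union_of_disjoint disjoint_sdiff]
    omega
  -- `A` lies in the two cosets `K`, `s₂ + K`
  have hA2cos : ∀ a ∈ A, a ∈ K ∨ a - s2 ∈ K := by
    intro a ha
    by_contra h
    push Not at h
    obtain ⟨a0, ha0A, ha0K, ha0x⟩ := hrunend 0 h0A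
    obtain ⟨a1, ha1A, ha1K, ha1x⟩ := hrunend s2 hs2A
    obtain ⟨a2, ha2A, ha2K, ha2x⟩ := hrunend a ha
    rw [sub_zero] at ha0K
    have h01 : a0 ≠ a1 := by
      rintro rfl
      exact hs2K (by have := K.sub_mem ha0K ha1K; rwa [sub_sub_cancel] at this)
    have h02 : a0 ≠ a2 := by
      rintro rfl
      exact h.1 (by have := K.sub_mem ha0K ha2K; rwa [sub_sub_cancel] at this)
    have h12 : a1 ≠ a2 := by
      rintro rfl
      exact h.2 (by have := K.sub_mem ha1K ha2K; rwa [sub_sub_sub_cancel_left] at this)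
    have hsub3 : ({x + a0, x + a1, x + a2} : Finset G) ⊆ (x +ᵥ A) \ A := by
      intro u hu
      rw [mem_insert, mem_insert, mem_singleton] at hu
      rw [mem_sdiff]
      rcases hu with rfl | rfl | rfl
      · exact ⟨mem_vadd_finset.2 ⟨a0, ha0A, rfl⟩, ha0x⟩
      · exact ⟨mem_vadd_finset.2 ⟨a1, ha1A, rfl⟩, ha1x⟩
      · exact ⟨mem_vadd_finset.2 ⟨a2, ha2A, rfl⟩, ha2x⟩
    have h3 : #({x + a0, x + a1, x + a2} : Finset G) = 3 :=
      card_eq_three.2 ⟨_, _, _, by simpa using h01, by simpa using h02, by simpa using h12, rfl⟩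
    have := card_le_card hsub3
    omega
  set W := A ∪ (x +ᵥ A) with hW
  have hWcos : ∀ w ∈ W, w ∈ K ∨ w - s2 ∈ K := by
    intro w hw
    rw [hW, mem_union] at hw
    rcases hw with h | h
    · exact hA2cos w h
    · obtain ⟨a, ha, rfl⟩ := mem_vadd_finset.1 h
      rw [vadd_eq_add]
      rcases hA2cos a ha with h' | h'
      · exact Or.inl (K.add_mem hxK h')
      · right
        have : x + a - s2 = x + (a - s2) := by abel
        rw [this]; exact K.add_mem hxK h'
  -- at most one new point in `y + A`
  have hnew : #((y +ᵥ A) \ W) ≤ 1 := by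
    have : #(W ∪ (y +ᵥ A)) = #W + #((y +ᵥ A) \ W) := by
      rw [← union_sdiff_self_eq_union, card_union_of_disjoint disjoint_sdiff]
    omega
  -- the pieces of `A` in the two cosets
  set A₀ := A.filter (fun a => a ∈ Kf) with hA₀
  set A₁ := A.filter (fun a => a ∉ Kf) with hA₁
  have hA01 : #A₀ + #A₁ = 4 := by
    rw [hA₀, hA₁, card_filter_add_card_filter_not]; exact hA4
  have h0A₀ : (0 : G) ∈ A₀ := mem_filter.2 ⟨h0A, (hKf 0).2 K.zero_mem⟩
  have hs2A₁ : s2 ∈ A₁ := mem_filter.2 ⟨hs2A, fun h => hs2K ((hKf s2).1 h)⟩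
  have hA₀pos : 1 ≤ #A₀ := card_pos.2 ⟨0, h0A₀⟩
  have hA₁pos : 1 ≤ #A₁ := card_pos.2 ⟨s2, hs2A₁⟩
  have hA₀K : ∀ a ∈ A₀, a ∈ K := fun a ha => (hKf a).1 (mem_filter.1 ha).2
  have hA₁K : ∀ a ∈ A₁, a - s2 ∈ K := fun a ha =>
    (hA2cos a (mem_filter.1 ha).1).resolve_left (fun h => (mem_filter.1 ha).2 ((hKf a).2 h))
  -- splitting the new points along `A = A₀ ⊔ A₁`
  have hsplit : #((y +ᵥ A₀) \ W) + #((y +ᵥ A₁) \ W) ≤ #((y +ᵥ A) \ W) := by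
    have hdisj : Disjoint ((y +ᵥ A₀) \ W) ((y +ᵥ A₁) \ W) := by
      refine (Disjoint.mono sdiff_subset sdiff_subset) ?_
      rw [disjoint_left]
      intro u hu0 hu1
      obtain ⟨a, ha, rfl⟩ := mem_vadd_finset.1 hu0
      obtain ⟨a', ha', he⟩ := mem_vadd_finset.1 hu1
      have : a' = a := by simpa using he
      subst this
      exact (mem_filter.1 ha').2 (mem_filter.1 ha).2
    rw [← card_union_of_disjoint hdisj]
    refine card_le_card (union_subset ?_ ?_)
    · exact sdiff_subset_sdiff (vadd_finset_subset_vadd_finset (filter_subset _ _)) subset_rfl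
    · exact sdiff_subset_sdiff (vadd_finset_subset_vadd_finset (filter_subset _ _)) subset_rfl
  -- generic bound: if `(y + P) ∩ W ⊆ Q` then `|P| ≤ |(y + P) ∖ W| + |Q|`
  have hbound : ∀ P Q : Finset G, (∀ u ∈ y +ᵥ P, u ∈ W → u ∈ Q) →
      #P ≤ #((y +ᵥ P) \ W) + #Q := by
    intro P Q h
    have h1 := card_sdiff_add_card_inter (y +ᵥ P) W
    have h2 : #((y +ᵥ P) ∩ W) ≤ #Q :=
      card_le_card fun u hu => h u (mem_inter.1 hu).1 (mem_inter.1 hu).2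
    rw [card_vadd_finset] at h1
    omega
  -- membership of `x + a'` in `W` traced back
  have hWx : ∀ u ∈ W, ∀ P : Finset G, (∀ a ∈ A, u = a → a ∈ P) →
      (∀ a' ∈ A, u = x + a' → a' ∈ P) → u ∈ P ∪ (x +ᵥ P) := by
    intro u hu P h1 h2
    rw [hW, mem_union] at hu
    rcases hu with h | h
    · exact mem_union_left _ (h1 u h rfl)
    · obtain ⟨a', ha', he⟩ := mem_vadd_finset.1 h
      exact mem_union_right _ (mem_vadd_finset.2 ⟨a', h2 a' ha' (by rw [← he, vadd_eq_add]), he⟩)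
  by_cases hys2 : y - s2 ∈ K
  · -- `y + A₁` lies in a new coset; `y + A₀` lies in `s₂ + K`
    have hB1 : #A₁ ≤ #((y +ᵥ A₁) \ W) + #(∅ : Finset G) := hbound A₁ ∅ (by
      intro u hu huW
      obtain ⟨a, ha, rfl⟩ := mem_vadd_finset.1 hu
      rw [vadd_eq_add] at huW
      have haK := hA₁K a ha
      exfalso
      rcases hWcos _ huW with h | h
      · apply hs2K
        apply htwo
        have : s2 + s2 = (y + a) - (y - s2) - (a - s2) := by abel
        rw [this]; exact K.sub_mem (K.sub_mem h hys2) haK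
      · apply hyK
        have : y = (y + a - s2) - (a - s2) := by abel
        rw [this]; exact K.sub_mem h haK)
    have hB0 : #A₀ ≤ #((y +ᵥ A₀) \ W) + #(A₁ ∪ (x +ᵥ A₁)) := hbound A₀ _ (by
      intro u hu huW
      obtain ⟨a, ha, rfl⟩ := mem_vadd_finset.1 hu
      rw [vadd_eq_add] at huW ⊢
      have haK := hA₀K a ha
      have hu1 : y + a - s2 ∈ K := by
        have : y + a - s2 = (y - s2) + a := by abel
        rw [this]; exact K.add_mem hys2 haK
      have hu2 : y + a ∉ K := fun h => hyK (by
        have : y = (y + a) - a := by abel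
        rw [this]; exact K.sub_mem h haK)
      refine hWx _ huW A₁ (fun b hb he => mem_filter.2 ⟨hb, fun h => hu2 ?_⟩)
        (fun b hb he => mem_filter.2 ⟨hb, fun h => hu2 ?_⟩)
      · rw [he]; exact (hKf b).1 h
      · rw [he]; exact K.add_mem hxK ((hKf b).1 h))
    have hcardA1x : #(A₁ ∪ (x +ᵥ A₁)) ≤ 2 * #A₁ :=
      (card_union_le _ _).trans (by rw [card_vadd_finset]; omega)
    simp only [card_empty, add_zero] at hB1
    omega
  · have hB0 : #A₀ ≤ #((y +ᵥ A₀) \ W) + #(∅ : Finset G) := hbound A₀ ∅ (by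
      intro u hu huW
      obtain ⟨a, ha, rfl⟩ := mem_vadd_finset.1 hu
      rw [vadd_eq_add] at huW
      have haK := hA₀K a ha
      exfalso
      rcases hWcos _ huW with h | h
      · exact hyK (by
          have : y = (y + a) - a := by abel
          rw [this]; exact K.sub_mem h haK)
      · exact hys2 (by
          have : y - s2 = (y + a - s2) - a := by abel
          rw [this]; exact K.sub_mem h haK))
    simp only [card_empty, add_zero] at hB0
    by_cases hys2' : y + s2 ∈ K
    · have hB1 : #A₁ ≤ #((y +ᵥ A₁) \ W) + #(A₀ ∪ (x +ᵥ A₀)) := hbound A₁ _ (by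
        intro u hu huW
        obtain ⟨a, ha, rfl⟩ := mem_vadd_finset.1 hu
        rw [vadd_eq_add] at huW ⊢
        have haK := hA₁K a ha
        have hu1 : y + a ∈ K := by
          have : y + a = (y + s2) + (a - s2) := by abel
          rw [this]; exact K.add_mem hys2' haK
        refine hWx _ huW A₀ (fun b hb he => mem_filter.2 ⟨hb, (hKf b).2 (by rw [← he]; exact hu1)⟩)
          (fun b hb he => mem_filter.2 ⟨hb, (hKf b).2 ?_⟩)
        have : b = (x + b) - x := by abel
        rw [this, ← he]; exact K.sub_mem hu1 hxK)
      have hcardA0x : #(A₀ ∪ (x +ᵥ A₀)) ≤ 2 * #A₀ :=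
        (card_union_le _ _).trans (by rw [card_vadd_finset]; omega)
      omega
    · have hB1 : #A₁ ≤ #((y +ᵥ A₁) \ W) + #(∅ : Finset G) := hbound A₁ ∅ (by
        intro u hu huW
        obtain ⟨a, ha, rfl⟩ := mem_vadd_finset.1 hu
        rw [vadd_eq_add] at huW
        have haK := hA₁K a ha
        exfalso
        rcases hWcos _ huW with h | h
        · exact hys2' (by
            have : y + s2 = (y + a) - (a - s2) := by abel
            rw [this]; exact K.sub_mem h haK)
        · exact hyK (by
            have : y = (y + a - s2) - (a - s2) := by abel
            rw [this]; exact K.sub_mem h haK))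
      simp only [card_empty, add_zero] at hB1
      omega

/-! ### §7, towards Lemma 27: windows (short progressions containing a set) and rectification -/

omit [Fintype G] in
/-- `u ∈ r + X ↔ u − r ∈ X`. [folklore] -/
private theorem mem_vadd_finset_iff_sub_mem {X : Finset G} {r u : G} :
    u ∈ r +ᵥ X ↔ u - r ∈ X := by
  rw [mem_vadd_finset]
  constructor
  · rintro ⟨v, hv, rfl⟩; rwa [vadd_eq_add, add_sub_cancel_left]
  · intro h; exact ⟨u - r, h, by rw [vadd_eq_add, add_sub_cancel]⟩

/-- The complement has as many run-ends as the set: `|(r + (G ∖ A)) ∖ (G ∖ A)| = |(r + A) ∖ A|`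
(run-starts of `A` ↔ run-ends of `A`). [cite: HamidouneSerraZemor2008, §7 (proof of Lemma 25:
the connected components of `T` and of `T̄` alternate)] -/
theorem card_vadd_univ_sdiff_sdiff (A : Finset G) (r : G) :
    #((r +ᵥ (univ \ A)) \ (univ \ A)) = #((r +ᵥ A) \ A) := by
  classical
  have hset : (r +ᵥ (univ \ A)) \ (univ \ A) = A \ (r +ᵥ A) := by
    ext u
    simp only [mem_sdiff, mem_vadd_finset_iff_sub_mem, mem_univ, true_and, not_not]
    tauto
  rw [hset]
  have h1 := card_sdiff_add_card_inter A (r +ᵥ A)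
  have h2 := card_sdiff_add_card_inter (r +ᵥ A) A
  rw [inter_comm, card_vadd_finset] at h2
  omega

/-- **A set with at most two `r`-runs sits in a short `r`-progression:** in `G = ⟨r⟩`, if
`∅ ≠ A ≠ G` has `|(r + A) ∖ A| ≤ 2`, then `A ⊆ {a, …, a + (L−1) r}` with `2L ≤ |G| + |A|` (the
complement of the longer of the at most two gaps). [cite: HamidouneSerraZemor2008, §7 (proof of
Lemma 27: "`A` can be represented by two pairs of consecutive integers, and hence by a subset of
`4` integers included in an interval of length `≤ (n+1)/2`")] -/
theorem exists_subset_apFinset_short_of_card_vadd_sdiff_le_two {r : G}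
    (hr : AddSubgroup.zmultiples r = ⊤) {A : Finset G} (hA : A.Nonempty) (hAu : A ≠ univ)
    (h2 : #((r +ᵥ A) \ A) ≤ 2) :
    ∃ a : G, ∃ L : ℕ, A ⊆ apFinset a r L ∧ 2 * L ≤ Fintype.card G + #A := by
  classical
  set n := Fintype.card G with hn
  have hcAne : univ \ A ≠ univ := by
    intro h
    obtain ⟨t, ht⟩ := hA
    have : t ∈ univ \ A := by rw [h]; exact mem_univ t
    exact (mem_sdiff.1 this).2 ht
  obtain ⟨ℓ, hcov, -, hStcard, hrunsub, hrun⟩ := eq_filter_union_biUnion_apFinset (univ \ A) r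
  rw [filter_vadd_apFinset_subset_eq_empty hr hcAne, empty_union] at hcov
  set St := (univ \ A).filter (fun s => s - r ∉ univ \ A) with hSt
  rw [card_vadd_univ_sdiff_sdiff] at hStcard
  have hrun' : ∀ s ∈ St, #(apFinset s r (ℓ s)) = ℓ s := fun s hs =>
    (hrun s (mem_filter.1 hs).1 (mem_filter.1 hs).2).2.1
  have hStne : St.Nonempty := by
    rw [nonempty_iff_ne_empty]
    intro h0
    rw [h0, biUnion_empty] at hcov
    apply hAu
    have : univ \ A = ∅ := hcov
    rwa [sdiff_eq_empty_iff_subset, univ_subset_iff] at this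
  obtain ⟨s0, hs0, hmax⟩ := exists_max_image St ℓ hStne
  have hcardc : n - #A ≤ ∑ s ∈ St, ℓ s := by
    calc n - #A = #(univ \ A) := by rw [card_univ_sdiff]
      _ = #(St.biUnion fun s => apFinset s r (ℓ s)) := by rw [← hcov]
      _ ≤ ∑ s ∈ St, #(apFinset s r (ℓ s)) := card_biUnion_le
      _ = ∑ s ∈ St, ℓ s := sum_congr rfl hrun'
  have hsum : ∑ s ∈ St, ℓ s ≤ 2 * ℓ s0 :=
    calc ∑ s ∈ St, ℓ s ≤ ∑ s ∈ St, ℓ s0 := sum_le_sum hmax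
      _ = #St * ℓ s0 := by rw [sum_const, smul_eq_mul]
      _ ≤ 2 * ℓ s0 := Nat.mul_le_mul_right _ (by omega)
  have hℓn : ℓ s0 ≤ n := by rw [← hrun' s0 hs0]; exact card_le_univ _
  refine ⟨s0 + ℓ s0 • r, n - ℓ s0, ?_, by omega⟩
  rw [← univ_sdiff_apFinset_of_zmultiples hr s0 hℓn]
  intro x hx
  rw [mem_sdiff]
  exact ⟨mem_univ x, fun h => (mem_sdiff.1 (hrunsub s0 h)).2 hx⟩

omit [Fintype G] in
/-- **Rectification of a pair of windowed sets:** if `X ⊆ {a, …, a + (L−1) r}` and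
`Y ⊆ {b, …, b + (M−1) r}` with `L, M ≤ o(r)` and `L + M ≤ o(r) + 1`, then with the index sets
`I_X = {i < L : a + i r ∈ X}`, `I_Y = {j < M : b + j r ∈ Y}` one has `|X| = |I_X|`, `|Y| = |I_Y|`
and `|X + Y| = |I_X + I_Y|` ("the sum `A + S` in `ℤ_n` has the same cardinality as the sum `A + S`
in `ℤ`"). [cite: HamidouneSerraZemor2008, §7 (proof of Lemma 27, last paragraph)] -/
theorem card_add_eq_card_index_add {r a b : G} {L M : ℕ} (hL : L ≤ addOrderOf r)
    (hM : M ≤ addOrderOf r) (hLM : L + M ≤ addOrderOf r + 1) {X Y : Finset G}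
    (hX : X ⊆ apFinset a r L) (hY : Y ⊆ apFinset b r M) :
    #X = #((range L).filter fun i => a + i • r ∈ X) ∧
      #Y = #((range M).filter fun j => b + j • r ∈ Y) ∧
      #(X + Y) = #(((range L).filter fun i => a + i • r ∈ X) +
        ((range M).filter fun j => b + j • r ∈ Y)) := by
  classical
  set IX := (range L).filter fun i => a + i • r ∈ X with hIX
  set IY := (range M).filter fun j => b + j • r ∈ Y with hIY
  have hinj : ∀ c : G, ∀ N ≤ addOrderOf r, Set.InjOn (fun i : ℕ => c + i • r) (range N : Finset ℕ) := by
    intro c N hN i hi j hj hij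
    have hi' : i < addOrderOf r := lt_of_lt_of_le (mem_range.1 (mem_coe.1 hi)) hN
    have hj' : j < addOrderOf r := lt_of_lt_of_le (mem_range.1 (mem_coe.1 hj)) hN
    exact nsmul_injOn_Iio_addOrderOf (Set.mem_Iio.2 hi') (Set.mem_Iio.2 hj') (add_left_cancel hij)
  have hXeq : X = IX.image fun i => a + i • r := by
    ext x
    rw [mem_image]
    constructor
    · intro hx
      obtain ⟨i, hi, rfl⟩ := mem_apFinset.1 (hX hx)
      exact ⟨i, mem_filter.2 ⟨mem_range.2 hi, hx⟩, rfl⟩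
    · rintro ⟨i, hi, rfl⟩
      exact (mem_filter.1 hi).2
  have hYeq : Y = IY.image fun j => b + j • r := by
    ext y
    rw [mem_image]
    constructor
    · intro hy
      obtain ⟨j, hj, rfl⟩ := mem_apFinset.1 (hY hy)
      exact ⟨j, mem_filter.2 ⟨mem_range.2 hj, hy⟩, rfl⟩
    · rintro ⟨j, hj, rfl⟩
      exact (mem_filter.1 hj).2
  have hcX : #X = #IX := by
    rw [hXeq, card_image_of_injOn ((hinj a L hL).mono (coe_subset.2 (filter_subset _ _)))]
  have hcY : #Y = #IY := by
    rw [hYeq, card_image_of_injOn ((hinj b M hM).mono (coe_subset.2 (filter_subset _ _)))]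
  refine ⟨hcX, hcY, ?_⟩
  have hXYeq : X + Y = (IX + IY).image fun m => a + b + m • r := by
    ext z
    rw [mem_add, mem_image]
    constructor
    · rintro ⟨x, hx, y, hy, rfl⟩
      rw [hXeq] at hx; rw [hYeq] at hy
      obtain ⟨i, hi, rfl⟩ := mem_image.1 hx
      obtain ⟨j, hj, rfl⟩ := mem_image.1 hy
      exact ⟨i + j, add_mem_add hi hj, by rw [add_nsmul]; abel⟩
    · rintro ⟨m, hm, rfl⟩
      obtain ⟨i, hi, j, hj, rfl⟩ := mem_add.1 hm
      refine ⟨a + i • r, ?_, b + j • r, ?_, by rw [add_nsmul]; abel⟩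
      · rw [hXeq]; exact mem_image_of_mem _ hi
      · rw [hYeq]; exact mem_image_of_mem _ hj
  have hsub : IX + IY ⊆ range (L + M - 1) := by
    intro m hm
    obtain ⟨i, hi, j, hj, rfl⟩ := mem_add.1 hm
    have := mem_range.1 (mem_filter.1 hi).1
    have := mem_range.1 (mem_filter.1 hj).1
    exact mem_range.2 (by omega)
  rw [hXYeq, card_image_of_injOn ((hinj (a + b) (L + M - 1) (by omega)).mono (coe_subset.2 hsub))]

/-- **[HamidouneSerraZemor2008, §7, Lemma 26] ("an easy exercise"):** "Let `S` and `T` be subsets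
of `ℤ` such that `|S| = 3`, `|T| = 4` and `|S + T| = 7`.  Then `S` is either a progression or a
quasi-progression": `S ⊆ {c, c + d, c + 2d, c + 3d}` with `d > 0` and `c = min S`.  PROOF (ours):
Nathanson's Theorem 4.8 (Lev–Smeliansky, `lev_smeliansky_inverse`) applied to `(S, T)` when
`diam T ≤ diam S`, and to `(T, S)` otherwise (then `S` lies in a `5`-term progression of difference
`d` and `diam S < diam T ≤ 4d` removes the last term).
[cite: HamidouneSerraZemor2008, §7, Lemma 26] [cite: Nathanson1996, Thm 4.8] -/
theorem exists_forall_eq_add_mul_of_card_add_le_seven {I J : Finset ℤ} (hI : #I = 3) (hJ : #J = 4)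
    (hIJ : #(I + J) ≤ 7) :
    ∃ d : ℤ, 0 < d ∧ ∃ c ∈ I, (∀ z ∈ I, c ≤ z) ∧ ∀ z ∈ I, ∃ i : ℕ, i < 4 ∧ z = c + i * d := by
  classical
  have hIne : I.Nonempty := card_pos.1 (by omega)
  have hJne : J.Nonempty := card_pos.1 (by omega)
  refine (le_or_gt (J.max' hJne - J.min' hJne) (I.max' hIne - I.min' hIne)).elim
    (fun hdiam => ?_) (fun hdiam => ?_)
  · -- `diam J ≤ diam I`: apply Theorem 4.8 to `(I, J)`
    have hsmall : (#(I + J) : ℤ) ≤ #I + #J + min (#I : ℤ) (#J -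
        (if J.max' hJne - J.min' hJne = I.max' hIne - I.min' hIne then 1 else 0)) - 3 := by
      rw [hI, hJ]; push_cast
      split_ifs <;> norm_num <;> omega
    obtain ⟨d, hd, hIsub, -⟩ := lev_smeliansky_inverse hIne hJne hdiam hsmall
    refine ⟨d, hd, I.min' hIne, min'_mem I hIne, fun z hz => min'_le I z hz, fun z hz => ?_⟩
    obtain ⟨i, hi, he⟩ := mem_image.1 (hIsub hz)
    refine ⟨i, ?_, he.symm⟩
    have := mem_range.1 hi
    rw [hJ] at this
    omega
  · -- `diam I < diam J`: apply Theorem 4.8 to `(J, I)`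
    have hne : ¬ (I.max' hIne - I.min' hIne = J.max' hJne - J.min' hJne) := by omega
    have hsmall : (#(J + I) : ℤ) ≤ #J + #I + min (#J : ℤ) (#I -
        (if I.max' hIne - I.min' hIne = J.max' hJne - J.min' hJne then 1 else 0)) - 3 := by
      rw [if_neg hne, hI, hJ, add_comm J I]; push_cast
      norm_num; omega
    obtain ⟨d, hd, hJsub, hIsub⟩ := lev_smeliansky_inverse hJne hIne hdiam.le hsmall
    refine ⟨d, hd, I.min' hIne, min'_mem I hIne, fun z hz => min'_le I z hz, fun z hz => ?_⟩
    obtain ⟨i, hi, he⟩ := mem_image.1 (hIsub hz)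
    refine ⟨i, ?_, he.symm⟩
    -- `diam J ≤ 4 d`
    obtain ⟨i', hi', he'⟩ := mem_image.1 (hJsub (max'_mem J hJne))
    have hi'5 : i' ≤ 4 := by
      have := mem_range.1 hi'
      rw [add_comm J I, hI] at this
      omega
    have hdiamJ : J.max' hJne - J.min' hJne ≤ 4 * d := by
      rw [← he']
      have : (i' : ℤ) * d ≤ 4 * d := by
        apply mul_le_mul_of_nonneg_right _ hd.le
        exact_mod_cast hi'5
      linarith
    -- `i d = z − min I ≤ diam I < diam J ≤ 4 d`
    have hzle : z ≤ I.max' hIne := le_max' I z hz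
    have hid : (i : ℤ) * d < 4 * d := by
      have : (i : ℤ) * d = z - I.min' hIne := by rw [← he]; ring
      linarith
    by_contra hi4
    push Not at hi4
    have : (4 : ℤ) * d ≤ (i : ℤ) * d := by
      apply mul_le_mul_of_nonneg_right _ hd.le
      exact_mod_cast hi4
    linarith

omit [Fintype G] in
/-- A set containing `0` inside a progression of difference `e` generates at most `⟨e⟩`; if it
generates `G`, then `⟨e⟩ = G`. [cite: HamidouneSerraZemor2008, §7 (proof of Lemma 25:
"Observe that `S ⊂ ⟨d⟩ + a`. Since `0 ∈ S`, we have `a ∈ ⟨d⟩`. Then `ℤ_n = ⟨S⟩ = ⟨d⟩`")] -/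
theorem zmultiples_eq_top_of_zero_mem_subset_apFinset {S : Finset G} {c e : G} {m : ℕ}
    (h0 : (0 : G) ∈ S) (hgen : AddSubgroup.closure (S : Set G) = ⊤) (hS : S ⊆ apFinset c e m) :
    AddSubgroup.zmultiples e = ⊤ := by
  obtain ⟨i0, -, hc⟩ := mem_apFinset.1 (hS h0)
  have hcmem : c ∈ AddSubgroup.zmultiples e := by
    have : c = -(i0 • e) := eq_neg_of_add_eq_zero_left hc
    rw [this]
    exact AddSubgroup.neg_mem _ (AddSubgroup.nsmul_mem _ (AddSubgroup.mem_zmultiples e) i0)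
  rw [eq_top_iff, ← hgen, AddSubgroup.closure_le]
  intro s hs
  obtain ⟨i, -, rfl⟩ := mem_apFinset.1 (hS (mem_coe.1 hs))
  exact AddSubgroup.add_mem _ hcmem (AddSubgroup.nsmul_mem _ (AddSubgroup.mem_zmultiples e) i)

omit [Fintype G] in
/-- `X + {0, x, y} = X ∪ (x + X) ∪ (y + X)`. [cite: HamidouneSerraZemor2008, §7 (proof of Lemma 27:
"`|A + {0, x, y}| = |A| + 3`", the three translates of `A`)] -/
theorem add_triple_eq_union (X : Finset G) (x y : G) :
    X + ({0, x, y} : Finset G) = X ∪ (x +ᵥ X) ∪ (y +ᵥ X) := by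
  ext u
  simp only [mem_add, mem_union, mem_insert, mem_singleton, mem_vadd_finset, vadd_eq_add]
  constructor
  · rintro ⟨a, ha, z, hz, rfl⟩
    rcases hz with rfl | rfl | rfl
    · left; left; rwa [add_zero]
    · left; right; exact ⟨a, ha, add_comm _ _⟩
    · right; exact ⟨a, ha, add_comm _ _⟩
  · rintro ((h | ⟨a, ha, rfl⟩) | ⟨a, ha, rfl⟩)
    · exact ⟨u, h, 0, Or.inl rfl, add_zero u⟩
    · exact ⟨a, ha, x, Or.inr (Or.inl rfl), add_comm _ _⟩
    · exact ⟨a, ha, y, Or.inr (Or.inr rfl), add_comm _ _⟩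

/-! ### §7, Lemma 27: a generating `3`-set with `κ₄ = 3` lies in a `4`-term progression of a
generator (`gcd(|G|, 6) = 1`) -/

omit [DecidableEq G] in
/-- When `gcd(|G|, 6) = 1`, every non-zero element has order at least `5`.
[cite: HamidouneSerraZemor2008, §7 (proof of Lemma 27: "Since `gcd(|G|, 6) = 1` we have
`min {|H|, |G/K|} ≥ 5`")] -/
theorem five_le_addOrderOf_of_coprime_six (hcop : (Fintype.card G).Coprime 6) {g : G}
    (hg : g ≠ 0) : 5 ≤ addOrderOf g := by
  have hdvd : addOrderOf g ∣ Fintype.card G := addOrderOf_dvd_card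
  have hpos : 0 < addOrderOf g := addOrderOf_pos g
  have hne1 : addOrderOf g ≠ 1 := fun h => hg (AddMonoid.addOrderOf_eq_one_iff.1 h)
  have h2 : ¬ 2 ∣ Fintype.card G := fun h => by
    have := (Nat.Coprime.coprime_dvd_left h hcop).eq_one_of_dvd (by norm_num)
    omega
  have h3 : ¬ 3 ∣ Fintype.card G := fun h => by
    have := (Nat.Coprime.coprime_dvd_left h hcop).eq_one_of_dvd (by norm_num)
    omega
  by_contra hlt
  push Not at hlt
  interval_cases h : addOrderOf g
  · exact hne1 rfl
  · exact h2 hdvd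
  · exact h3 hdvd
  · exact h2 (dvd_trans (by norm_num) hdvd)

/-- **A `4`-set which is a progression transfers it** (the sub-case "`A` is an arithmetic
progression with difference `y − x`" of [HamidouneSerraZemor2008, Lemma 27]): if `A ∋ 0`
generates `G`, `|A| = 4`, `z ≠ 0` has order `≥ 5`, `|(z + A) ∖ A| ≤ 1`, and `|A + S| = 7` for a
`3`-set `S` (`|G| ≥ 8`), then `⟨z⟩ = G` and `S ⊆ {b, b + z, b + 2z, b + 3z}` for some `b`.
[cite: HamidouneSerraZemor2008, §7, Lemma 27 (proof: "Then `A` is an arithmetic progression with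
difference `y − x` … Now it comes easily that `S` is a quasi-progression")] -/
theorem subset_apFinset_four_of_card_vadd_sdiff_le_one {A S : Finset G} {z : G} (h0A : (0 : G) ∈ A)
    (hgenA : AddSubgroup.closure (A : Set G) = ⊤) (hA4 : #A = 4)
    (hord5 : 5 ≤ addOrderOf z) (h1 : #((z +ᵥ A) \ A) ≤ 1) (hS3 : #S = 3) (hAS : #(A + S) = 7)
    (hn : 8 ≤ Fintype.card G) :
    AddSubgroup.zmultiples z = ⊤ ∧ ∃ b : G, S ⊆ apFinset b z 4 := by
  classical
  -- `A` is not `z`-invariant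
  have h1' : #((z +ᵥ A) \ A) = 1 := by
    refine le_antisymm h1 ?_
    by_contra h0
    have hzA : z +ᵥ A = A := by
      have : (z +ᵥ A) \ A = ∅ := by rw [← card_eq_zero]; omega
      exact eq_of_subset_of_card_le (sdiff_eq_empty_iff_subset.1 this) (by rw [card_vadd_finset])
    have hsub : apFinset (0 : G) z (addOrderOf z) ⊆ A := by
      intro u hu
      obtain ⟨i, -, rfl⟩ := mem_apFinset.1 hu
      exact (mem_iff_add_nsmul_mem_of_vadd_eq hzA 0 i).1 h0A
    have := card_le_card hsub
    rw [card_apFinset_of_le_addOrderOf 0 z le_rfl] at this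
    omega
  obtain ⟨s, -, ℓ, -, hAeq, hPinv, hAPcard, -⟩ :=
    exists_eq_filter_union_apFinset_of_card_vadd_sdiff_eq_one h1'
  set P := A.filter fun u => u +ᵥ apFinset (0 : G) z (addOrderOf z) ⊆ A with hP
  have hP0 : P = ∅ := by
    rcases P.eq_empty_or_nonempty with h | hne
    · exact h
    · exfalso
      have h1 := card_apFinset_zero_addOrderOf_le_card hPinv hne
      rw [card_apFinset_of_le_addOrderOf 0 z le_rfl] at h1
      have hP4 : #P ≤ 4 := (card_le_card (filter_subset _ _)).trans hA4.le
      omega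
  rw [hP0, empty_union] at hAeq
  have hℓ : ℓ = 4 := by rw [← hAPcard, ← hAeq, hA4]
  have hr : AddSubgroup.zmultiples z = ⊤ :=
    zmultiples_eq_top_of_zero_mem_subset_apFinset h0A hgenA hAeq.subset
  have hAP : IsAP A z := ⟨s, by rw [hA4, ← hℓ]; exact hAeq⟩
  refine ⟨hr, ?_⟩
  obtain ⟨b, hb⟩ := subset_apFinset_of_isAP_of_card_add_le_of_zmultiples hr hAP (by omega)
    (card_pos.1 (by omega) : S.Nonempty) (by rw [add_comm, hAS]; omega) (by rw [add_comm, hAS]; omega)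
  exact ⟨b, by rw [hS3] at hb; exact hb⟩

/-- **The last case of [HamidouneSerraZemor2008, Lemma 27]** (`|A ∩ (A + x)| ≥ 2`): with `A ∋ 0`
a generating `4`-set, `S = {0, x, y}` generating (`x ≠ y` non-zero), `gcd(|G|, 6) = 1`, `|G| ≥ 11`,
`|A ∪ (x + A) ∪ (y + A)| = 7` and `|A ∩ (x + A)| ≥ 2`, the set `S` lies in a `4`-term progression
whose difference generates `G`.  Proof: one `x`-run makes `A` an `x`-progression
(`subset_apFinset_four_of_card_vadd_sdiff_le_one`); two `x`-runs give `⟨x⟩ = G`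
(`zmultiples_eq_top_of_card_union_vadd_le`), `A` inside an `x`-window of length `≤ (n+3)/2`
(`exists_subset_apFinset_short_of_card_vadd_sdiff_le_two`), `y = t x`; if `S = {0, x, t x}` fits
in a window of length `≤ (n−1)/2` (from `0` or from `t x`), rectification
(`card_add_eq_card_index_add`) and Lemma 26 give `t ≤ 3` or `t ≥ n − 2`; otherwise
`2t ∈ {n−1, n+1, n+3}` and `S ⊆ {−h, 0, h, 2h}` or `{0, h, 2h, 3h}` with `2h = x` ("`S` is included
in an arithmetic progression of length `4` and difference `2⁻¹`").
[cite: HamidouneSerraZemor2008, §7, Lemma 27 (proof, last two paragraphs)] -/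
theorem exists_subset_apFinset_four_of_two_le_card_inter {A : Finset G} {x y : G}
    (h0A : (0 : G) ∈ A) (hgenA : AddSubgroup.closure (A : Set G) = ⊤) (hA4 : #A = 4)
    (hgenS : AddSubgroup.closure (({0, x, y} : Finset G) : Set G) = ⊤)
    (hcop : (Fintype.card G).Coprime 6) (hx : x ≠ 0) (hy : y ≠ 0) (hxy : x ≠ y)
    (h7 : #(A ∪ (x +ᵥ A) ∪ (y +ᵥ A)) = 7) (h2 : 2 ≤ #(A ∩ (x +ᵥ A)))
    (hn11 : 11 ≤ Fintype.card G) :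
    ∃ r a : G, AddSubgroup.zmultiples r = ⊤ ∧ ({0, x, y} : Finset G) ⊆ apFinset a r 4 := by
  classical
  set n := Fintype.card G with hn
  have h2n : ¬ 2 ∣ n := fun h => by
    have := (Nat.Coprime.coprime_dvd_left h hcop).eq_one_of_dvd (by norm_num)
    omega
  have hodd : Odd n := Nat.odd_iff.2 (by omega)
  have hord5 : ∀ g : G, g ≠ 0 → 5 ≤ addOrderOf g := fun g hg =>
    five_le_addOrderOf_of_coprime_six hcop hg
  have hn12 : n ≠ 12 := by omega
  have hS3 : #({0, x, y} : Finset G) = 3 := card_eq_three.2 ⟨0, x, y, hx.symm, hy.symm, hxy, rfl⟩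
  have hAS : #(A + {0, x, y}) = 7 := by rw [add_triple_eq_union]; exact h7
  have hxcnt : #((x +ᵥ A) \ A) + #(A ∩ (x +ᵥ A)) = 4 := by
    have := card_sdiff_add_card_inter (x +ᵥ A) A
    rw [card_vadd_finset, inter_comm] at this
    omega
  by_cases hx1 : #((x +ᵥ A) \ A) ≤ 1
  · obtain ⟨hr, b, hb⟩ := subset_apFinset_four_of_card_vadd_sdiff_le_one h0A hgenA hA4
      (hord5 x hx) hx1 hS3 hAS (by omega)
    exact ⟨x, b, hr, hb⟩
  -- two `x`-runs
  have hx2 : #((x +ᵥ A) \ A) = 2 := by omega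
  have h6 : #(A ∪ (x +ᵥ A)) = 6 := by
    rw [← union_sdiff_self_eq_union, card_union_of_disjoint disjoint_sdiff, hA4, hx2]
  have hr : AddSubgroup.zmultiples x = ⊤ :=
    zmultiples_eq_top_of_card_union_vadd_le h0A hgenA hA4 hgenS hodd hord5 hx h6 h7.le
  have hordx : addOrderOf x = n := addOrderOf_eq_card_of_zmultiples_eq_top hr
  have hinj : ∀ i i' : ℕ, i < n → i' < n → i • x = i' • x → i = i' := fun i i' hi hi' he =>
    nsmul_injOn_Iio_addOrderOf (by rw [Set.mem_Iio, hordx]; exact hi)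
      (by rw [Set.mem_Iio, hordx]; exact hi') he
  -- window for `A`
  have hAu : A ≠ univ := by
    intro h
    rw [h, card_univ] at hA4
    omega
  obtain ⟨a, L, hAsub, hL⟩ :=
    exists_subset_apFinset_short_of_card_vadd_sdiff_le_two hr ⟨0, h0A⟩ hAu (by omega)
  rw [hA4] at hL
  have hLn : L ≤ n := by omega
  -- `y = t • x`
  obtain ⟨t, ht, hty⟩ : ∃ t, t < n ∧ t • x = y := by
    have : y ∈ apFinset (0 : G) x (addOrderOf x) := by
      rw [apFinset_zero_addOrderOf_eq_univ hr]; exact mem_univ y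
    obtain ⟨t, ht, he⟩ := mem_apFinset.1 this
    exact ⟨t, by rwa [hordx] at ht, by rwa [zero_add] at he⟩
  have ht0 : t ≠ 0 := by rintro rfl; apply hy; rw [← hty, zero_nsmul]
  have ht1 : t ≠ 1 := by rintro rfl; apply hxy; rw [← hty, one_nsmul]
  -- the cast `ℕ → ℤ`
  set f : ℕ →+ ℤ := Nat.castAddMonoidHom ℤ with hf
  have hfinj : Function.Injective f := fun i j h => by
    simpa [hf] using h
  -- the rectification step, shared by the two windows for `S`
  have rect : ∀ (b : G) (M : ℕ), ({0, x, y} : Finset G) ⊆ apFinset b x M → M ≤ n →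
      L + M ≤ n + 1 → ∃ d : ℤ, 0 < d ∧ ∃ c ∈ ((range M).filter fun j => b + j • x ∈
        ({0, x, y} : Finset G)).image f,
        (∀ z ∈ ((range M).filter fun j => b + j • x ∈ ({0, x, y} : Finset G)).image f, c ≤ z) ∧
        ∀ z ∈ ((range M).filter fun j => b + j • x ∈ ({0, x, y} : Finset G)).image f,
          ∃ i : ℕ, i < 4 ∧ z = c + i * d := by
    intro b M hSsub hM hLM
    obtain ⟨hcA, hcS, hcsum⟩ := card_add_eq_card_index_add (r := x) (a := a) (b := b) (L := L)
      (M := M) (by rw [hordx]; exact hLn) (by rw [hordx]; exact hM) (by rw [hordx]; exact hLM)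
      hAsub hSsub
    set IA := (range L).filter fun i => a + i • x ∈ A
    set IS := (range M).filter fun j => b + j • x ∈ ({0, x, y} : Finset G)
    have hI3 : #(IS.image f) = 3 := by rw [card_image_of_injective _ hfinj, ← hcS, hS3]
    have hJ4 : #(IA.image f) = 4 := by rw [card_image_of_injective _ hfinj, ← hcA, hA4]
    have hIJ : #(IS.image f + IA.image f) ≤ 7 := by
      rw [← image_add, card_image_of_injective _ hfinj, add_comm, ← hcsum, hAS]
    exact exists_forall_eq_add_mul_of_card_add_le_seven hI3 hJ4 hIJ
  by_cases hta : 2 * (t + 1) + 1 ≤ n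
  · -- window `[0, t]` for `S`
    have hSsub : ({0, x, y} : Finset G) ⊆ apFinset 0 x (t + 1) := by
      intro u hu
      rw [mem_insert, mem_insert, mem_singleton] at hu
      rcases hu with rfl | rfl | rfl
      · exact mem_apFinset.2 ⟨0, by omega, by rw [zero_nsmul, add_zero]⟩
      · exact mem_apFinset.2 ⟨1, by omega, by rw [one_nsmul, zero_add]⟩
      · exact mem_apFinset.2 ⟨t, by omega, by rw [zero_add, hty]⟩
    obtain ⟨d, hd, c, hcI, hcle, hall⟩ := rect 0 (t + 1) hSsub (by omega) (by omega)
    set IS := (range (t + 1)).filter fun j => (0 : G) + j • x ∈ ({0, x, y} : Finset G) with hIS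
    have hISeq : IS = {0, 1, t} := by
      ext j
      rw [hIS, mem_filter, mem_range, zero_add, mem_insert, mem_insert, mem_singleton, mem_insert,
        mem_insert, mem_singleton]
      constructor
      · rintro ⟨hj, h | h | h⟩
        · left; exact hinj j 0 (by omega) (by omega) (by rw [h, zero_nsmul])
        · right; left; exact hinj j 1 (by omega) (by omega) (by rw [h, one_nsmul])
        · right; right; exact hinj j t (by omega) ht (by rw [h, hty])
      · rintro (rfl | rfl | rfl)
        · exact ⟨by omega, Or.inl (zero_nsmul x)⟩
        · exact ⟨by omega, Or.inr (Or.inl (one_nsmul x))⟩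
        · exact ⟨by omega, Or.inr (Or.inr hty)⟩
    have hIeq : IS.image f = {(0 : ℤ), 1, (t : ℤ)} := by
      rw [hISeq, image_insert, image_insert, image_singleton]
      simp [hf]
    rw [hIeq] at hcI hcle hall
    have hc0 : c = 0 := by
      have h0le := hcle 0 (by simp)
      simp only [mem_insert, mem_singleton] at hcI
      rcases hcI with rfl | rfl | rfl <;> omega
    subst hc0
    obtain ⟨i1, -, he1⟩ := hall 1 (by simp)
    have hd1 : d = 1 := Int.eq_one_of_mul_eq_one_left hd.le (by linarith : (i1 : ℤ) * d = 1)
    subst hd1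
    obtain ⟨i2, hi2, he2⟩ := hall t (by simp)
    have ht4 : t < 4 := by omega
    exact ⟨x, 0, hr, hSsub.trans (apFinset_mono 0 x (by omega))⟩
  by_cases htb : 2 * (n - t + 2) + 1 ≤ n
  · -- window `[t, n + 1]` for `S`, starting at `y`
    have hnx : n • x = 0 := by rw [← hordx, addOrderOf_nsmul_eq_zero]
    have hSsub : ({0, x, y} : Finset G) ⊆ apFinset y x (n - t + 2) := by
      intro u hu
      rw [mem_insert, mem_insert, mem_singleton] at hu
      rcases hu with rfl | rfl | rfl
      · refine mem_apFinset.2 ⟨n - t, by omega, ?_⟩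
        rw [← hty, ← add_nsmul, show t + (n - t) = n from by omega, hnx]
      · refine mem_apFinset.2 ⟨n - t + 1, by omega, ?_⟩
        rw [← hty, ← add_nsmul, show t + (n - t + 1) = n + 1 from by omega, succ_nsmul, hnx, zero_add]
      · exact mem_apFinset.2 ⟨0, by omega, by rw [zero_nsmul, add_zero]⟩
    obtain ⟨d, hd, c, hcI, hcle, hall⟩ := rect y (n - t + 2) hSsub (by omega) (by omega)
    set IS := (range (n - t + 2)).filter fun j => y + j • x ∈ ({0, x, y} : Finset G) with hIS
    have hISeq : IS = {n - t, n - t + 1, 0} := by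
      ext j
      rw [hIS, mem_filter, mem_range, mem_insert, mem_insert, mem_singleton, mem_insert,
        mem_insert, mem_singleton, ← hty, ← add_nsmul]
      constructor
      · rintro ⟨hj, h | h | h⟩
        · left
          by_contra hne
          -- `(t + j) • x = 0 = n • x` with `t + j ≠ n`
          rcases Nat.lt_or_ge (t + j) n with hlt | hge
          · have := hinj (t + j) 0 hlt (by omega) (by rw [h, zero_nsmul]); omega
          · have h' : (t + j - n) • x = 0 := by
              have : (t + j) • x = (t + j - n) • x + n • x := by
                rw [← add_nsmul]; congr 1; omega
              rw [this, hnx, add_zero] at h; exact h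
            have := hinj (t + j - n) 0 (by omega) (by omega) (by rw [h', zero_nsmul]); omega
        · right; left
          rcases Nat.lt_or_ge (t + j) n with hlt | hge
          · have := hinj (t + j) 1 hlt (by omega) (by rw [h, one_nsmul]); omega
          · have h' : (t + j - n) • x = x := by
              have : (t + j) • x = (t + j - n) • x + n • x := by
                rw [← add_nsmul]; congr 1; omega
              rw [this, hnx, add_zero] at h; exact h
            have := hinj (t + j - n) 1 (by omega) (by omega) (by rw [h', one_nsmul]); omega
        · right; right
          have := hinj (t + j) t (by
            by_contra hge
            push Not at hge
            have h' : (t + j - n) • x = t • x := by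
              have : (t + j) • x = (t + j - n) • x + n • x := by
                rw [← add_nsmul]; congr 1; omega
              rw [this, hnx, add_zero] at h; exact h
            have := hinj (t + j - n) t (by omega) ht h'
            omega) ht h
          omega
      · rintro (rfl | rfl | rfl)
        · exact ⟨by omega, Or.inl (by rw [show t + (n - t) = n from by omega, hnx])⟩
        · exact ⟨by omega, Or.inr (Or.inl (by
            rw [show t + (n - t + 1) = n + 1 from by omega, succ_nsmul, hnx, zero_add]))⟩
        · exact ⟨by omega, Or.inr (Or.inr (by rw [add_zero]))⟩
    have hIeq : IS.image f = {((n - t : ℕ) : ℤ), ((n - t + 1 : ℕ) : ℤ), (0 : ℤ)} := by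
      rw [hISeq, image_insert, image_insert, image_singleton]
      simp [hf]
    rw [hIeq] at hcI hcle hall
    have hc0 : c = 0 := by
      have h0le := hcle 0 (by simp)
      simp only [mem_insert, mem_singleton] at hcI
      rcases hcI with rfl | rfl | rfl <;> omega
    subst hc0
    obtain ⟨i2, -, he2⟩ := hall ((n - t : ℕ) : ℤ) (by simp)
    obtain ⟨i3, hi3, he3⟩ := hall ((n - t + 1 : ℕ) : ℤ) (by simp)
    have hd1 : d = 1 := by
      refine Int.eq_one_of_mul_eq_one_left hd.le (a := (i3 : ℤ) - i2) ?_
      push_cast at he2 he3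
      linarith
    subst hd1
    have hnt : n - t + 1 < 4 := by push_cast at he3; omega
    exact ⟨x, y, hr, hSsub.trans (apFinset_mono y x (by omega))⟩
  -- the middle values of `t`: `S` lies in a `4`-term progression of difference `h = x/2`
  set h : G := ((n + 1) / 2) • x with hh
  have h2h : h + h = x := by
    rw [hh, ← add_nsmul, show (n + 1) / 2 + (n + 1) / 2 = n + 1 from by omega, succ_nsmul, ← hordx,
      addOrderOf_nsmul_eq_zero, zero_add]
  have hrh : AddSubgroup.zmultiples h = ⊤ := by
    rw [eq_top_iff, ← hr]
    refine (AddSubgroup.zmultiples_le).2 ?_   -- hmm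
    rw [← h2h]
    exact AddSubgroup.add_mem _ (AddSubgroup.mem_zmultiples h) (AddSubgroup.mem_zmultiples h)
  have h3h : (3 : ℕ) • h = h + h + h := by
    rw [show (3 : ℕ) = 1 + 1 + 1 from rfl, add_nsmul, add_nsmul, one_nsmul]
  have hcases : 2 * t + 1 = n ∨ 2 * t = n + 1 ∨ 2 * t = n + 3 := by omega
  rcases hcases with hc | hc | hc
  · -- `y = −h`
    have hyh : y = -h := by
      rw [← hty, hh, eq_neg_iff_add_eq_zero, ← add_nsmul, show t + (n + 1) / 2 = n from by omega,
        ← hordx, addOrderOf_nsmul_eq_zero]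
    refine ⟨h, -h, hrh, ?_⟩
    intro u hu
    rw [mem_insert, mem_insert, mem_singleton] at hu
    rcases hu with rfl | rfl | rfl
    · exact mem_apFinset.2 ⟨1, by omega, by rw [one_nsmul, neg_add_cancel]⟩
    · exact mem_apFinset.2 ⟨3, by omega, by rw [h3h, ← h2h]; abel⟩
    · exact mem_apFinset.2 ⟨0, by omega, by rw [zero_nsmul, add_zero, hyh]⟩
  · -- `y = h`
    have hyh : y = h := by rw [← hty, hh, show t = (n + 1) / 2 from by omega]
    refine ⟨h, 0, hrh, ?_⟩
    intro u hu
    rw [mem_insert, mem_insert, mem_singleton] at hu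
    rcases hu with rfl | rfl | rfl
    · exact mem_apFinset.2 ⟨0, by omega, by rw [zero_nsmul, add_zero]⟩
    · exact mem_apFinset.2 ⟨2, by omega, by rw [two_nsmul, zero_add, h2h]⟩
    · exact mem_apFinset.2 ⟨1, by omega, by rw [one_nsmul, zero_add, hyh]⟩
  · -- `y = 3h`
    have hyh : y = h + h + h := by
      rw [← hty, hh, show t = (n + 1) / 2 + (n + 1) / 2 + (n + 1) / 2 - n from by omega]
      rw [show (n + 1) / 2 + (n + 1) / 2 + (n + 1) / 2 - n = ((n + 1) / 2 + (n + 1) / 2 + (n + 1) / 2) - n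
        from rfl, sub_nsmul _ (by omega), add_nsmul, add_nsmul, ← hordx, addOrderOf_nsmul_eq_zero]
      abel
    refine ⟨h, 0, hrh, ?_⟩
    intro u hu
    rw [mem_insert, mem_insert, mem_singleton] at hu
    rcases hu with rfl | rfl | rfl
    · exact mem_apFinset.2 ⟨0, by omega, by rw [zero_nsmul, add_zero]⟩
    · exact mem_apFinset.2 ⟨2, by omega, by rw [two_nsmul, zero_add, h2h]⟩
    · exact mem_apFinset.2 ⟨3, by omega, by rw [h3h, zero_add, hyh]⟩

/-- **[HamidouneSerraZemor2008, §7, Lemma 27]:** "Let `S` be a `4`-separable generating subset of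
an abelian group `G` of order `n` such that `0 ∈ S`, `|S| = 3` and `κ₄(S) = |S| = 3`.  Assume
moreover that `gcd(n, 6) = 1`.  Then `G` is a cyclic group and `S` is a quasi-progression."  Here
with the conclusion in the form used by §8: for some generator `r` of `G` (`⟨r⟩ = G`, so `G` is
cyclic) and some `a`, `S ⊆ {a, a + r, a + 2r, a + 3r}`.  Proof as printed up to the re-routing
recorded at `zmultiples_eq_top_of_card_union_vadd_le` and
`exists_subset_apFinset_four_of_two_le_card_inter`: a `4`-atom `A ∋ 0` has `|A| = 4` (Lemma 23)
and generates `G` ("otherwise `|A + S| ≥ 2|A| > |A| + |S|`"); with `S = {0, x, y}`, either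
`|A + {x, y}| = |A| + 1` and `A` is a `(y − x)`-progression, or `|A ∩ (A + x)| ≥ 2` up to
exchanging `x` and `y`. [cite: HamidouneSerraZemor2008, §7, Lemma 27] -/
theorem exists_subset_apFinset_of_conn_four_eq_three {S : Finset G} (h0 : (0 : G) ∈ S)
    (hgen : AddSubgroup.closure (S : Set G) = ⊤) (hS3 : #S = 3) (hκ : conn 4 S = 3)
    (hsep : IsSeparable 4 S) (hcop : (Fintype.card G).Coprime 6) :
    ∃ r a : G, AddSubgroup.zmultiples r = ⊤ ∧ S ⊆ apFinset a r 4 := by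
  classical
  set n := Fintype.card G with hn
  have hord5 : ∀ g : G, g ≠ 0 → 5 ≤ addOrderOf g := fun g hg =>
    five_le_addOrderOf_of_coprime_six hcop hg
  obtain ⟨A', hA'⟩ := exists_isAtom hsep
  have hA'ne : A'.Nonempty := card_pos.1 (by have := hA'.1.1.1; omega)
  obtain ⟨a0, ha0⟩ := hA'ne
  set A := (-a0) +ᵥ A' with hA
  have hAat : IsAtom 4 S A := hA'.vadd (-a0)
  have h0A : (0 : G) ∈ A := mem_vadd_finset.2 ⟨a0, ha0, by rw [vadd_eq_add, neg_add_cancel]⟩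
  clear_value A
  have hA4 : #A = 4 := IsAtom.card_eq_four_of_conn_four_eq_three h0 hgen hS3 hκ hAat h0A
  have hAS : #(A + S) = 7 := by
    have h1 := hAat.1.2
    have h2 := card_le_card_add h0 A
    rw [hκ] at h1
    omega
  have hn11 : 11 ≤ n := by
    have := hAat.1.1.2
    omega
  -- `A` generates `G`
  have hgenA : AddSubgroup.closure (A : Set G) = ⊤ := by
    by_contra hH
    set H := AddSubgroup.closure (A : Set G) with hHdef
    obtain ⟨s, hsS, hsH⟩ : ∃ s ∈ S, s ∉ H := by
      by_contra h
      push Not at h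
      apply hH
      rw [eq_top_iff, ← hgen, AddSubgroup.closure_le]
      exact fun g hg => h g (mem_coe.1 hg)
    have hsub : A ∪ (s +ᵥ A) ⊆ A + S := by
      apply union_subset
      · exact subset_add_left _ h0
      · intro u hu
        obtain ⟨a, ha, rfl⟩ := mem_vadd_finset.1 hu
        exact mem_add.2 ⟨a, ha, s, hsS, by rw [vadd_eq_add, add_comm]⟩
    have hdisj : Disjoint A (s +ᵥ A) := by
      rw [disjoint_left]
      intro u huA hus
      obtain ⟨a, ha, rfl⟩ := mem_vadd_finset.1 hus
      apply hsH
      have h1 : (s +ᵥ a) ∈ H := AddSubgroup.subset_closure (mem_coe.2 huA)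
      have h2 : a ∈ H := AddSubgroup.subset_closure (mem_coe.2 ha)
      have : s = (s +ᵥ a) - a := by rw [vadd_eq_add, add_sub_cancel_right]
      rw [this]
      exact H.sub_mem h1 h2
    have := card_le_card hsub
    rw [card_union_of_disjoint hdisj, card_vadd_finset, hA4, hAS] at this
    omega
  obtain ⟨x, y, hx, hy, hxy, hSeq⟩ := exists_eq_triple_of_card_eq_three h0 hS3
  subst hSeq
  have h7 : #(A ∪ (x +ᵥ A) ∪ (y +ᵥ A)) = 7 := by rw [← add_triple_eq_union]; exact hAS
  have hcnt : ∀ z : G, #(A ∪ (z +ᵥ A)) = 4 + #((z +ᵥ A) \ A) := fun z => by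
    rw [← union_sdiff_self_eq_union, card_union_of_disjoint disjoint_sdiff, hA4]
  have hxyu : #((x +ᵥ A) ∪ (y +ᵥ A)) = #(A ∪ ((y - x) +ᵥ A)) := by
    have : (x +ᵥ A) ∪ (y +ᵥ A) = x +ᵥ (A ∪ ((y - x) +ᵥ A)) := by
      rw [vadd_finset_union, vadd_vadd, add_sub_cancel]
    rw [this, card_vadd_finset]
  have hie := card_union_add_card_inter A ((x +ᵥ A) ∪ (y +ᵥ A))
  rw [← union_assoc, h7, hxyu, hcnt (y - x), hA4] at hie
  by_cases hyx1 : #(((y - x) +ᵥ A) \ A) ≤ 1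
  · -- `A` is a `(y − x)`-progression
    have hyx0 : y - x ≠ 0 := sub_ne_zero.2 (Ne.symm hxy)
    obtain ⟨hr, b, hb⟩ := subset_apFinset_four_of_card_vadd_sdiff_le_one h0A hgenA hA4
      (hord5 _ hyx0) hyx1 hS3 hAS (by omega)
    exact ⟨y - x, b, hr, hb⟩
  · have hge : 3 ≤ #(A ∩ ((x +ᵥ A) ∪ (y +ᵥ A))) := by omega
    have hle : #(A ∩ ((x +ᵥ A) ∪ (y +ᵥ A))) ≤ #(A ∩ (x +ᵥ A)) + #(A ∩ (y +ᵥ A)) := by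
      rw [inter_union_distrib_left]; exact card_union_le _ _
    rcases le_or_gt 2 #(A ∩ (x +ᵥ A)) with h2 | h2
    · exact exists_subset_apFinset_four_of_two_le_card_inter h0A hgenA hA4 hgen hcop hx hy hxy h7
        h2 hn11
    · have h2' : 2 ≤ #(A ∩ (y +ᵥ A)) := by omega
      have hgen' : AddSubgroup.closure (({0, y, x} : Finset G) : Set G) = ⊤ := by
        rw [pair_comm]; exact hgen
      have h7' : #(A ∪ (y +ᵥ A) ∪ (x +ᵥ A)) = 7 := by rw [union_right_comm]; exact h7
      obtain ⟨r, a, hr, hsub⟩ := exists_subset_apFinset_four_of_two_le_card_inter h0A hgenA hA4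
        hgen' hcop hy hx (Ne.symm hxy) h7' h2' hn11
      exact ⟨r, a, hr, by rw [pair_comm] at hsub; exact hsub⟩

/-! ### §6, Lemma 24: the `3`-atoms of a `4`-set with `κ₃ = 4` have three elements -/

/-- **Cauchy–Davenport below the smallest order** (a consequence of Kneser's theorem, playing the
role of "by Corollary 8, `κ₁(Z) = |Z| − 1` for each subset `0 ∈ Z ⊂ G` with `|Z| ≤ 3`, since
the order of any nonzero element in `G` is at least `5`" in the proof of Lemma 24): if every
non-zero element has order `≥ m` and `|W + T| < m` for nonempty `W, T`, then
`|W + T| ≥ |W| + |T| − 1` (the stabilizer of `W + T` is trivial, being smaller than any non-zero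
cyclic subgroup). [cite: HamidouneSerraZemor2008, §6 (proof of Lemma 24, Claim 1)]
[cite: Nathanson1996, §4.1 (Kneser's theorem)] -/
theorem card_add_card_le_card_add_succ_of_card_add_lt {m : ℕ}
    (hord : ∀ g : G, g ≠ 0 → m ≤ addOrderOf g) {W T : Finset G} (hW : W.Nonempty)
    (hT : T.Nonempty) (hlt : #(W + T) < m) : #W + #T ≤ #(W + T) + 1 := by
  classical
  obtain ⟨hkn, -⟩ := card_add_card_le_card_add_add_card_addStab_and_dvd W T hW hT
  set H := (W + T).addStab with hH
  have hWT : (W + T).Nonempty := hW.add hT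
  have hH1 : #H ≤ 1 := by
    by_contra hlt1
    obtain ⟨a, ha, b, hb, hab⟩ := one_lt_card.1 (by omega : 1 < #H)
    -- a non-zero period `h`
    obtain ⟨h, hh, hh0⟩ : ∃ h ∈ H, h ≠ 0 := by
      by_cases ha0 : a = 0
      · exact ⟨b, hb, fun hb0 => hab (ha0.trans hb0.symm)⟩
      · exact ⟨a, ha, ha0⟩
    have hper : h +ᵥ (W + T) = W + T := (mem_addStab hWT).1 hh
    have h1 := card_apFinset_zero_addOrderOf_le_card hper hWT
    rw [card_apFinset_of_le_addOrderOf 0 h le_rfl] at h1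
    have := hord h hh0
    omega
  omega

/-- **Claim 1 in the proof of [HamidouneSerraZemor2008, Lemma 24]: `S ∖ {0}` is an arithmetic
progression.**  Hypotheses (all established in the printed proof before the claim): `0 ∈ S`
generating with `|S| = 4`, `A ∋ 0` with `|A| = 4`, `A + S = A + (S ∖ {s})` for every `s ∈ S`
(Lemma 4), `|A ∩ (g + A)| ≤ 2` for `g ≠ 0` (Corollary 9), `|A + S| = 8`, `|G| ≥ 13`, every
non-zero element of order `≥ 5`.  Proof as printed, with the layers `N_i = (A + iS) ∖ (A + (i−1)S)`
and their decomposition `N_i = ⊔_X N_i^X` by the type `X = {s ∈ S : u − s ∈ N_{i−1}}` (a pair of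
`S*` or `S*` itself — singletons are excluded by Lemma 4 and (eq:nx1)); `|N_1^{S*∖x}| ≤ 2`,
`|N_2^X| + 1 ≤ |N_1^X|`, `N_3^X = ∅` for pairs `X`, `|N_2^{S*}| + 2 ≤ |N_1| = 4`; if
`|N_2^{S*}| = 2` the pair `(N_2^{S*}, −S*)` is critical and `S*` is a progression; otherwise
`|N_2| ≤ 3`, `|N_3| ≤ 1`, `N_4 = ∅` and `A + 3S = G` has at most `12 < 13` elements.  The
Chowla-type counts are `card_add_card_le_card_add_succ_of_card_add_lt`.
[cite: HamidouneSerraZemor2008, §6, Lemma 24 (proof, Claim 1)] -/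
theorem isAP_erase_zero_of_layers {S A : Finset G} (h0 : (0 : G) ∈ S) (hS4 : #S = 4)
    (hgen : AddSubgroup.closure (S : Set G) = ⊤) (h0A : (0 : G) ∈ A) (hA4 : #A = 4)
    (hL4 : ∀ s ∈ S, A + S.erase s = A + S) (hC9 : ∀ g : G, g ≠ 0 → #(A ∩ (g +ᵥ A)) ≤ 2)
    (hAS : #(A + S) = 8) (hG : 13 ≤ Fintype.card G)
    (hord5 : ∀ g : G, g ≠ 0 → 5 ≤ addOrderOf g) :
    ∃ d : G, d ≠ 0 ∧ IsAP (S.erase 0) d := by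
  classical
  set S' := S.erase 0 with hS'
  have hS'3 : #S' = 3 := by rw [hS', card_erase_of_mem h0, hS4]
  have hmemS' : ∀ s, s ∈ S' ↔ s ≠ 0 ∧ s ∈ S := fun s => by rw [hS', mem_erase]
  -- the layers `L i = A + iS`
  obtain ⟨L, hL0, hLs⟩ : ∃ L : ℕ → Finset G, L 0 = A ∧ ∀ i, L (i + 1) = L i + S :=
    ⟨fun n => Nat.rec A (fun _ X => X + S) n, rfl, fun _ => rfl⟩
  have hLmono : ∀ i, L i ⊆ L (i + 1) := fun i => by rw [hLs]; exact subset_add_left _ h0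
  -- the type of a point of a layer
  set X : ℕ → G → Finset G := fun i u => S.filter fun s => u - s ∈ L i with hX
  have hXmem : ∀ i u s, s ∈ X i u ↔ s ∈ S ∧ u - s ∈ L i := fun i u s => by rw [hX, mem_filter]
  have hXsub : ∀ i u, u ∈ L (i + 1) \ L i → X i u ⊆ S' := by
    intro i u hu s hs
    rw [hXmem] at hs
    rw [hmemS']
    refine ⟨?_, hs.1⟩
    rintro rfl
    rw [sub_zero] at hs
    exact (mem_sdiff.1 hu).2 hs.2
  have hXne : ∀ i u, u ∈ L (i + 1) \ L i → (X i u).Nonempty := by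
    intro i u hu
    rw [mem_sdiff, hLs] at hu
    obtain ⟨v, hv, s, hs, rfl⟩ := mem_add.1 hu.1
    exact ⟨s, (hXmem _ _ _).2 ⟨hs, by rw [add_sub_cancel_right]; exact hv⟩⟩
  -- (eq:nx1)
  have hnx : ∀ i u, u ∈ L (i + 2) \ L (i + 1) → ∀ x ∈ X (i + 1) u,
      u - x ∈ L (i + 1) \ L i ∧ X i (u - x) ⊆ X (i + 1) u := by
    intro i u hu x hx
    rw [hXmem] at hx
    rw [mem_sdiff] at hu
    refine ⟨mem_sdiff.2 ⟨hx.2, fun h => hu.2 ?_⟩, fun y hy => ?_⟩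
    · rw [hLs]
      exact mem_add.2 ⟨u - x, h, x, hx.1, sub_add_cancel u x⟩
    · rw [hXmem] at hy ⊢
      refine ⟨hy.1, ?_⟩
      rw [hLs]
      exact mem_add.2 ⟨u - x - y, hy.2, x, hx.1, by abel⟩
  -- (F1): no singleton types
  have hX2 : ∀ i u, u ∈ L (i + 1) \ L i → 2 ≤ #(X i u) := by
    intro i
    induction i with
    | zero =>
      intro u hu
      have hu' := hu
      rw [mem_sdiff, hLs, hL0] at hu'
      obtain ⟨a, ha, s, hs, rfl⟩ := mem_add.1 hu'.1
      have : a + s ∈ A + S.erase s := by rw [hL4 s hs]; exact mem_add.2 ⟨a, ha, s, hs, rfl⟩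
      obtain ⟨a', ha', s', hs', he⟩ := mem_add.1 this
      rw [mem_erase] at hs'
      have h2 : ({s, s'} : Finset G) ⊆ X 0 (a + s) := by
        intro z hz
        rw [mem_insert, mem_singleton] at hz
        rw [hXmem, hL0]
        rcases hz with rfl | rfl
        · exact ⟨hs, by rw [add_sub_cancel_right]; exact ha⟩
        · exact ⟨hs'.2, by rw [← he, add_sub_cancel_right]; exact ha'⟩
      calc 2 = #({s, s'} : Finset G) := (card_pair (Ne.symm hs'.1)).symm
        _ ≤ _ := card_le_card h2
    | succ i ih =>
      intro u hu
      obtain ⟨x, hx⟩ := hXne (i + 1) u hu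
      obtain ⟨h1, h2⟩ := hnx i u hu x hx
      exact (ih _ h1).trans (card_le_card h2)
  -- the type is `S'` or `S' ∖ {x}`
  have htype : ∀ i u, u ∈ L (i + 1) \ L i → X i u = S' ∨ ∃ x ∈ S', X i u = S'.erase x := by
    intro i u hu
    have hsub := hXsub i u hu
    have h2 := hX2 i u hu
    by_cases heq : X i u = S'
    · exact Or.inl heq
    · right
      have hcard : #(S' \ X i u) = 1 := by
        have := card_sdiff_add_card_eq_card hsub
        have hlt : #(X i u) < #S' := card_lt_card (hsub.ssubset_of_ne heq)
        omega
      obtain ⟨x, hx⟩ := card_eq_one.1 hcard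
      have hxS' : x ∈ S' ∧ x ∉ X i u := by
        have : x ∈ S' \ X i u := by rw [hx]; exact mem_singleton_self x
        exact mem_sdiff.1 this
      refine ⟨x, hxS'.1, ?_⟩
      ext z
      rw [mem_erase]
      constructor
      · intro hz
        exact ⟨fun h => hxS'.2 (h ▸ hz), hsub hz⟩
      · rintro ⟨hzx, hzS'⟩
        by_contra hzX
        have : z ∈ S' \ X i u := mem_sdiff.2 ⟨hzS', hzX⟩
        rw [hx, mem_singleton] at this
        exact hzx this
  -- the classes
  set CP : ℕ → G → Finset G := fun i x => (L (i + 1) \ L i).filter fun u => X i u = S'.erase x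
    with hCP
  set CS : ℕ → Finset G := fun i => (L (i + 1) \ L i).filter fun u => X i u = S' with hCS
  have hmemCP : ∀ i x u, u ∈ CP i x ↔ u ∈ L (i + 1) \ L i ∧ X i u = S'.erase x := fun i x u => by
    rw [hCP, mem_filter]
  have hmemCS : ∀ i u, u ∈ CS i ↔ u ∈ L (i + 1) \ L i ∧ X i u = S' := fun i u => by
    rw [hCS, mem_filter]
  -- partition count
  have hpart : ∀ i, #(L (i + 1) \ L i) = #(CS i) + ∑ x ∈ S', #(CP i x) := by
    intro i
    have hcov : L (i + 1) \ L i = CS i ∪ S'.biUnion (CP i) := by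
      ext u
      rw [mem_union, mem_biUnion, hmemCS]
      constructor
      · intro hu
        rcases htype i u hu with h | ⟨x, hx, h⟩
        · exact Or.inl ⟨hu, h⟩
        · exact Or.inr ⟨x, hx, (hmemCP i x u).2 ⟨hu, h⟩⟩
      · rintro (⟨hu, -⟩ | ⟨x, -, hux⟩)
        · exact hu
        · exact ((hmemCP i x u).1 hux).1
    have hdisj1 : Disjoint (CS i) (S'.biUnion (CP i)) := by
      rw [disjoint_left]
      intro u hu hu'
      rw [hmemCS] at hu
      obtain ⟨x, hx, hux⟩ := mem_biUnion.1 hu'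
      rw [hmemCP] at hux
      have : x ∈ S'.erase x := by rw [← hux.2, hu.2]; exact hx
      exact notMem_erase x S' this
    have hdisj2 : ∀ x ∈ S', ∀ x' ∈ S', x ≠ x' → Disjoint (CP i x) (CP i x') := by
      intro x hx x' hx' hne
      rw [disjoint_left]
      intro u hu hu'
      rw [hmemCP] at hu hu'
      have : S'.erase x = S'.erase x' := hu.2.symm.trans hu'.2
      exact hne ((erase_inj S' hx).1 this)
    rw [hcov, card_union_of_disjoint hdisj1, card_biUnion hdisj2]
  -- `|N_1| = 4`
  have hL1 : L 1 = A + S := by rw [hLs, hL0]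
  have hcL0 : #(L 0) = 4 := by rw [hL0, hA4]
  have hcL1 : #(L 1) = 8 := by rw [hL1, hAS]
  have hN1 : #(L 1 \ L 0) = 4 := by
    have : #(L 1 \ L 0) + #(L 0) = #(L 1) := card_sdiff_add_card_eq_card (hLmono 0)
    omega
  -- the three elements of `S'`
  obtain ⟨x1, x2, x3, h12, h13, h23, hS'eq⟩ := card_eq_three.1 hS'3
  have hx1 : x1 ∈ S' := by rw [hS'eq]; simp
  have hx2 : x2 ∈ S' := by rw [hS'eq]; simp
  have hx3 : x3 ∈ S' := by rw [hS'eq]; simp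
  have hsum : ∀ f : G → ℕ, ∑ x ∈ S', f x = f x1 + (f x2 + f x3) := by
    intro f
    rw [hS'eq, sum_insert (by simp [h12, h13]), sum_insert (by simp [h23]), sum_singleton]
  -- (F3): `|N_1^{S' ∖ x}| ≤ 2`
  have hF3 : ∀ x ∈ S', #(CP 0 x) ≤ 2 := by
    intro x hx
    have hx0 : x ≠ 0 := ((hmemS' x).1 hx).1
    have hxS : x ∈ S := ((hmemS' x).1 hx).2
    have hsub : (x +ᵥ A) \ A ⊆ (L 1 \ L 0) \ CP 0 x := by
      intro u hu
      rw [mem_sdiff] at hu ⊢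
      obtain ⟨a, ha, rfl⟩ := mem_vadd_finset.1 hu.1
      have huN : x +ᵥ a ∈ L 1 \ L 0 := by
        rw [mem_sdiff, hL1, hL0]
        exact ⟨mem_add.2 ⟨a, ha, x, hxS, by rw [vadd_eq_add, add_comm]⟩, hu.2⟩
      refine ⟨huN, fun h => ?_⟩
      rw [hmemCP] at h
      have : x ∈ X 0 (x +ᵥ a) :=
        (hXmem _ _ _).2 ⟨hxS, by rw [vadd_eq_add, add_sub_cancel_left, hL0]; exact ha⟩
      rw [h.2] at this
      exact notMem_erase x S' this
    have h1 : 2 ≤ #((x +ᵥ A) \ A) := by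
      have := card_sdiff_add_card_inter (x +ᵥ A) A
      rw [card_vadd_finset, inter_comm] at this
      have := hC9 x hx0
      omega
    have h2 : #((L 1 \ L 0) \ CP 0 x) + #(CP 0 x) = #(L 1 \ L 0) :=
      card_sdiff_add_card_eq_card (filter_subset _ _)
    have := card_le_card hsub
    omega
  -- (F4): `N_{i+1}^P − P ⊆ N_i^P` for the pair types
  have hF4 : ∀ x ∈ S', ∀ i, CP (i + 1) x + (-(S'.erase x)) ⊆ CP i x := by
    intro x hx i u hu
    obtain ⟨w, hw, z, hz, rfl⟩ := mem_add.1 hu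
    rw [mem_neg'] at hz
    rw [hmemCP] at hw
    have hyX : -z ∈ X (i + 1) w := by rw [hw.2]; exact hz
    obtain ⟨h1, h2⟩ := hnx i w hw.1 (-z) hyX
    rw [sub_neg_eq_add] at h1 h2
    rw [hmemCP]
    refine ⟨h1, ?_⟩
    apply eq_of_subset_of_card_le (h2.trans hw.2.subset)
    rw [card_erase_of_mem hx, hS'3]
    exact hX2 i _ h1
  -- (F5): `N_{i+1}^{S'} − S' ⊆ N_i`
  have hF5 : ∀ i, CS (i + 1) + (-S') ⊆ L (i + 1) \ L i := by
    intro i u hu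
    obtain ⟨w, hw, z, hz, rfl⟩ := mem_add.1 hu
    rw [mem_neg'] at hz
    rw [hmemCS] at hw
    have := (hnx i w hw.1 (-z) (by rw [hw.2]; exact hz)).1
    rwa [sub_neg_eq_add] at this
  have hnegP : ∀ x ∈ S', #(-(S'.erase x)) = 2 := fun x hx => by
    rw [card_neg, card_erase_of_mem hx, hS'3]
  have hnegS : #(-S') = 3 := by rw [card_neg, hS'3]
  -- the Chowla-type counts
  have hKC : ∀ (W T U : Finset G), W + T ⊆ U → #U < 5 → T.Nonempty →
      #W = 0 ∨ #W + #T ≤ #U + 1 := by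
    intro W T U hsub hU hT
    rcases W.eq_empty_or_nonempty with h | hW
    · exact Or.inl (by rw [h, card_empty])
    · right
      have hlt : #(W + T) < 5 := (card_le_card hsub).trans_lt hU
      have := card_add_card_le_card_add_succ_of_card_add_lt hord5 hW hT hlt
      have := card_le_card hsub
      omega
  have hc2 : ∀ x ∈ S', #(CP 1 x) = 0 ∨ #(CP 1 x) + 2 ≤ #(CP 0 x) + 1 := by
    intro x hx
    have := hKC (CP 1 x) (-(S'.erase x)) (CP 0 x) (hF4 x hx 0) (by have := hF3 x hx; omega)
      (by rw [← card_pos, hnegP x hx]; omega)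
    rwa [hnegP x hx] at this
  have hc3 : ∀ x ∈ S', CP 2 x = ∅ := by
    intro x hx
    have := hKC (CP 2 x) (-(S'.erase x)) (CP 1 x) (hF4 x hx 1)
      (by rcases hc2 x hx with h | h <;> · have := hF3 x hx; omega)
      (by rw [← card_pos, hnegP x hx]; omega)
    rw [hnegP x hx] at this
    apply card_eq_zero.1
    have := hF3 x hx
    rcases hc2 x hx with h | h <;> omega
  have hc4 : ∀ x ∈ S', CP 3 x = ∅ := by
    intro x hx
    have hsub := hF4 x hx 2
    rw [hc3 x hx] at hsub
    rcases (CP 3 x).eq_empty_or_nonempty with h | ⟨w, hw⟩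
    · exact h
    · exfalso
      obtain ⟨z, hz⟩ : (-(S'.erase x)).Nonempty := by rw [← card_pos, hnegP x hx]; omega
      exact notMem_empty _ (hsub (add_mem_add hw hz))
  have hcS2 : #(CS 1) = 0 ∨ #(CS 1) + 3 ≤ 4 + 1 := by
    have := hKC (CS 1) (-S') (L 1 \ L 0) (hF5 0) (by rw [hN1]; omega)
      (by rw [← card_pos, hnegS]; omega)
    rwa [hnegS, hN1] at this
  by_cases hcrit : #(CS 1) = 2
  · -- the critical pair `(N_2^{S'}, −S')`: `S'` is an arithmetic progression
    have h4 : #(CS 1 + (-S')) = 4 := by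
      have h1 : #(CS 1 + (-S')) ≤ 4 := (card_le_card (hF5 0)).trans hN1.le
      have h2 := card_add_card_le_card_add_succ_of_card_add_lt hord5
        (card_pos.1 (by omega) : (CS 1).Nonempty) (by rw [← card_pos, hnegS]; omega)
        (by omega : #(CS 1 + (-S')) < 5)
      rw [hcrit, hnegS] at h2
      omega
    obtain ⟨w1, w2, hw12, hCSeq⟩ := card_eq_two.1 hcrit
    set T := -S' with hT
    set d := w1 - w2 with hd
    have hd0 : d ≠ 0 := sub_ne_zero.2 hw12
    have hunion : CS 1 + T = (w1 +ᵥ T) ∪ (w2 +ᵥ T) := by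
      rw [hCSeq, insert_eq, union_add, singleton_add, singleton_add]
    have hcount : #((d +ᵥ T) \ T) = 1 := by
      have h1 : (w1 +ᵥ T) ∪ (w2 +ᵥ T) = w2 +ᵥ ((d +ᵥ T) ∪ T) := by
        rw [vadd_finset_union, vadd_vadd, hd, add_sub_cancel]
      have h2 : #((d +ᵥ T) ∪ T) = 4 := by rw [← card_vadd_finset w2, ← h1, ← hunion, h4]
      have h3 : #((d +ᵥ T) ∪ T) = #((d +ᵥ T) \ T) + #T := by
        rw [← sdiff_union_self_eq_union, card_union_of_disjoint sdiff_disjoint]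
      rw [hnegS] at h3
      omega
    obtain ⟨t0, -, ℓ, -, hTeq, hPinv, hAPcard, -⟩ :=
      exists_eq_filter_union_apFinset_of_card_vadd_sdiff_eq_one hcount
    set P := T.filter fun u => u +ᵥ apFinset (0 : G) d (addOrderOf d) ⊆ T with hP
    have hP0 : P = ∅ := by
      rcases P.eq_empty_or_nonempty with h | hne
      · exact h
      · exfalso
        have h1 := card_apFinset_zero_addOrderOf_le_card hPinv hne
        rw [card_apFinset_of_le_addOrderOf 0 d le_rfl] at h1
        have hP3 : #P ≤ 3 := (card_le_card (filter_subset _ _)).trans hnegS.le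
        have := hord5 d hd0
        omega
    rw [hP0, empty_union] at hTeq
    have hℓ : ℓ = 3 := by rw [← hAPcard, ← hTeq, hnegS]
    have hT3' : T = apFinset t0 d (2 + 1) := by rw [hTeq, hℓ]
    refine ⟨d, hd0, -t0 - 2 • d, ?_⟩
    rw [hS'3, show S' = -T from by rw [hT, neg_neg], hT3', neg_apFinset]
  · -- otherwise the layers die out before covering `G`
    have hcS1 : #(CS 1) ≤ 1 := by rcases hcS2 with h | h <;> omega
    have hN2 : #(L 2 \ L 1) ≤ 3 := by
      rw [hpart 1, hsum]
      have hc1sum : #(CP 0 x1) + (#(CP 0 x2) + #(CP 0 x3)) ≤ 4 := by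
        have := hpart 0
        rw [hN1, hsum] at this
        omega
      have e1 := hc2 x1 hx1
      have e2 := hc2 x2 hx2
      have e3 := hc2 x3 hx3
      have f1 := hF3 x1 hx1
      have f2 := hF3 x2 hx2
      have f3 := hF3 x3 hx3
      omega
    have hcS3 : #(CS 2) ≤ 1 := by
      have := hKC (CS 2) (-S') (L 2 \ L 1) (hF5 1) (by omega)
        (by rw [← card_pos, hnegS]; omega)
      rw [hnegS] at this
      omega
    have hN3 : #(L 3 \ L 2) ≤ 1 := by
      rw [hpart 2, hsum, hc3 x1 hx1, hc3 x2 hx2, hc3 x3 hx3, card_empty]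
      omega
    have hCS3 : CS 3 = ∅ := by
      rcases (CS 3).eq_empty_or_nonempty with h | ⟨w, hw⟩
      · exact h
      · exfalso
        have hsub : w +ᵥ (-S') ⊆ L 3 \ L 2 := by
          intro u hu
          obtain ⟨z, hz, rfl⟩ := mem_vadd_finset.1 hu
          exact hF5 2 (mem_add.2 ⟨w, hw, z, hz, rfl⟩)
        have := card_le_card hsub
        rw [card_vadd_finset, hnegS] at this
        omega
    have hN4 : #(L 4 \ L 3) = 0 := by
      rw [hpart 3, hCS3, hsum, hc4 x1 hx1, hc4 x2 hx2, hc4 x3 hx3, card_empty]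
    have hL43 : L 3 + S = L 3 := by
      rw [← hLs]
      have h1 : L 4 ⊆ L 3 := by
        rw [← sdiff_eq_empty_iff_subset, ← card_eq_zero]; exact hN4
      exact subset_antisymm h1 (hLmono 3)
    have hL3ne : (L 3).Nonempty :=
      ⟨0, hLmono 2 (hLmono 1 (hLmono 0 (by rw [hL0]; exact h0A)))⟩
    have hL3u : L 3 = univ := eq_univ_of_add_eq_of_closure_eq_top hL3ne hgen hL43
    have hc12 : #(L 2 \ L 1) + #(L 1) = #(L 2) := card_sdiff_add_card_eq_card (hLmono 1)
    have hc23 : #(L 3 \ L 2) + #(L 2) = #(L 3) := card_sdiff_add_card_eq_card (hLmono 2)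
    have hL3c : #(L 3) = Fintype.card G := by rw [hL3u, card_univ]
    omega

omit [Fintype G] [DecidableEq G] in
/-- The underlying finset of a subgroup has `Nat.card K` elements. [folklore] -/
private theorem natCard_eq_card_of_coe_eq {K : AddSubgroup G} {A : Finset G}
    (hK : (K : Set G) = A) : Nat.card K = #A := by
  rw [← SetLike.coe_sort_coe, hK, Finset.coe_sort_coe, Nat.card_eq_fintype_card, Fintype.card_coe]

/-- **A `3`-fragment of size `3` for `S = {0, 2e, 3e, 4e}`:** if `o(e) ≥ 3`, `κ₃(S) = 4` and
`|G| ≥ 10` then `{0, e, 2e}` is a `3`-fragment of `S` ("But then `{0, d, 2d}` is a `3`-atom of `S`.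
This contradiction concludes the proof"). [cite: HamidouneSerraZemor2008, §6, Lemma 24 (proof,
last paragraph)] -/
theorem isFragment_three_of_eq_zero_two_three_four {S : Finset G} {e : G}
    (hS : S = {0, 2 • e, 3 • e, 4 • e}) (he : 3 ≤ addOrderOf e) (hκ : conn 3 S = 4)
    (hn : 10 ≤ Fintype.card G) : IsFragment 3 S (apFinset 0 e 3) := by
  classical
  have hX3 : #(apFinset (0 : G) e 3) = 3 := card_apFinset_of_le_addOrderOf 0 e he
  have hsub : apFinset (0 : G) e 3 + S ⊆ apFinset 0 e 7 := by
    intro u hu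
    obtain ⟨x, hx, y, hy, rfl⟩ := mem_add.1 hu
    obtain ⟨i, hi, rfl⟩ := mem_apFinset.1 hx
    rw [hS, mem_insert, mem_insert, mem_insert, mem_singleton] at hy
    rw [zero_add]
    rcases hy with rfl | rfl | rfl | rfl
    · exact mem_apFinset.2 ⟨i, by omega, by rw [zero_add, add_zero]⟩
    · exact mem_apFinset.2 ⟨i + 2, by omega, by rw [zero_add, add_nsmul]⟩
    · exact mem_apFinset.2 ⟨i + 3, by omega, by rw [zero_add, add_nsmul]⟩
    · exact mem_apFinset.2 ⟨i + 4, by omega, by rw [zero_add, add_nsmul]⟩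
  have h7 : #(apFinset (0 : G) e 3 + S) ≤ 7 := (card_le_card hsub).trans (card_apFinset_le _ _ _)
  have hadm : IsAdm 3 S (apFinset 0 e 3) := ⟨by omega, by omega⟩
  have hge := conn_le hadm
  rw [hκ] at hge
  exact ⟨hadm, by rw [hκ]; omega⟩

omit [Fintype G] in
/-- In a `3`-term progression `{a, a + d, a + 2d}` the middle term `m = a + d` reflects the set
onto itself: `2m − t` is a term for every term `t`. [folklore] -/
private theorem exists_middle_of_eq_apFinset_three {T : Finset G} {a d : G}
    (hT : T = apFinset a d 3) : ∃ m ∈ T, ∀ t ∈ T, m + m - t ∈ T := by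
  refine ⟨a + d, by rw [hT]; exact mem_apFinset.2 ⟨1, by omega, by rw [one_nsmul]⟩, ?_⟩
  intro t ht
  rw [hT] at ht ⊢
  obtain ⟨i, hi, rfl⟩ := mem_apFinset.1 ht
  refine mem_apFinset.2 ⟨2 - i, by omega, ?_⟩
  interval_cases i <;> simp <;> abel

/-- **[HamidouneSerraZemor2008, §6, Lemma 24]:** "Let `0 ∈ S` be a `3`-separable generating subset
of a finite abelian group `G` such that `κ₃(S) = |S| = 4`.  Assume `gcd(|G|, 6) = 1`.  Let `A` be
a `3`-atom of `S` such that `0 ∈ A`.  Then `|A| = 3`."  Proof as printed: if `|A| ≥ 4` then `A` is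
not a subgroup (`|A| ∣ 4`), so `|A ∩ (A + g)| ≤ 2` (Corollary 9) and `|A| ≤ 5`; `A` generates `G`
(here: `A + (S ∩ ⟨A⟩)` and `A + (S ∖ ⟨A⟩)` would both be single translates of `A`); a `2`-atom
`B ∋ 0` of `A` is a subgroup or a pair (Theorem 21) — a subgroup forces `|A| = |B| = 5 = κ₂(A)`
and `S` would be a smaller `2`-fragment, a pair forces `|A| = 4`; `|G| ≥ 13` (the dual fragment
would give a `3`-atom of size `3`); then Claim 1 (`isAP_erase_zero_of_layers`) for `S` and for
`S − a − d` gives `S = ±{0, 2d, 3d, 4d}`, and `{0, d, 2d}` is a `3`-fragment smaller than `A`.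
[cite: HamidouneSerraZemor2008, §6, Lemma 24] -/
theorem IsAtom.card_eq_three_of_conn_three_eq_four {S : Finset G} (h0 : (0 : G) ∈ S)
    (hgen : AddSubgroup.closure (S : Set G) = ⊤) (hS4 : #S = 4) (hκ : conn 3 S = 4)
    (hcop : (Fintype.card G).Coprime 6) {A : Finset G} (hA : IsAtom 3 S A) (h0A : (0 : G) ∈ A) :
    #A = 3 := by
  classical
  set n := Fintype.card G with hn
  have hord5 : ∀ g : G, g ≠ 0 → 5 ≤ addOrderOf g := fun g hg =>
    five_le_addOrderOf_of_coprime_six hcop hg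
  have h2n : ¬ 2 ∣ n := fun h => by
    have := (Nat.Coprime.coprime_dvd_left h hcop).eq_one_of_dvd (by norm_num); omega
  have h3n : ¬ 3 ∣ n := fun h => by
    have := (Nat.Coprime.coprime_dvd_left h hcop).eq_one_of_dvd (by norm_num); omega
  have htwo : ∀ u : G, u + u = 0 → u = 0 := by
    intro u hu
    by_contra hne
    have h1 := hord5 u hne
    have h2 : addOrderOf u ≤ 2 := addOrderOf_le_of_nsmul_eq_zero (by norm_num) (by rw [two_nsmul, hu])
    omega
  have hAadm := hA.1.1
  have hAfr := hA.1.2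
  rw [hκ] at hAfr
  have hAS : #(A + S) = #A + 4 := by
    have := card_le_card_add h0 A
    omega
  have hA3le : 3 ≤ #A := hAadm.1
  have hroom : #(A + S) + 3 ≤ n := hAadm.2
  by_contra hA3
  have hA4le : 4 ≤ #A := by omega
  -- (1) `A` is not a subgroup
  have hnot : ∀ K : AddSubgroup G, (K : Set G) ≠ A := by
    intro K hK
    have hKA : ∀ g, g ∈ A ↔ g ∈ K := fun g => by rw [← Finset.mem_coe, ← hK, SetLike.mem_coe]
    have hmul := card_add_eq_card_image_mul K A hKA S
    rw [add_comm, hAS] at hmul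
    have hdvd : #A ∣ #A + 4 := ⟨_, hmul.trans (mul_comm _ _)⟩
    have h4 : #A ∣ 4 := (Nat.dvd_add_right dvd_rfl).1 hdvd
    have hA4 : #A = 4 := by
      have := Nat.le_of_dvd (by norm_num) h4
      omega
    have hKn : Nat.card K ∣ n := by
      rw [hn, ← Nat.card_eq_fintype_card]; exact AddSubgroup.card_addSubgroup_dvd_card K
    rw [natCard_eq_card_of_coe_eq hK, hA4] at hKn
    exact h2n (dvd_trans (by norm_num) hKn)
  -- (2) Corollary 9
  have hC9 : ∀ g : G, g ≠ 0 → #(A ∩ (g +ᵥ A)) ≤ 2 := fun g hg =>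
    Nat.le_of_lt_succ (hA.card_inter_vadd_lt_of_forall_ne h0 h0A hnot
      (fun x hx => le_trans (by norm_num) (hord5 x hx)) hg)
  -- (3) `|A| ≤ 5`: three translates of `A` inside `A + S`
  obtain ⟨s1, hs1, s2, hs2, hs12, hs10, hs20⟩ : ∃ s1 ∈ S, ∃ s2 ∈ S, s1 ≠ s2 ∧ s1 ≠ 0 ∧ s2 ≠ 0 := by
    have h3 : #(S.erase 0) = 3 := by rw [card_erase_of_mem h0, hS4]
    obtain ⟨u, v, w, huv, -, -, he⟩ := card_eq_three.1 h3
    have hu : u ∈ S.erase 0 := by rw [he]; simp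
    have hv : v ∈ S.erase 0 := by rw [he]; simp
    rw [mem_erase] at hu hv
    exact ⟨u, hu.2, v, hv.2, huv, hu.1, hv.1⟩
  have hA5 : #A ≤ 5 := by
    have hsub : A ∪ (s1 +ᵥ A) ∪ (s2 +ᵥ A) ⊆ A + S := by
      rw [← add_triple_eq_union]
      exact add_subset_add_left (by
        intro z hz
        rw [mem_insert, mem_insert, mem_singleton] at hz
        rcases hz with rfl | rfl | rfl
        · exact h0
        · exact hs1
        · exact hs2)
    have i1 := card_union_add_card_inter A (s1 +ᵥ A)
    have i2 := card_union_add_card_inter (A ∪ (s1 +ᵥ A)) (s2 +ᵥ A)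
    have i3 : #((A ∪ (s1 +ᵥ A)) ∩ (s2 +ᵥ A)) ≤ #(A ∩ (s2 +ᵥ A)) + #((s1 +ᵥ A) ∩ (s2 +ᵥ A)) := by
      rw [union_inter_distrib_right]; exact card_union_le _ _
    have i4 : #((s1 +ᵥ A) ∩ (s2 +ᵥ A)) ≤ 2 := by
      have : (s1 +ᵥ A) ∩ (s2 +ᵥ A) = s1 +ᵥ (A ∩ ((s2 - s1) +ᵥ A)) := by
        rw [vadd_finset_inter, vadd_vadd, add_sub_cancel]
      rw [this, card_vadd_finset]
      exact hC9 _ (sub_ne_zero.2 (Ne.symm hs12))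
    have := hC9 s1 hs10
    have := hC9 s2 hs20
    have := card_le_card hsub
    rw [card_vadd_finset] at i1 i2
    omega
  -- (4) `A` generates `G`
  have hgenA : AddSubgroup.closure (A : Set G) = ⊤ := by
    by_contra hH
    set H := AddSubgroup.closure (A : Set G) with hHdef
    have hAH : ∀ a ∈ A, a ∈ H := fun a ha => AddSubgroup.subset_closure (mem_coe.2 ha)
    set SH := S.filter (fun s => s ∈ H) with hSH
    set SO := S.filter (fun s => s ∉ H) with hSO
    have hSOne : SO.Nonempty := by
      by_contra h
      rw [not_nonempty_iff_eq_empty, hSO, filter_eq_empty_iff] at h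
      apply hH
      rw [eq_top_iff, ← hgen, AddSubgroup.closure_le]
      intro g hg
      by_contra hgH
      exact h (mem_coe.1 hg) hgH
    have h0SH : (0 : G) ∈ SH := mem_filter.2 ⟨h0, H.zero_mem⟩
    have hsplit : #SH + #SO = 4 := by rw [hSH, hSO, card_filter_add_card_filter_not, hS4]
    -- the two parts of `A + S`
    have hdisj : Disjoint (A + SH) (A + SO) := by
      rw [disjoint_left]
      intro u hu1 hu2
      obtain ⟨a, ha, s, hs, rfl⟩ := mem_add.1 hu1
      obtain ⟨a', ha', s', hs', he⟩ := mem_add.1 hu2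
      apply (mem_filter.1 hs').2
      have : s' = a + s - a' := by rw [← he, add_sub_cancel_left]
      rw [this]
      exact H.sub_mem (H.add_mem (hAH a ha) (mem_filter.1 hs).2) (hAH a' ha')
    have hsub : (A + SH) ∪ (A + SO) ⊆ A + S :=
      union_subset (add_subset_add_left (filter_subset _ _)) (add_subset_add_left (filter_subset _ _))
    have hcard := card_le_card hsub
    rw [card_union_of_disjoint hdisj, hAS] at hcard
    have hge1 : #A ≤ #(A + SH) := card_le_card_add (mem_filter.2 ⟨h0, H.zero_mem⟩) A
    obtain ⟨s0, hs0⟩ := hSOne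
    have hge2 : #A ≤ #(A + SO) := by
      calc #A = #(A + {s0}) := by rw [add_singleton, card_vadd_finset]
        _ ≤ #(A + SO) := card_le_card (add_subset_add_left (singleton_subset_iff.2 hs0))
    have hA4 : #A = 4 := by omega
    -- every `s ∈ SH` is a period of `A`, hence `0`
    have hSH0 : ∀ s ∈ SH, s = 0 := by
      intro s hs
      by_contra hs0'
      have hsA : s +ᵥ A = A := by
        have h1 : s +ᵥ A ⊆ A + SH := by
          intro u hu
          obtain ⟨a, ha, rfl⟩ := mem_vadd_finset.1 hu
          exact mem_add.2 ⟨a, ha, s, hs, by rw [vadd_eq_add, add_comm]⟩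
        have h2 : A + SH = A := by
          symm
          exact eq_of_subset_of_card_le (subset_add_left _ h0SH) (by omega)
        rw [h2] at h1
        exact eq_of_subset_of_card_le h1 (by rw [card_vadd_finset])
      have := card_apFinset_zero_addOrderOf_le_card hsA ⟨0, h0A⟩
      rw [card_apFinset_of_le_addOrderOf 0 s le_rfl] at this
      have := hord5 s hs0'
      omega
    have hSH1 : #SH = 1 := by
      rw [card_eq_one]
      exact ⟨0, eq_singleton_iff_unique_mem.2 ⟨h0SH, hSH0⟩⟩
    -- every `s ∈ SO` gives the same translate of `A`
    have hSOeq : ∀ s ∈ SO, s +ᵥ A = A + SO := by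
      intro s hs
      apply eq_of_subset_of_card_le
      · intro u hu
        obtain ⟨a, ha, rfl⟩ := mem_vadd_finset.1 hu
        exact mem_add.2 ⟨a, ha, s, hs, by rw [vadd_eq_add, add_comm]⟩
      · rw [card_vadd_finset]; omega
    have hSO1 : ∀ s ∈ SO, ∀ s' ∈ SO, s = s' := by
      intro s hs s' hs'
      by_contra hne
      have hper : (s - s') +ᵥ A = A := by
        have h1 : (s - s') +ᵥ (s' +ᵥ A) = s +ᵥ A := by rw [vadd_vadd, sub_add_cancel]
        rw [hSOeq s' hs', ← hSOeq s hs, vadd_vadd] at h1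
        have h2 := congrArg (fun X : Finset G => (-s) +ᵥ X) h1
        simp only [vadd_vadd, neg_add_cancel, zero_vadd] at h2
        rwa [show -s + (s - s' + s) = s - s' from by abel] at h2
      have := card_apFinset_zero_addOrderOf_le_card hper ⟨0, h0A⟩
      rw [card_apFinset_of_le_addOrderOf 0 _ le_rfl] at this
      have := hord5 (s - s') (sub_ne_zero.2 hne)
      omega
    have hSO1' : #SO ≤ 1 := card_le_one.2 hSO1
    omega
  -- (5) the `2`-atoms of `A`
  have hSA : S + A = A + S := add_comm S A
  have hSadm2 : IsAdm 2 A S := ⟨by omega, by rw [hSA, hAS]; omega⟩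
  have hκ2 : conn 2 A ≤ #A := by
    have := conn_le hSadm2
    rw [hSA, hAS] at this
    omega
  obtain ⟨B', hB'⟩ := exists_isAtom ⟨S, hSadm2⟩
  have hB'ne : B'.Nonempty := card_pos.1 (by have := hB'.1.1.1; omega)
  obtain ⟨b0, hb0⟩ := hB'ne
  set B := (-b0) +ᵥ B' with hBdef
  have hB : IsAtom 2 A B := hB'.vadd (-b0)
  have h0B : (0 : G) ∈ B := mem_vadd_finset.2 ⟨b0, hb0, by rw [vadd_eq_add, neg_add_cancel]⟩
  clear_value B
  have hBadm := hB.1.1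
  have hBfr := hB.1.2
  have hcomm : B + A = A + B := add_comm B A
  unfold IsAdm at hBadm
  rw [hcomm] at hBadm hBfr
  have hBA : #(A + B) ≤ #B + #A := by
    have := card_le_card_add h0A B
    rw [hcomm] at this
    omega
  have hdich := IsAtom.exists_addSubgroup_or_card_eq_two_of_conn_le_add (S := A) h0A (m := 0)
    (by norm_num) (by simpa using hκ2) (by norm_num; omega) hB h0B
  have hA4 : #A = 4 := by
    rcases hdich with ⟨K, hK⟩ | hB2
    · -- (6) `B` a subgroup
      exfalso
      have hKB : ∀ g, g ∈ B ↔ g ∈ K := fun g => by rw [← Finset.mem_coe, ← hK, SetLike.mem_coe]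
      have hB2 : 2 ≤ #B := hBadm.1
      have hBn : #B ∣ n := by
        have := AddSubgroup.card_addSubgroup_dvd_card K
        rwa [natCard_eq_card_of_coe_eq hK, Nat.card_eq_fintype_card] at this
      have hB5 : 5 ≤ #B := by
        by_contra hlt
        interval_cases h : #B
        · exact h2n hBn
        · exact h3n hBn
        · exact h2n (dvd_trans (by norm_num) hBn)
      have hmul := card_add_eq_card_image_mul K B hKB A
      set m := #(A.image fun s : G => (s : G ⧸ K)) with hm
      -- `m |B| ≤ |B| + 5`
      have hm2 : m ≤ 2 := by
        by_contra hm3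
        have : 3 * #B ≤ m * #B := Nat.mul_le_mul_right _ (by omega)
        omega
      have hm1 : m ≠ 1 := by
        intro hm1
        -- `A` inside the coset of `0`, i.e. `A ⊆ K`: then `K = G`, too big
        have hAK : ∀ a ∈ A, a ∈ K := by
          intro a ha
          have h1 : (a : G ⧸ K) = ((0 : G) : G ⧸ K) := by
            have := card_le_one.1 hm1.le (a : G ⧸ K) (mem_image_of_mem _ ha) ((0 : G) : G ⧸ K)
              (mem_image_of_mem _ h0A)
            exact this
          rw [QuotientAddGroup.eq] at h1
          simpa using h1
        have hKtop : K = ⊤ := by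
          rw [eq_top_iff, ← hgenA, AddSubgroup.closure_le]
          exact fun g hg => hAK g (mem_coe.1 hg)
        have hBu : #B = n := by
          have := natCard_eq_card_of_coe_eq hK
          rw [hKtop, AddSubgroup.card_top, Nat.card_eq_fintype_card] at this
          exact this.symm
        have := hBadm.2
        have := card_le_card_add h0A B
        rw [hcomm] at this
        omega
      have hm0 : m ≠ 0 := by
        intro hm0
        rw [hm, card_eq_zero, image_eq_empty] at hm0
        rw [hm0] at h0A
        exact notMem_empty _ h0A
      have hm2' : m = 2 := by omega
      rw [hm2'] at hmul
      -- `|B| = |A| = 5 = κ₂(A)`; then `S` is a smaller `2`-fragment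
      have hB5' : #B = 5 := by omega
      have hκ5 : conn 2 A = #A := by omega
      have hSfr : IsFragment 2 A S := ⟨hSadm2, by rw [hSA, hAS, hκ5]; omega⟩
      have := hB.2 S hSfr
      omega
    · -- (7) `B = {0, b}`
      obtain ⟨b, hb0, hBeq, hcount⟩ := hB.exists_eq_pair_of_card_eq_two h0A h0B hB2
      have h1 : #((b +ᵥ A) \ A) + #((b +ᵥ A) ∩ A) = #A := by
        rw [card_sdiff_add_card_inter, card_vadd_finset]
      rw [inter_comm] at h1
      have := hC9 b hb0
      omega
  -- (8) `|G| ≥ 13`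
  have hG13 : 13 ≤ n := by
    by_contra hlt
    have hn11 : n = 11 := by omega
    obtain ⟨hdual, -⟩ := hA.1.dual h0
    have hc : #(univ \ (A + S)) = 3 := by rw [card_univ_sdiff]; omega
    obtain ⟨T, hT⟩ := exists_isAtom ⟨_, hdual.1⟩
    have hT3 : #T = 3 := le_antisymm ((hT.2 _ hdual).trans hc.le) hT.1.1.1
    have hTneg : IsAtom 3 S (-T) := by simpa using hT.neg
    have := hA.card_eq_card hTneg
    rw [card_neg] at this
    omega
  -- (9) Claim 1 for `S`
  have hL4 : ∀ s ∈ S, A + S.erase s = A + S := fun s _ =>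
    hA.add_erase_eq_of_lt_card h0 (by omega) s
  have hAS8 : #(A + S) = 8 := by omega
  obtain ⟨d, hd0, a, hSAP⟩ := isAP_erase_zero_of_layers h0 hS4 hgen h0A hA4 hL4 hC9 hAS8 hG13 hord5
  rw [card_erase_of_mem h0, hS4] at hSAP
  -- the elements of `S`
  have hmemS : ∀ z, z ∈ S ↔ z = 0 ∨ ∃ i, i < 3 ∧ a + i • d = z := by
    intro z
    constructor
    · intro hz
      by_cases hz0 : z = 0
      · exact Or.inl hz0
      · right
        have : z ∈ S.erase 0 := mem_erase.2 ⟨hz0, hz⟩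
        rw [hSAP] at this
        exact mem_apFinset.1 this
    · rintro (rfl | ⟨i, hi, rfl⟩)
      · exact h0
      · have : a + i • d ∈ S.erase 0 := by rw [hSAP]; exact mem_apFinset.2 ⟨i, hi, rfl⟩
        exact (mem_erase.1 this).2
  have hne0 : ∀ i, i < 3 → a + i • d ≠ 0 := by
    intro i hi h
    have : a + i • d ∈ S.erase 0 := by rw [hSAP]; exact mem_apFinset.2 ⟨i, hi, rfl⟩
    exact (mem_erase.1 this).1 h
  have ha0 : a ≠ 0 := by simpa using hne0 0 (by omega)
  have had0 : a + d ≠ 0 := by simpa using hne0 1 (by omega)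
  have ha2d0 : a + 2 • d ≠ 0 := hne0 2 (by omega)
  have hd5 := hord5 d hd0
  have h2d : d + d ≠ 0 := fun h => hd0 (htwo d h)
  -- (10) Claim 1 for `S − (a + d)`
  set c := a + d with hc
  set S₂ := (-c) +ᵥ S with hS₂
  have hmemS₂ : ∀ z, z ∈ S₂ ↔ z + c ∈ S := by
    intro z
    rw [hS₂, mem_vadd_finset]
    constructor
    · rintro ⟨w, hw, rfl⟩
      have : (-c +ᵥ w) + c = w := by rw [vadd_eq_add]; abel
      rw [this]; exact hw
    · intro h; exact ⟨z + c, h, by rw [vadd_eq_add]; abel⟩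
  have h0S₂ : (0 : G) ∈ S₂ := (hmemS₂ 0).2 (by rw [zero_add]; exact (hmemS c).2 (Or.inr ⟨1, by omega, by rw [one_nsmul]⟩))
  have hS₂4 : #S₂ = 4 := by rw [hS₂, card_vadd_finset, hS4]
  have hgen₂ : AddSubgroup.closure (S₂ : Set G) = ⊤ := by
    rw [eq_top_iff, ← hgen, AddSubgroup.closure_le]
    intro z hz
    have hcS₂ : -c ∈ S₂ := (hmemS₂ _).2 (by rw [neg_add_cancel]; exact h0)
    have hzc : z - c ∈ S₂ := (hmemS₂ _).2 (by rw [sub_add_cancel]; exact mem_coe.1 hz)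
    have : z = (z - c) - (-c) := by abel
    rw [this]
    exact AddSubgroup.sub_mem _ (AddSubgroup.subset_closure hzc) (AddSubgroup.subset_closure hcS₂)
  have hvaddA : ∀ Y : Finset G, A + ((-c) +ᵥ Y) = (-c) +ᵥ (A + Y) := fun Y => by
    rw [add_comm, vadd_add_assoc, add_comm]
  have hL4₂ : ∀ s ∈ S₂, A + S₂.erase s = A + S₂ := by
    intro s hs
    have hsc : s + c ∈ S := (hmemS₂ s).1 hs
    have h1 : S₂.erase s = (-c) +ᵥ S.erase (s + c) := by
      ext z
      rw [mem_erase, hmemS₂, mem_vadd_finset]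
      constructor
      · rintro ⟨hzs, hz⟩
        refine ⟨z + c, mem_erase.2 ⟨fun h => hzs ?_, hz⟩, by rw [vadd_eq_add]; abel⟩
        calc z = (z + c) - c := by abel
          _ = s := by rw [h]; abel
      · rintro ⟨w, hw, rfl⟩
        rw [mem_erase] at hw
        refine ⟨fun h => hw.1 ?_, by rw [show (-c +ᵥ w) + c = w from by rw [vadd_eq_add]; abel]; exact hw.2⟩
        rw [← h, vadd_eq_add]; abel
    rw [h1, hvaddA, hL4 _ hsc, hS₂, hvaddA]
  have hAS₂ : #(A + S₂) = 8 := by rw [hS₂, hvaddA, card_vadd_finset, hAS8]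
  obtain ⟨d', hd'0, a', hSAP'⟩ :=
    isAP_erase_zero_of_layers h0S₂ hS₂4 hgen₂ h0A hA4 hL4₂ hC9 hAS₂ hG13 hord5
  rw [card_erase_of_mem h0S₂, hS₂4] at hSAP'
  -- `S₂ ∖ {0} = {−(a + d), −d, d}`
  have hTmem : ∀ z, z ∈ S₂.erase 0 ↔ z = -(a + d) ∨ z = -d ∨ z = d := by
    intro z
    rw [mem_erase, hmemS₂, hmemS]
    constructor
    · rintro ⟨hz0, h | ⟨i, hi, he⟩⟩
      · left
        rw [hc] at h
        exact eq_neg_of_add_eq_zero_left h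
      · rw [hc] at he
        interval_cases i
        · right; left
          calc z = (z + (a + d)) - (a + d) := by abel
            _ = -d := by rw [← he, zero_nsmul]; abel
        · exfalso
          apply hz0
          calc z = (z + (a + d)) - (a + d) := by abel
            _ = 0 := by rw [← he, one_nsmul]; abel
        · right; right
          calc z = (z + (a + d)) - (a + d) := by abel
            _ = d := by rw [← he]; abel
    · rintro (rfl | rfl | rfl)
      · exact ⟨by rw [← hc]; exact neg_ne_zero.2 had0, Or.inl (by rw [hc, neg_add_cancel])⟩
      · exact ⟨neg_ne_zero.2 hd0, Or.inr ⟨0, by omega, by rw [zero_nsmul, hc]; abel⟩⟩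
      · exact ⟨hd0, Or.inr ⟨2, by omega, by rw [hc]; abel⟩⟩
  obtain ⟨m, hm, hmid⟩ := exists_middle_of_eq_apFinset_three hSAP'
  have H : ∀ t, (t = -(a + d) ∨ t = -d ∨ t = d) →
      (m + m - t = -(a + d) ∨ m + m - t = -d ∨ m + m - t = d) :=
    fun t ht => (hTmem _).1 (hmid t ((hTmem t).2 ht))
  rw [hTmem] at hm
  -- `a = 2d` or `a = −4d`
  have key : a = d + d ∨ a = -(d + d + d + d) := by
    rcases hm with hm | hm | hm <;> rw [hm] at H
    · rcases H d (Or.inr (Or.inr rfl)) with h | h | h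
      · exfalso; apply ha2d0
        calc a + 2 • d = -((-(a + d) + -(a + d) - d) - -(a + d)) := by abel
          _ = 0 := by rw [sub_eq_zero.2 h, neg_zero]
      · exfalso; apply had0; rw [hc]; apply htwo
        calc a + d + (a + d) = -((-(a + d) + -(a + d) - d) - -d) := by abel
          _ = 0 := by rw [sub_eq_zero.2 h, neg_zero]
      · exfalso; apply ha2d0; apply htwo
        calc a + 2 • d + (a + 2 • d) = -((-(a + d) + -(a + d) - d) - d) := by abel
          _ = 0 := by rw [sub_eq_zero.2 h, neg_zero]
    · rcases H d (Or.inr (Or.inr rfl)) with h | h | h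
      · left
        calc a = ((-d + -d - d) - -(a + d)) + (d + d) := by abel
          _ = d + d := by rw [sub_eq_zero.2 h, zero_add]
      · exfalso; apply h2d
        calc d + d = -((-d + -d - d) - -d) := by abel
          _ = 0 := by rw [sub_eq_zero.2 h, neg_zero]
      · exfalso; apply h2d; apply htwo
        calc d + d + (d + d) = -((-d + -d - d) - d) := by abel
          _ = 0 := by rw [sub_eq_zero.2 h, neg_zero]
    · rcases H (-d) (Or.inr (Or.inl rfl)) with h | h | h
      · right
        calc a = -(d + d + d + d) + ((d + d - -d) - -(a + d)) := by abel
          _ = -(d + d + d + d) := by rw [sub_eq_zero.2 h, add_zero]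
      · exfalso; apply h2d; apply htwo
        calc d + d + (d + d) = (d + d - -d) - -d := by abel
          _ = 0 := sub_eq_zero.2 h
      · exfalso; apply h2d
        calc d + d = (d + d - -d) - d := by abel
          _ = 0 := sub_eq_zero.2 h
  -- either way `S = {0, 2e, 3e, 4e}` and `{0, e, 2e}` is a smaller `3`-fragment
  have hshape : ∃ e : G, 5 ≤ addOrderOf e ∧ S = {0, 2 • e, 3 • e, 4 • e} := by
    rcases key with hkey | hkey
    · refine ⟨d, hd5, ?_⟩
      ext z
      rw [hmemS, mem_insert, mem_insert, mem_insert, mem_singleton, hkey]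
      constructor
      · rintro (rfl | ⟨i, hi, rfl⟩)
        · exact Or.inl rfl
        · interval_cases i
          · exact Or.inr (Or.inl (by abel))
          · exact Or.inr (Or.inr (Or.inl (by abel)))
          · exact Or.inr (Or.inr (Or.inr (by abel)))
      · rintro (rfl | rfl | rfl | rfl)
        · exact Or.inl rfl
        · exact Or.inr ⟨0, by omega, by abel⟩
        · exact Or.inr ⟨1, by omega, by abel⟩
        · exact Or.inr ⟨2, by omega, by abel⟩
    · refine ⟨-d, by rw [addOrderOf_neg]; exact hd5, ?_⟩
      ext z
      rw [hmemS, mem_insert, mem_insert, mem_insert, mem_singleton, hkey]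
      constructor
      · rintro (rfl | ⟨i, hi, rfl⟩)
        · exact Or.inl rfl
        · interval_cases i
          · exact Or.inr (Or.inr (Or.inr (by abel)))
          · exact Or.inr (Or.inr (Or.inl (by abel)))
          · exact Or.inr (Or.inl (by abel))
      · rintro (rfl | rfl | rfl | rfl)
        · exact Or.inl rfl
        · exact Or.inr ⟨2, by omega, by abel⟩
        · exact Or.inr ⟨1, by omega, by abel⟩
        · exact Or.inr ⟨0, by omega, by abel⟩
  obtain ⟨e, he5, hSeq⟩ := hshape
  have hfr := isFragment_three_of_eq_zero_two_three_four hSeq (by omega) hκ (by omega)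
  have := hA.2 _ hfr
  rw [card_apFinset_of_le_addOrderOf 0 e (by omega)] at this
  omega

/-! ### §8, Theorem 28 (the Hamidoune–Rødseth theorem for abelian groups): the case of a
generating `3`-atom with at most four elements -/

/-- **"Theorem 14 implies that `A` is a progression"** (the recurring step of the proof of
[HamidouneSerraZemor2008, Theorem 28]): if `A ∋ 0` generates `G`, `2 ≤ |A| ≤ 5`, `A` is
`k`-separable (`k ≥ 2`) with `κ_k(A) < |A|`, and every non-zero element has order `≥ 5`, then `A`
is an arithmetic progression whose difference generates `G` (a `k`-fragment is `2`-admissible, so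
`κ₂(A) ≤ κ_k(A) ≤ |A| − 1`; Theorem 14 applies, and `A ∖ {0}` cannot be periodic, being smaller
than any non-zero cyclic subgroup). [cite: HamidouneSerraZemor2008, §8 (proof of Theorem 28,
Cases 1 and 2: "Theorem 14 implies that `A` is a progression")] -/
theorem exists_isAP_of_conn_lt_card {A : Finset G} {k : ℕ} (h0A : (0 : G) ∈ A)
    (hgenA : AddSubgroup.closure (A : Set G) = ⊤) (hk2 : 2 ≤ k) (hsep : IsSeparable k A)
    (hlt : conn k A + 1 ≤ #A) (hA2 : 2 ≤ #A) (hA5 : #A ≤ 5)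
    (hord5 : ∀ g : G, g ≠ 0 → 5 ≤ addOrderOf g) :
    ∃ d : G, d ≠ 0 ∧ AddSubgroup.zmultiples d = ⊤ ∧ IsAP A d := by
  classical
  obtain ⟨X, hX⟩ := exists_isFragment hsep
  have hXadm2 : IsAdm 2 A X := ⟨le_trans hk2 hX.1.1, by have := hX.1.2; omega⟩
  have hκ2 : conn 2 A + 1 ≤ #A := by
    have h1 := conn_le hXadm2
    have h2 := hX.2
    omega
  rcases isAP_or_vadd_erase_eq_of_forall_card_le_addOrderOf h0A hgenA ⟨X, hXadm2⟩ hκ2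
    (fun a _ ha0 => le_trans hA5 (hord5 a ha0)) with ⟨d, hd0, hAP⟩ | ⟨d, hd0, hper⟩
  · obtain ⟨a, hAeq⟩ := hAP
    exact ⟨d, hd0, zmultiples_eq_top_of_zero_mem_subset_apFinset h0A hgenA hAeq.subset, a, hAeq⟩
  · exfalso
    have hne : (A.erase 0).Nonempty := card_pos.1 (by rw [card_erase_of_mem h0A]; omega)
    have h1 := card_apFinset_zero_addOrderOf_le_card hper hne
    rw [card_apFinset_of_le_addOrderOf 0 d le_rfl, card_erase_of_mem h0A] at h1
    have := hord5 d hd0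
    omega

/-- **[HamidouneSerraZemor2008, §8, Theorem 28], the case of a small generating `3`-atom (Cases 1
and 2 of the printed proof).**  Let `G` be a finite abelian group with `gcd(|G|, 6) = 1`,
`0 ∈ S ⊆ G` with `4 ≤ |S| ≤ |G| − 7` and `κ₃(S) = |S|`, and let `A ∋ 0` be a `3`-atom of `S`
which generates `G` and has `|A| ≤ 4`.  Then `S` is a progression or a quasi-progression:
`S ⊆ {a, a + r, …, a + |S| r}` for a generator `r` of `G`.  Proof as printed — `|A| = 3`:
`κ₄(A) ≤ 3`; `κ₄(A) < 3` makes `A` a progression (Theorem 14, `exists_isAP_of_conn_lt_card`) and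
`S` follows (`subset_apFinset_of_isAP_of_card_add_le_of_zmultiples`); `κ₄(A) = 3` makes `A` a
quasi-progression (Lemma 27) and `S` follows (Lemma 25).  `|A| = 4`: `κ₃(A) ≤ 4`; `κ₃(A) < 4` as
before; `κ₃(A) = 4`: a `3`-atom `B ∋ 0` of `A` has `|B| = 3` (Lemma 24), generates `G`, and
Theorem 14 / Lemma 27 followed by Lemma 25 twice transfer the structure from `B` to `A` to `S`
(the room `|S| + |A| ≤ |G| − 4` for the last transfer comes from the dual fragment).
[cite: HamidouneSerraZemor2008, §8, Theorem 28 (Cases 1 and 2)] -/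
theorem exists_subset_apFinset_of_isAtom_three_of_card_le_four {S A : Finset G}
    (h0 : (0 : G) ∈ S) (hcop : (Fintype.card G).Coprime 6) (hS4 : 4 ≤ #S)
    (hSn : #S + 7 ≤ Fintype.card G) (hκ : conn 3 S = #S) (hA : IsAtom 3 S A) (h0A : (0 : G) ∈ A)
    (hgenA : AddSubgroup.closure (A : Set G) = ⊤) (hAle : #A ≤ 4) :
    ∃ r a : G, AddSubgroup.zmultiples r = ⊤ ∧ S ⊆ apFinset a r (#S + 1) := by
  classical
  set n := Fintype.card G with hn
  have hord5 : ∀ g : G, g ≠ 0 → 5 ≤ addOrderOf g := fun g hg =>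
    five_le_addOrderOf_of_coprime_six hcop hg
  have h2n : ¬ 2 ∣ n := fun h => by
    have := (Nat.Coprime.coprime_dvd_left h hcop).eq_one_of_dvd (by norm_num); omega
  have hn12 : n ≠ 12 := by omega
  have hAadm := hA.1.1
  have hAfr := hA.1.2
  rw [hκ] at hAfr
  have hAS : #(A + S) = #A + #S := by
    have := card_le_card_add h0 A
    omega
  have hSA : S + A = A + S := add_comm _ _
  have hSne : S.Nonempty := card_pos.1 (by omega)
  have hA3le : 3 ≤ #A := hAadm.1
  have hroomA : #(A + S) + 3 ≤ n := hAadm.2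
  have hTS : #(S + A) ≤ #S + #A := by rw [hSA, hAS, Nat.add_comm]
  have hTSn : #(S + A) < Fintype.card G := by rw [hSA]; omega
  -- room: `|S| + |A| + 4 ≤ |G|` (for `|A| = 4` the dual fragment would otherwise be a `3`-set)
  have hroomS : #S + #A + 4 ≤ Fintype.card G := by
    by_contra hlt
    have hc : #(univ \ (A + S)) = 3 := by rw [card_univ_sdiff]; omega
    obtain ⟨hdual, -⟩ := hA.1.dual h0
    obtain ⟨T, hT⟩ := exists_isAtom ⟨_, hdual.1⟩
    have hT3 : #T = 3 := le_antisymm ((hT.2 _ hdual).trans hc.le) hT.1.1.1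
    have hTneg : IsAtom 3 S (-T) := by simpa using hT.neg
    have := hA.card_eq_card hTneg
    rw [card_neg] at this
    omega
  -- Small tool: knots of size ≤ 3 add at least `2` against a `3`-set
  have hgrow : ∀ (W B : Finset G), W.Nonempty → #W ≤ 3 → #B = 3 → #W + 2 ≤ #(W + B) := by
    intro W B hW hW3 hB3
    by_cases h5 : #(W + B) < 5
    · have := card_add_card_le_card_add_succ_of_card_add_lt hord5 hW (card_pos.1 (by omega)) h5
      omega
    · omega
  rcases (show #A = 3 ∨ #A = 4 by omega) with hA3 | hA4
  · -- Case 1: `|A| = 3`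
    have hSadm4 : IsAdm 4 A S := ⟨hS4, by rw [hSA, hAS]; omega⟩
    have hsep4 : IsSeparable 4 A := ⟨S, hSadm4⟩
    have hκ4 : conn 4 A ≤ 3 := by
      have := conn_le hSadm4
      rw [hSA, hAS] at this
      omega
    rcases Nat.lt_or_ge (conn 4 A) 3 with hlt | hge
    · obtain ⟨d, -, hr, hAP⟩ := exists_isAP_of_conn_lt_card h0A hgenA (by norm_num) hsep4
        (by omega) (by omega) (by omega) hord5
      obtain ⟨b, hb⟩ := subset_apFinset_of_isAP_of_card_add_le_of_zmultiples hr hAP (by omega) hSne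
        hTS hTSn
      exact ⟨d, b, hr, hb⟩
    · have hκ4eq : conn 4 A = 3 := le_antisymm hκ4 hge
      obtain ⟨r, a', hr, hAsub⟩ :=
        exists_subset_apFinset_of_conn_four_eq_three h0A hgenA hA3 hκ4eq hsep4 hcop
      have hAsub' : A ⊆ apFinset a' r (#A + 1) := by rw [hA3]; exact hAsub
      obtain ⟨b, hb⟩ := subset_apFinset_of_card_add_le_of_subset_apFinset hr hn12 hA3le hAsub'
        (by omega) hTS hroomS
      exact ⟨r, b, hr, hb⟩
  · -- Case 2: `|A| = 4`
    have hSadm3 : IsAdm 3 A S := ⟨by omega, by rw [hSA, hAS]; omega⟩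
    have hsep3 : IsSeparable 3 A := ⟨S, hSadm3⟩
    have hκ3 : conn 3 A ≤ 4 := by
      have := conn_le hSadm3
      rw [hSA, hAS] at this
      omega
    rcases Nat.lt_or_ge (conn 3 A) 4 with hlt | hge
    · obtain ⟨d, -, hr, hAP⟩ := exists_isAP_of_conn_lt_card h0A hgenA (by norm_num) hsep3
        (by omega) (by omega) (by omega) hord5
      obtain ⟨b, hb⟩ := subset_apFinset_of_isAP_of_card_add_le_of_zmultiples hr hAP (by omega) hSne
        hTS hTSn
      exact ⟨d, b, hr, hb⟩
    · have hκ3eq : conn 3 A = 4 := le_antisymm hκ3 hge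
      -- a `3`-atom `B ∋ 0` of `A`
      obtain ⟨B', hB'⟩ := exists_isAtom hsep3
      have hB'ne : B'.Nonempty := card_pos.1 (by have := hB'.1.1.1; omega)
      obtain ⟨b0, hb0⟩ := hB'ne
      set B := (-b0) +ᵥ B' with hBdef
      have hB : IsAtom 3 A B := hB'.vadd (-b0)
      have h0B : (0 : G) ∈ B := mem_vadd_finset.2 ⟨b0, hb0, by rw [vadd_eq_add, neg_add_cancel]⟩
      clear_value B
      have hB3 : #B = 3 := IsAtom.card_eq_three_of_conn_three_eq_four h0A hgenA hA4 hκ3eq hcop hB h0B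
      have hBA : B + A = A + B := add_comm _ _
      have hAB : #(A + B) = 7 := by
        have h1 := hB.1.2
        have h2 := card_le_card_add h0A B
        rw [hκ3eq, hBA] at h1
        rw [hBA] at h2
        omega
      -- `B` generates `G`
      have hgenB : AddSubgroup.closure (B : Set G) = ⊤ := by
        by_contra hH
        set H := AddSubgroup.closure (B : Set G) with hHdef
        have hBH : ∀ b ∈ B, b ∈ H := fun b hb => AddSubgroup.subset_closure (mem_coe.2 hb)
        set AH := A.filter (fun a => a ∈ H) with hAH
        set AO := A.filter (fun a => a ∉ H) with hAO
        have hAOne : AO.Nonempty := by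
          by_contra h
          rw [not_nonempty_iff_eq_empty, hAO, filter_eq_empty_iff] at h
          apply hH
          rw [eq_top_iff, ← hgenA, AddSubgroup.closure_le]
          intro g hg
          by_contra hgH
          exact h (mem_coe.1 hg) hgH
        have h0AH : (0 : G) ∈ AH := mem_filter.2 ⟨h0A, H.zero_mem⟩
        have hsplit : #AH + #AO = 4 := by rw [hAH, hAO, card_filter_add_card_filter_not, hA4]
        have hdisj : Disjoint (AH + B) (AO + B) := by
          rw [disjoint_left]
          intro u hu1 hu2
          obtain ⟨a, ha, b, hb, rfl⟩ := mem_add.1 hu1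
          obtain ⟨a', ha', b', hb', he⟩ := mem_add.1 hu2
          apply (mem_filter.1 ha').2
          have : a' = a + b - b' := by rw [← he, add_sub_cancel_right]
          rw [this]
          exact H.sub_mem (H.add_mem (mem_filter.1 ha).2 (hBH b hb)) (hBH b' hb')
        have hsub : (AH + B) ∪ (AO + B) ⊆ A + B :=
          union_subset (add_subset_add_right (filter_subset _ _))
            (add_subset_add_right (filter_subset _ _))
        have hcard := card_le_card hsub
        rw [card_union_of_disjoint hdisj, hAB] at hcard
        have h1 := hgrow AH B ⟨0, h0AH⟩ (by have := hAOne.card_pos; omega) hB3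
        have h2 := hgrow AO B hAOne (by have : 1 ≤ #AH := card_pos.2 ⟨0, h0AH⟩; omega) hB3
        omega
      -- `A` is `4`-admissible for `B`
      have hAadm4 : IsAdm 4 B A := ⟨by omega, by omega⟩
      have hsep4 : IsSeparable 4 B := ⟨A, hAadm4⟩
      have hκ4 : conn 4 B ≤ 3 := by
        have := conn_le hAadm4
        omega
      -- in both sub-cases `A` is an almost-progression of a generator
      have hAap : ∃ r a' : G, AddSubgroup.zmultiples r = ⊤ ∧ A ⊆ apFinset a' r (#A + 1) := by
        rcases Nat.lt_or_ge (conn 4 B) 3 with hlt | hge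
        · obtain ⟨d, -, hr, hBP⟩ := exists_isAP_of_conn_lt_card h0B hgenB (by norm_num) hsep4
            (by omega) (by omega) (by omega) hord5
          obtain ⟨a', ha'⟩ := subset_apFinset_of_isAP_of_card_add_le_of_zmultiples hr hBP
            (by omega) ⟨0, h0A⟩ (by rw [hAB]; omega) (by omega)
          exact ⟨d, a', hr, ha'⟩
        · have hκ4eq : conn 4 B = 3 := le_antisymm hκ4 hge
          obtain ⟨r, b', hr, hBsub⟩ :=
            exists_subset_apFinset_of_conn_four_eq_three h0B hgenB hB3 hκ4eq hsep4 hcop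
          obtain ⟨a', ha'⟩ := subset_apFinset_of_card_add_le_of_subset_apFinset hr hn12 (S := B)
            (T := A) (by omega) (by rw [hB3]; exact hBsub) (by omega) (by rw [hAB]; omega)
            (by omega)
          exact ⟨r, a', hr, ha'⟩
      obtain ⟨r, a', hr, hAsub⟩ := hAap
      obtain ⟨b, hb⟩ := subset_apFinset_of_card_add_le_of_subset_apFinset hr hn12 hA3le hAsub
        (by omega) hTS hroomS
      exact ⟨r, b, hr, hb⟩

/-! ### §8, Theorem 28, Claim 2: a non-generating `3`-atom makes `S ∖ {0}` quasi-periodic -/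

omit [Fintype G] in
/-- `X + T` is invariant under every `q` with `q + T ⊆ T`. [folklore] -/
private theorem vadd_add_eq_of_forall_add_mem {X T : Finset G} {q : G}
    (hT : ∀ t ∈ T, q + t ∈ T) : q +ᵥ (X + T) = X + T := by
  refine eq_of_subset_of_card_le (fun u hu => ?_) (by rw [card_vadd_finset])
  obtain ⟨v, hv, rfl⟩ := mem_vadd_finset.1 hu
  obtain ⟨x, hx, t, ht, rfl⟩ := mem_add.1 hv
  rw [vadd_eq_add, add_left_comm]
  exact add_mem_add hx (hT t ht)

/-- **[HamidouneSerraZemor2008, §8, Theorem 28, Claim 2]** ("The result holds if `A` generates a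
proper subgroup `K` of `G`"): let `0 ∈ S` generate the finite abelian group `G`, every non-zero
element of `G` have order `≥ 3`, `κ₃(S) = |S|`, every element of `S ∖ {0}` have order
`≥ |S| + 1`, and let `A ∋ 0` be a `3`-atom of `S` with `⟨A⟩ ≠ G`.  Then `S* = S ∖ {0}` is
quasi-periodic: `S* ⊆ P` for a periodic set `P` (`q + P = P`, `q ≠ 0`) with `|P| = |S*| + 1`.
Proof as printed: if `A = K` is a subgroup then `|A|` divides `|S + A| = |S| + |A|`, so
`|S| ≥ |A|`, `S ∩ A = {0}` by the order condition, `S + A = A ⊔ (S* + A)` and `P = S* + A`;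
otherwise Corollary 9 makes `A` weakly Sidon, `S = S_1 ∪ ⋯ ∪ S_j` (`j ≥ 2`) modulo `K` with
`|S_i + A| ≥ min(|K|, |S_i| + |A| − 1)` (Lemma 10 in `K`), so at most one piece has
`|S_i + A| < |K|`; hence `|S| ≥ |K|`, `S ∩ K = {0}`, the deficient piece is `S_1 = {0}`, the other
pieces satisfy `|S_i + A| = |K|`, `|S*| = (j − 1)|K| − … = |S| − 1` and `P = S* + K`.
[cite: HamidouneSerraZemor2008, §8, Theorem 28 (proof, Claim 2)] -/
theorem exists_periodic_superset_erase_zero_of_closure_ne_top {S A : Finset G}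
    (h0 : (0 : G) ∈ S) (hgen : AddSubgroup.closure (S : Set G) = ⊤)
    (hord3 : ∀ g : G, g ≠ 0 → 3 ≤ addOrderOf g) (hκ : conn 3 S = #S)
    (hord : ∀ s ∈ S, s ≠ 0 → #S + 1 ≤ addOrderOf s) (hA : IsAtom 3 S A) (h0A : (0 : G) ∈ A)
    (hAG : AddSubgroup.closure (A : Set G) ≠ ⊤) :
    ∃ P : Finset G, S.erase 0 ⊆ P ∧ #P = #S ∧ ∃ q : G, q ≠ 0 ∧ q +ᵥ P = P := by
  classical
  have hAadm := hA.1.1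
  have hA3 : 3 ≤ #A := hAadm.1
  have hAS : #(A + S) = #A + #S := by
    have h1 := hA.1.2
    have h2 := card_le_card_add h0 A
    rw [hκ] at h1
    omega
  have hSA : #(S + A) = #S + #A := by rw [add_comm, hAS, Nat.add_comm]
  by_cases hsub : ∃ K : AddSubgroup G, (K : Set G) = A
  · -- `A = K` is a subgroup
    obtain ⟨K, hK⟩ := hsub
    have hAf : ∀ g, g ∈ A ↔ g ∈ K := fun g => by rw [← Finset.mem_coe, ← hK, SetLike.mem_coe]
    have hKcard : Nat.card K = #A := natCard_eq_card_of_coe_eq hK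
    -- `|A|` divides `|S + A|`, so `|A| ≤ |S|`
    have hdvd : #A ∣ #S := by
      have h1 : #A ∣ #(S + A) := by
        rw [card_add_eq_card_image_mul K A hAf S]; exact Dvd.intro_left _ rfl
      rw [hSA] at h1
      exact (Nat.dvd_add_left (dvd_refl _)).1 h1
    have hAleS : #A ≤ #S := Nat.le_of_dvd (card_pos.2 ⟨0, h0⟩) hdvd
    -- `S ∩ A = {0}`
    have hSK : ∀ s ∈ S, s ∈ A → s = 0 := by
      intro s hs hsA
      by_contra hs0
      have h1 := hord s hs hs0
      have h2 := Nat.le_of_dvd Nat.card_pos (AddSubgroup.addOrderOf_dvd_natCard K ((hAf s).1 hsA))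
      omega
    -- `S + A = A ⊔ (S* + A)`
    have hdisj : Disjoint A (S.erase 0 + A) := by
      rw [disjoint_right]
      intro u hu huA
      obtain ⟨s, hs, a, ha, rfl⟩ := mem_add.1 hu
      rw [mem_erase] at hs
      apply hs.1 (hSK s hs.2 ((hAf s).2 _))
      have := K.sub_mem ((hAf _).1 huA) ((hAf a).1 ha)
      rwa [add_sub_cancel_right] at this
    have hunion : S + A = A ∪ (S.erase 0 + A) := by
      conv_lhs => rw [← insert_erase h0, insert_eq, union_add, singleton_add, zero_vadd]
    refine ⟨S.erase 0 + A, subset_add_left _ h0A, ?_, ?_⟩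
    · have := card_union_of_disjoint hdisj
      rw [← hunion, hSA] at this
      omega
    · obtain ⟨q, hq⟩ : (A.erase 0).Nonempty := card_pos.1 (by rw [card_erase_of_mem h0A]; omega)
      rw [mem_erase] at hq
      exact ⟨q, hq.1, vadd_add_eq_of_forall_add_mem fun t ht =>
        (hAf _).2 (K.add_mem ((hAf q).1 hq.2) ((hAf t).1 ht))⟩
  · -- `A ≠ K`: decomposition modulo `K = ⟨A⟩`
    push Not at hsub
    set K := AddSubgroup.closure (A : Set G) with hKdef
    have hAK : ∀ a ∈ A, a ∈ K := fun a ha => AddSubgroup.subset_closure (mem_coe.2 ha)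
    have hAKs : (A : Set G) ⊆ K := fun a ha => hAK a ha
    haveI : Fintype ↥K := Fintype.ofFinite _
    set Kf : Finset G := (univ : Finset ↥K).image (fun x : ↥K => (x : G)) with hKfdef
    have hKf : ∀ g, g ∈ Kf ↔ g ∈ K := fun g => by
      rw [hKfdef, mem_image]
      constructor
      · rintro ⟨x, -, rfl⟩; exact x.2
      · intro hg; exact ⟨⟨g, hg⟩, mem_univ _, rfl⟩
    have hKfcard : #Kf = Nat.card ↥K := by
      rw [hKfdef, card_image_of_injective _ Subtype.val_injective, card_univ,
        Nat.card_eq_fintype_card]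
    have h0Kf : (0 : G) ∈ Kf := (hKf 0).2 K.zero_mem
    have hAKf : A ⊆ Kf := fun a ha => (hKf a).2 (hAK a ha)
    have hAlt : #A < #Kf := by
      refine card_lt_card ⟨hAKf, fun h => hsub K ?_⟩
      ext g
      rw [SetLike.mem_coe, mem_coe, ← hKf]
      exact ⟨fun hg => h hg, fun hg => hAKf hg⟩
    -- Corollary 9: `A` is weakly Sidon
    have hsid2 : ∀ g : G, g ≠ 0 → #(A ∩ (g +ᵥ A)) ≤ 2 := fun g hg =>
      Nat.lt_succ_iff.1 (hA.card_inter_vadd_lt_of_forall_ne h0 h0A hsub hord3 hg)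
    -- the pieces of `S` modulo `K`
    set I : Finset (G ⧸ K) := S.image (fun s : G => (s : G ⧸ K)) with hI
    set pc : G ⧸ K → Finset G := fun c => S.filter (fun s : G => (s : G ⧸ K) = c) with hpc
    have hpc_ne : ∀ c ∈ I, ∃ s₀ ∈ S, (s₀ : G ⧸ K) = c ∧ s₀ ∈ pc c := by
      intro c hc
      obtain ⟨s₀, hs₀, rfl⟩ := mem_image.1 hc
      exact ⟨s₀, hs₀, rfl, mem_filter.2 ⟨hs₀, rfl⟩⟩
    have hsumA : #(S + A) = ∑ c ∈ I, #(pc c + A) := card_add_eq_sum_card_filter_add K S A hAKs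
    have hsumS : #S = ∑ c ∈ I, #(pc c) :=
      card_eq_sum_card_fiberwise fun s hs => mem_image_of_mem _ hs
    have hpc_le : ∀ c, #(pc c) ≤ #(pc c + A) := fun c => card_le_card_add h0A _
    have hle_q : ∀ c ∈ I, #(pc c + A) ≤ #Kf := by
      intro c hc
      obtain ⟨s₀, -, hs₀, -⟩ := hpc_ne c hc
      have := card_le_card (filter_add_subset_vadd K Kf hKf S A hAKs hs₀)
      rwa [card_vadd_finset] at this
    -- Lemma 10 in `K` for a deficient piece
    have hV : ∀ c ∈ I, #(pc c + A) + 1 ≤ #Kf → #(pc c) + #A ≤ #(pc c + A) + 1 := by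
      intro c hc hδ
      obtain ⟨s₀, hs₀S, hs₀, hs₀pc⟩ := hpc_ne c hc
      have hva : (-s₀ +ᵥ pc c) + A = -s₀ +ᵥ (pc c + A) := by
        rw [← singleton_add, ← singleton_add, add_assoc]
      have hPK : ∀ g ∈ -s₀ +ᵥ pc c, g ∈ AddSubgroup.closure (A : Set G) := by
        intro g hg
        obtain ⟨s, hs, rfl⟩ := mem_vadd_finset.1 hg
        rw [hpc, mem_filter] at hs
        exact QuotientAddGroup.eq.1 (hs₀.trans hs.2.symm)
      have := card_add_card_le_succ_of_subset_closure h0A hA3 hsid2 hPK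
        ⟨-s₀ +ᵥ s₀, mem_vadd_finset.2 ⟨s₀, hs₀pc, rfl⟩⟩
        (by rw [hva, card_vadd_finset, ← hKfcard]; exact hδ)
      rwa [hva, card_vadd_finset, card_vadd_finset] at this
    -- the excesses sum to `|A|`; at most one deficient piece
    have hsum_f : ∑ c ∈ I, (#(pc c + A) - #(pc c)) = #A := by
      have e : ∑ c ∈ I, #(pc c + A) = ∑ c ∈ I, #(pc c) + ∑ c ∈ I, (#(pc c + A) - #(pc c)) := by
        rw [← sum_add_distrib]
        exact sum_congr rfl fun c _ => by have := hpc_le c; omega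
      omega
    have huniq : ∀ c₁ ∈ I, ∀ c₂ ∈ I, c₁ ≠ c₂ → #(pc c₁ + A) < #Kf → #(pc c₂ + A) < #Kf →
        False := by
      intro c₁ hc₁ c₂ hc₂ hne h₁ h₂
      have hsub2 : ({c₁, c₂} : Finset (G ⧸ K)) ⊆ I := by
        rw [insert_subset_iff, singleton_subset_iff]; exact ⟨hc₁, hc₂⟩
      have h := sum_le_sum_of_subset (f := fun c => #(pc c + A) - #(pc c)) hsub2
      rw [sum_pair hne, hsum_f] at h
      have e₁ := hV c₁ hc₁ h₁
      have e₂ := hV c₂ hc₂ h₂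
      have := hpc_le c₁
      have := hpc_le c₂
      omega
    -- two distinct cosets: `0` and that of an element of `S` outside `K`
    have h00 : ((0 : G) : G ⧸ K) = 0 := (QuotientAddGroup.eq_zero_iff _).2 K.zero_mem
    have h0I : (0 : G ⧸ K) ∈ I := mem_image.2 ⟨0, h0, h00⟩
    obtain ⟨s₁, hs₁S, hs₁K⟩ : ∃ s ∈ S, s ∉ K := by
      by_contra h
      push Not at h
      apply hAG
      rw [eq_top_iff, ← hgen, AddSubgroup.closure_le]
      exact fun s hs => h s hs
    have hc₁0 : (s₁ : G ⧸ K) ≠ 0 := fun h => hs₁K ((QuotientAddGroup.eq_zero_iff _).1 h)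
    have hc₁I : (s₁ : G ⧸ K) ∈ I := mem_image_of_mem _ hs₁S
    have h2I : 2 ≤ #I := one_lt_card.2 ⟨_, hc₁I, 0, h0I, hc₁0⟩
    have h0pc : (0 : G) ∈ pc 0 := mem_filter.2 ⟨h0, h00⟩
    -- `|S| ≥ |K|`
    have hSge : #Kf ≤ #S := by
      have hsub2 : ({0, (s₁ : G ⧸ K)} : Finset (G ⧸ K)) ⊆ I := by
        rw [insert_subset_iff, singleton_subset_iff]; exact ⟨h0I, hc₁I⟩
      have h := sum_le_sum_of_subset (f := fun c => #(pc c + A)) hsub2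
      rw [sum_pair hc₁0.symm, ← hsumA, hSA] at h
      have hA0 : #A ≤ #(pc 0 + A) := by
        have := card_le_card (add_subset_add_right (t := A)
          (singleton_subset_iff.2 h0pc))
        rwa [singleton_add, zero_vadd] at this
      rcases Nat.lt_or_ge (#(pc (s₁ : G ⧸ K) + A)) #Kf with hlt | hge
      · -- the piece of `s₁` is deficient, so the piece of `0` is full
        have hfull0 : #(pc 0 + A) = #Kf := by
          by_contra hne
          exact huniq _ h0I _ hc₁I hc₁0.symm (lt_of_le_of_ne (hle_q _ h0I) hne) hlt
        have e₁ := hV _ hc₁I hlt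
        have : 1 ≤ #(pc (s₁ : G ⧸ K)) := card_pos.2 ⟨s₁, mem_filter.2 ⟨hs₁S, rfl⟩⟩
        omega
      · omega
    -- hence `S ∩ K = {0}`, the piece of `0` is `{0}` and deficient, the others are full
    have hSK : ∀ s ∈ S, s ∈ K → s = 0 := by
      intro s hs hsK
      by_contra hs0
      have h1 := hord s hs hs0
      have h2 := Nat.le_of_dvd Nat.card_pos (AddSubgroup.addOrderOf_dvd_natCard K hsK)
      omega
    have hpc0 : pc 0 = {0} := by
      ext s
      rw [hpc, mem_filter, mem_singleton, QuotientAddGroup.eq_zero_iff]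
      exact ⟨fun h => hSK s h.1 h.2, fun h => by rw [h]; exact ⟨h0, K.zero_mem⟩⟩
    have hpc0A : #(pc 0 + A) = #A := by rw [hpc0, singleton_add, zero_vadd]
    have hfull : ∀ c ∈ I.erase 0, #(pc c + A) = #Kf := by
      intro c hc
      rw [mem_erase] at hc
      by_contra hne
      exact huniq _ hc.2 _ h0I hc.1 (lt_of_le_of_ne (hle_q _ hc.2) hne) (by rw [hpc0A]; exact hAlt)
    have hScard : #S = (#I - 1) * #Kf := by
      have e := add_sum_erase I (fun c => #(pc c + A)) h0I
      rw [← hsumA, hSA, hpc0A, sum_congr rfl hfull, sum_const, smul_eq_mul,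
        card_erase_of_mem h0I] at e
      omega
    -- `P = S* + K`
    have himage : (S.erase 0).image (fun s : G => (s : G ⧸ K)) = I.erase 0 := by
      ext c
      simp only [mem_image, mem_erase, hI]
      constructor
      · rintro ⟨s, ⟨hs0, hs⟩, rfl⟩
        exact ⟨fun h => hs0 (hSK s hs ((QuotientAddGroup.eq_zero_iff _).1 h)), s, hs, rfl⟩
      · rintro ⟨hc0, s, hs, rfl⟩
        exact ⟨s, ⟨fun h => hc0 (by rw [h, h00]), hs⟩, rfl⟩
    refine ⟨S.erase 0 + Kf, subset_add_left _ h0Kf, ?_, ?_⟩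
    · rw [card_add_eq_card_image_mul K Kf hKf (S.erase 0), himage, card_erase_of_mem h0I, hScard]
    · obtain ⟨q, hq⟩ : (Kf.erase 0).Nonempty := card_pos.1 (by rw [card_erase_of_mem h0Kf]; omega)
      rw [mem_erase] at hq
      exact ⟨q, hq.1, vadd_add_eq_of_forall_add_mem fun t ht =>
        (hKf _).2 (K.add_mem ((hKf q).1 hq.2) ((hKf t).1 ht))⟩

/-! ### §8, Theorem 28, Case 3: a generating `3`-atom with at least five elements -/

/-- **[HamidouneSerraZemor2008, §8, Theorem 28, Case 3 (`|A| ≥ 5`)], the decomposition modulo the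
`2`-atom `B`.**  Let `K` be a subgroup of order `5` (finset `B`), `0 ∈ S` with `S ∩ B = {0}`,
`|S| ≤ |G| − 7`, `κ₃(S) = |S|`, every non-zero element of order `≥ 5`; let `A ∋ 0` generate `G`
with `|S + A| = |S| + 5 ≤ |G| − 5`, `|A ∩ B| = 3` and `A ∖ B` a `2`-set inside one coset
`a₁ + B`.  Then `S ∖ {0}` is quasi-periodic.  Proof as printed (decomposition of `S` modulo `B`;
`S + B = G`: the `V`-count `5 ≥ 2|V|` against `|G ∖ (A + S)| ≥ 5 ⇒ |V| ≥ 3`; `S + B ≠ G`: some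
`A_1 + S_i` misses `S + B`, `(S + A) ∖ S ⊇ (A_0 ∖ 0) ⊔ (S_i + A_1)`, so `|S* + A_0| ≤ |S*| + 1`
and `P = S* + B`, `|S* + B| = |S*|` being excluded by `κ₃(S) = |S|`).
[cite: HamidouneSerraZemor2008, §8, Theorem 28 (proof, Case 3)] -/
theorem exists_periodic_superset_erase_zero_of_two_cosets {S A : Finset G} (K : AddSubgroup G)
    (B : Finset G) (hKf : ∀ g, g ∈ B ↔ g ∈ K) (hB5 : #B = 5) (h0 : (0 : G) ∈ S)
    (hSK : ∀ s ∈ S, s ∈ B → s = 0) (hκ : conn 3 S = #S)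
    (hord5 : ∀ g : G, g ≠ 0 → 5 ≤ addOrderOf g) (h0A : (0 : G) ∈ A)
    (hgenA : AddSubgroup.closure (A : Set G) = ⊤) (hAS : #(S + A) = #S + 5)
    (hC5 : #(S + A) + 5 ≤ Fintype.card G) (hA0 : #(A ∩ B) = 3) {a₁ : G}
    (hA1 : A \ B ⊆ a₁ +ᵥ B) (hA1c : #(A \ B) = 2) :
    ∃ P : Finset G, S.erase 0 ⊆ P ∧ #P = #S ∧ ∃ q : G, q ≠ 0 ∧ q +ᵥ P = P := by
  classical
  set A₀ := A ∩ B with hA₀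
  set A₁ := A \ B with hA₁
  have h0B : (0 : G) ∈ B := (hKf 0).2 K.zero_mem
  have h0A₀ : (0 : G) ∈ A₀ := mem_inter.2 ⟨h0A, h0B⟩
  have hA₀K : (A₀ : Set G) ⊆ K := fun a ha => (hKf a).1 (mem_inter.1 (mem_coe.1 ha)).2
  have hA₀A : A₀ ⊆ A := inter_subset_left
  have hA₀B : A₀ ⊆ B := inter_subset_right
  have hA₁A : A₁ ⊆ A := sdiff_subset
  have hBB : ∀ x ∈ B, ∀ y ∈ B, x + y ∈ B := fun x hx y hy =>
    (hKf _).2 (K.add_mem ((hKf x).1 hx) ((hKf y).1 hy))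
  -- Chowla / Cauchy–Davenport in a coset of `B`: `|X + A₀| ≥ min(5, |X| + 2)`
  have hCD : ∀ X : Finset G, X.Nonempty → #(X + A₀) < 5 → #X + 2 ≤ #(X + A₀) := by
    intro X hX hlt
    have := card_add_card_le_card_add_succ_of_card_add_lt hord5 hX ⟨0, h0A₀⟩ hlt
    omega
  have hSsub : S ⊆ S + B := subset_add_left _ h0B
  by_cases huniv : S + B = univ
  · -- `S + B = G`: contradiction
    exfalso
    set I : Finset (G ⧸ K) := S.image (fun s : G => (s : G ⧸ K)) with hI
    set pc : G ⧸ K → Finset G := fun c => S.filter (fun s : G => (s : G ⧸ K) = c) with hpc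
    have hpc_ne : ∀ c ∈ I, ∃ s₀ ∈ S, (s₀ : G ⧸ K) = c ∧ s₀ ∈ pc c := by
      intro c hc
      obtain ⟨s₀, hs₀, rfl⟩ := mem_image.1 hc
      exact ⟨s₀, hs₀, rfl, mem_filter.2 ⟨hs₀, rfl⟩⟩
    have hsumA : #(S + A₀) = ∑ c ∈ I, #(pc c + A₀) :=
      card_add_eq_sum_card_filter_add K S A₀ hA₀K
    have hsumS : #S = ∑ c ∈ I, #(pc c) :=
      card_eq_sum_card_fiberwise fun s hs => mem_image_of_mem _ hs
    have hpc_le : ∀ c, #(pc c) ≤ #(pc c + A₀) := fun c => card_le_card_add h0A₀ _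
    have hle5 : ∀ c ∈ I, #(pc c + A₀) ≤ 5 := by
      intro c hc
      obtain ⟨s₀, -, hs₀, -⟩ := hpc_ne c hc
      have := card_le_card (filter_add_subset_vadd K B hKf S A₀ hA₀K hs₀)
      rwa [card_vadd_finset, hB5] at this
    have hIn : #I * 5 = Fintype.card G := by
      rw [← hB5, ← card_add_eq_card_image_mul K B hKf S, huniv, card_univ]
    have hSA₀ : #(S + A₀) ≤ #(S + A) := card_le_card (add_subset_add_left hA₀A)
    have hSA₀' : #S ≤ #(S + A₀) := card_le_card_add h0A₀ _
    have hsum_d : ∑ c ∈ I, (5 - #(pc c + A₀)) + #(S + A₀) = #I * 5 := by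
      rw [hsumA, ← sum_add_distrib, sum_congr rfl (fun c hc => Nat.sub_add_cancel (hle5 c hc)),
        sum_const, smul_eq_mul]
    have hsum_e : ∑ c ∈ I, (#(pc c + A₀) - #(pc c)) + #S = #(S + A₀) := by
      rw [hsumS, ← sum_add_distrib, hsumA]
      exact sum_congr rfl fun c _ => Nat.sub_add_cancel (hpc_le c)
    have hdg : ∑ c ∈ I, (5 - #(pc c + A₀)) ≤ ∑ c ∈ I, (if #(pc c + A₀) < 5 then 2 else 0) := by
      apply sum_le_sum
      intro c hc
      split_ifs with h
      · obtain ⟨s₀, -, -, hs₀pc⟩ := hpc_ne c hc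
        have := hCD (pc c) ⟨s₀, hs₀pc⟩ h
        have : 1 ≤ #(pc c) := card_pos.2 ⟨s₀, hs₀pc⟩
        omega
      · omega
    have hge : ∑ c ∈ I, (if #(pc c + A₀) < 5 then 2 else 0) ≤
        ∑ c ∈ I, (#(pc c + A₀) - #(pc c)) := by
      apply sum_le_sum
      intro c hc
      split_ifs with h
      · obtain ⟨s₀, -, -, hs₀pc⟩ := hpc_ne c hc
        have := hCD (pc c) ⟨s₀, hs₀pc⟩ h
        omega
      · exact Nat.zero_le _
    have heven : ∑ c ∈ I, (if #(pc c + A₀) < 5 then 2 else 0) =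
        2 * ∑ c ∈ I, (if #(pc c + A₀) < 5 then 1 else 0) := by
      rw [mul_sum]
      exact sum_congr rfl fun c _ => by split_ifs <;> rfl
    rw [heven] at hdg hge
    omega
  · -- `S + B ≠ G`: a point of `A + S` outside `S + B`
    obtain ⟨a, ha, s, hs, hout⟩ : ∃ a ∈ A, ∃ s ∈ S, s + a ∉ S + B := by
      by_contra h
      push Not at h
      apply huniv
      apply eq_univ_of_add_eq_of_closure_eq_top ⟨0 + 0, add_mem_add h0 h0B⟩ hgenA
      apply Subset.antisymm _ (subset_add_left _ h0A)
      intro x hx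
      obtain ⟨y, hy, a, ha, rfl⟩ := mem_add.1 hx
      obtain ⟨s, hs, k, hk, rfl⟩ := mem_add.1 hy
      obtain ⟨s', hs', k', hk', he⟩ := mem_add.1 (h a ha s hs)
      refine mem_add.2 ⟨s', hs', k' + k, hBB _ hk' _ hk, ?_⟩
      rw [← add_assoc, he]; abel
    have haB : a ∉ B := fun haB => hout (mem_add.2 ⟨s, hs, a, haB, rfl⟩)
    have haA₁ : a ∈ A₁ := mem_sdiff.2 ⟨ha, haB⟩
    -- the piece of `s`, and `S_i + A₁` misses `S + B`
    set Si := S.filter (fun s' : G => (s' : G ⧸ K) = (s : G ⧸ K)) with hSi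
    have hsSi : s ∈ Si := mem_filter.2 ⟨hs, rfl⟩
    have hdis : ∀ x ∈ Si + A₁, x ∉ S + B := by
      intro x hx hxSB
      obtain ⟨s', hs', a', ha', rfl⟩ := mem_add.1 hx
      obtain ⟨s'', hs'', k'', hk'', he⟩ := mem_add.1 hxSB
      rw [hSi, mem_filter] at hs'
      have h1 : -s' + s ∈ K := QuotientAddGroup.eq.1 hs'.2
      obtain ⟨ka, hka, hka'⟩ := mem_vadd_finset.1 (hA1 haA₁)
      obtain ⟨kb, hkb, hkb'⟩ := mem_vadd_finset.1 (hA1 ha')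
      rw [vadd_eq_add] at hka' hkb'
      apply hout
      refine mem_add.2 ⟨s'', hs'', k'' + (ka - kb) + (-s' + s), hBB _ (hBB _ hk'' _
        ((hKf _).2 (K.sub_mem ((hKf _).1 hka) ((hKf _).1 hkb)))) _ ((hKf _).2 h1), ?_⟩
      have e1 : s + a = (s' + a') + (a - a') + (-s' + s) := by abel
      rw [e1, ← he, ← hka', ← hkb']; abel
    -- the three disjoint parts of `(S + A) ∖ S`
    set W₁ := A₀.erase 0 with hW₁
    set W₂ := Si + A₁ with hW₂
    set W₃ := (S.erase 0 + A₀) \ S with hW₃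
    have hW₁c : #W₁ = 2 := by rw [hW₁, card_erase_of_mem h0A₀, hA0]
    have hW₂c : 2 ≤ #W₂ := by
      rw [← hA1c]; exact card_le_card_add_left ⟨s, hsSi⟩
    have hW₁sub : W₁ ⊆ (S + A) \ S := by
      intro x hx
      rw [hW₁, mem_erase] at hx
      rw [mem_sdiff]
      exact ⟨mem_add.2 ⟨0, h0, x, hA₀A hx.2, zero_add x⟩,
        fun hxS => hx.1 (hSK x hxS (hA₀B hx.2))⟩
    have hW₂sub : W₂ ⊆ (S + A) \ S := by
      intro x hx
      rw [mem_sdiff]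
      exact ⟨add_subset_add (filter_subset _ _) hA₁A hx, fun hxS => hdis x hx (hSsub hxS)⟩
    have hW₃sub : W₃ ⊆ (S + A) \ S :=
      sdiff_subset_sdiff (add_subset_add (erase_subset _ _) hA₀A) Subset.rfl
    have hW₁SB : W₁ ⊆ S + B := fun x hx =>
      mem_add.2 ⟨0, h0, x, hA₀B (mem_erase.1 hx).2, zero_add x⟩
    have hW₃SB : S.erase 0 + A₀ ⊆ S + B := add_subset_add (erase_subset _ _) hA₀B
    have hd12 : Disjoint W₁ W₂ :=
      disjoint_left.2 fun x hx1 hx2 => hdis x hx2 (hW₁SB hx1)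
    have hd23 : Disjoint W₂ W₃ :=
      disjoint_left.2 fun x hx2 hx3 => hdis x hx2 (hW₃SB (mem_sdiff.1 hx3).1)
    have hd13 : Disjoint W₁ W₃ := by
      rw [disjoint_left]
      intro x hx1 hx3
      obtain ⟨s', hs', a₀, ha₀, rfl⟩ := mem_add.1 (mem_sdiff.1 hx3).1
      rw [mem_erase] at hs'
      apply hs'.1 (hSK s' hs'.2 _)
      have hx1B : s' + a₀ ∈ B := hA₀B (mem_erase.1 hx1).2
      have := K.sub_mem ((hKf _).1 hx1B) ((hKf _).1 (hA₀B ha₀))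
      rw [add_sub_cancel_right] at this
      exact (hKf _).2 this
    have hWcard : #W₁ + #W₂ + #W₃ ≤ 5 := by
      have hsub : W₁ ∪ W₂ ∪ W₃ ⊆ (S + A) \ S :=
        union_subset (union_subset hW₁sub hW₂sub) hW₃sub
      have h1 := card_le_card hsub
      rw [card_union_of_disjoint (disjoint_union_left.2 ⟨hd13, hd23⟩),
        card_union_of_disjoint hd12] at h1
      have h2 := card_sdiff_add_card_eq_card (subset_add_left S h0A)
      omega
    have hW₃c : #W₃ ≤ 1 := by omega
    -- `|S* + A₀| ≤ |S*| + 1`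
    set S' := S.erase 0 with hS'
    have hS'K : ∀ s' ∈ S', s' ∉ K := fun s' hs' hK' =>
      (mem_erase.1 hs').1 (hSK s' (mem_erase.1 hs').2 ((hKf _).2 hK'))
    have hS'A₀ : #(S' + A₀) ≤ #S' + 1 := by
      have hsub : S' + A₀ ⊆ W₃ ∪ S' := by
        intro x hx
        by_cases hxS : x ∈ S
        · refine mem_union_right _ (mem_erase.2 ⟨?_, hxS⟩)
          rintro rfl
          obtain ⟨s', hs', a₀, ha₀, he⟩ := mem_add.1 hx
          apply hS'K s' hs'
          have : s' = -a₀ := eq_neg_of_add_eq_zero_left he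
          rw [this]
          exact K.neg_mem ((hKf _).1 (hA₀B ha₀))
        · exact mem_union_left _ (mem_sdiff.2 ⟨hx, hxS⟩)
      have := (card_le_card hsub).trans (card_union_le _ _)
      omega
    -- every coset met by `S*` is full in `S* + A₀`, so `|S* + B| = |S* + A₀| ≤ |S*| + 1`
    set I' : Finset (G ⧸ K) := S'.image (fun s : G => (s : G ⧸ K)) with hI'
    set pc' : G ⧸ K → Finset G := fun c => S'.filter (fun s : G => (s : G ⧸ K) = c) with hpc'
    have hpc'_ne : ∀ c ∈ I', ∃ s₀ ∈ S', (s₀ : G ⧸ K) = c ∧ s₀ ∈ pc' c := by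
      intro c hc
      obtain ⟨s₀, hs₀, rfl⟩ := mem_image.1 hc
      exact ⟨s₀, hs₀, rfl, mem_filter.2 ⟨hs₀, rfl⟩⟩
    have hsumA' : #(S' + A₀) = ∑ c ∈ I', #(pc' c + A₀) :=
      card_add_eq_sum_card_filter_add K S' A₀ hA₀K
    have hsumS' : #S' = ∑ c ∈ I', #(pc' c) :=
      card_eq_sum_card_fiberwise fun s hs => mem_image_of_mem _ hs
    have hpc'_le : ∀ c, #(pc' c) ≤ #(pc' c + A₀) := fun c => card_le_card_add h0A₀ _
    have hle5' : ∀ c ∈ I', #(pc' c + A₀) ≤ 5 := by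
      intro c hc
      obtain ⟨s₀, -, hs₀, -⟩ := hpc'_ne c hc
      have := card_le_card (filter_add_subset_vadd K B hKf S' A₀ hA₀K hs₀)
      rwa [card_vadd_finset, hB5] at this
    have hsum_e' : ∑ c ∈ I', (#(pc' c + A₀) - #(pc' c)) + #S' = #(S' + A₀) := by
      rw [hsumS', ← sum_add_distrib, hsumA']
      exact sum_congr rfl fun c _ => Nat.sub_add_cancel (hpc'_le c)
    have hfull : ∀ c ∈ I', #(pc' c + A₀) = 5 := by
      intro c hc
      by_contra hne
      have hlt : #(pc' c + A₀) < 5 := lt_of_le_of_ne (hle5' c hc) hne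
      obtain ⟨s₀, -, -, hs₀pc⟩ := hpc'_ne c hc
      have h1 := hCD (pc' c) ⟨s₀, hs₀pc⟩ hlt
      have h2 := single_le_sum (f := fun c => #(pc' c + A₀) - #(pc' c))
        (fun _ _ => Nat.zero_le _) hc
      omega
    have hS'B : #(S' + B) ≤ #S' + 1 := by
      rw [card_add_eq_card_image_mul K B hKf S', hB5, ← smul_eq_mul, ← sum_const,
        ← sum_congr rfl hfull, ← hsumA']
      exact hS'A₀
    -- `|S* + B| = |S*|` would make `S*` periodic, against `κ₃(S) = |S|`
    have hS'c : #S' + 1 = #S := by rw [hS', card_erase_of_mem h0]; have := card_pos.2 ⟨0, h0⟩; omega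
    have hS'B' : #(S' + B) = #S := by
      have hge : #S' ≤ #(S' + B) := card_le_card_add h0B _
      rcases (show #(S' + B) = #S' ∨ #(S' + B) = #S' + 1 by omega) with heq | heq
      · exfalso
        have hstab : S' + B = S' := (eq_of_subset_of_card_le (subset_add_left _ h0B) heq.le).symm
        have hBS : B + S ⊆ B ∪ S' := by
          intro x hx
          obtain ⟨b, hb, t, ht, rfl⟩ := mem_add.1 hx
          by_cases ht0 : t = 0
          · rw [ht0, add_zero]; exact mem_union_left _ hb
          · have h1 : t + b ∈ S' + B := add_mem_add (mem_erase.2 ⟨ht0, ht⟩) hb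
            rw [hstab] at h1
            rw [add_comm]
            exact mem_union_right _ h1
        have hBSc : #(B + S) ≤ 5 + #S' := by
          rw [← hB5]; exact (card_le_card hBS).trans (card_union_le _ _)
        have hadm : IsAdm 3 S B := ⟨by omega, by omega⟩
        have := conn_le hadm
        omega
      · omega
    refine ⟨S' + B, subset_add_left _ h0B, hS'B', ?_⟩
    obtain ⟨q, hq⟩ : (B.erase 0).Nonempty := card_pos.1 (by rw [card_erase_of_mem h0B]; omega)
    rw [mem_erase] at hq
    exact ⟨q, hq.1, vadd_add_eq_of_forall_add_mem fun t ht => hBB q hq.2 t ht⟩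


/-- **[HamidouneSerraZemor2008, §8, Theorem 28, Case 3 (`|A| ≥ 5`)].**  Let `0 ∈ S` generate the
finite abelian group `G`, `gcd(|G|, 6) = 1`, `4 ≤ |S| ≤ |G| − 7`, `κ₃(S) = |S|`, every element of
`S ∖ {0}` of order `≥ |S| + 1`, and let `A ∋ 0` be a `3`-atom of `S` which generates `G` and has
`|A| ≥ 5`.  Then `S ∖ {0}` is quasi-periodic.  Proof as printed: Corollary 9; a `2`-atom
`B ∋ 0` of `A` has `|B| ≥ 3`, so is a subgroup by Theorem 21; `|A + B| ≥ 3|A| − 6` and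
`|A| ≥ κ₂(A) ≥ |B| ≥ 2|A| − 6` with `gcd(|G|, 6) = 1` force `|A| = |B| = 5`, `A = A_0 ∪ A_1`
modulo `B` with `|A_i| ≤ 3`, w.l.o.g. (translating `A`) `|A_0| = 3`; `|S| ≥ 5` by Lemma 24, so
`S ∩ B = {0}`; `|A + S| ≤ |G| − 5` by the dual fragment; then
`exists_periodic_superset_erase_zero_of_two_cosets`.
[cite: HamidouneSerraZemor2008, §8, Theorem 28 (proof, Case 3)] -/
theorem exists_periodic_superset_erase_zero_of_five_le_card {S A : Finset G}
    (h0 : (0 : G) ∈ S) (hgen : AddSubgroup.closure (S : Set G) = ⊤)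
    (hcop : (Fintype.card G).Coprime 6) (hS4 : 4 ≤ #S) (hκ : conn 3 S = #S)
    (hord : ∀ s ∈ S, s ≠ 0 → #S + 1 ≤ addOrderOf s) (hA : IsAtom 3 S A) (h0A : (0 : G) ∈ A)
    (hgenA : AddSubgroup.closure (A : Set G) = ⊤) (hA5 : 5 ≤ #A) :
    ∃ P : Finset G, S.erase 0 ⊆ P ∧ #P = #S ∧ ∃ q : G, q ≠ 0 ∧ q +ᵥ P = P := by
  classical
  set n := Fintype.card G with hn
  have hord5 : ∀ g : G, g ≠ 0 → 5 ≤ addOrderOf g := fun g hg =>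
    five_le_addOrderOf_of_coprime_six hcop hg
  have h2n : ¬ 2 ∣ n := fun h => by
    have := (Nat.Coprime.coprime_dvd_left h hcop).eq_one_of_dvd (by norm_num); omega
  have h3n : ¬ 3 ∣ n := fun h => by
    have := (Nat.Coprime.coprime_dvd_left h hcop).eq_one_of_dvd (by norm_num); omega
  have hAadm := hA.1.1
  have hAS : #(A + S) = #A + #S := by
    have h1 := hA.1.2
    have h2 := card_le_card_add h0 A
    rw [hκ] at h1
    omega
  have hASn : #(A + S) + 3 ≤ n := hAadm.2
  have hSAc : S + A = A + S := add_comm _ _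
  -- `|S| ≥ 5` (Lemma 24)
  have hS5 : 5 ≤ #S := by
    by_contra hlt
    have hS4' : #S = 4 := by omega
    have := IsAtom.card_eq_three_of_conn_three_eq_four h0 hgen hS4' (by rw [hκ, hS4']) hcop hA
      h0A
    omega
  -- `A` is not a subgroup; Corollary 9
  have hnot : ∀ K : AddSubgroup G, (K : Set G) ≠ A := by
    intro K hK
    have hKtop : K = ⊤ := by rw [← AddSubgroup.closure_eq K, hK]; exact hgenA
    have hAu : A = univ := by
      apply eq_univ_of_forall
      intro g
      have : g ∈ (K : Set G) := by rw [hKtop]; trivial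
      rw [hK] at this
      exact mem_coe.1 this
    have h2 : A + S = univ := by rw [hAu]; exact univ_subset_iff.1 (subset_add_left _ h0)
    rw [h2, card_univ] at hASn
    omega
  have hsid2 : ∀ g : G, g ≠ 0 → #(A ∩ (g +ᵥ A)) ≤ 2 := fun g hg =>
    Nat.lt_succ_iff.1 (hA.card_inter_vadd_lt_of_forall_ne h0 h0A hnot
      (fun x hx => le_trans (by norm_num) (hord5 x hx)) hg)
  -- a `2`-atom `B ∋ 0` of `A`
  have hSadm2 : IsAdm 2 A S := ⟨by omega, by rw [hSAc]; omega⟩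
  have hκ2 : conn 2 A ≤ #A := by
    have := conn_le hSadm2
    rw [hSAc, hAS] at this
    omega
  obtain ⟨B', hB'⟩ := exists_isAtom ⟨S, hSadm2⟩
  obtain ⟨b0, hb0⟩ : B'.Nonempty := card_pos.1 (by have := hB'.1.1.1; omega)
  set B := (-b0) +ᵥ B' with hBdef
  have hB : IsAtom 2 A B := hB'.vadd (-b0)
  have h0B : (0 : G) ∈ B := mem_vadd_finset.2 ⟨b0, hb0, by rw [vadd_eq_add, neg_add_cancel]⟩
  clear_value B
  have hBAn : #(B + A) + 2 ≤ n := hB.1.1.2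
  have hBfr : #(B + A) - #B = conn 2 A := hB.1.2
  have hBle : #B ≤ #(B + A) := card_le_card_add h0A B
  have hBA : #(B + A) ≤ #B + #A := by omega
  -- `|B| ≥ 3`
  have hB3 : 3 ≤ #B := by
    by_contra hlt
    have hB2 : #B = 2 := by have := hB.1.1.1; omega
    obtain ⟨x, y, hxy, hBxy⟩ := card_eq_two.1 hB2
    obtain ⟨b, hb0, hBb⟩ : ∃ b : G, b ≠ 0 ∧ B = {0, b} := by
      have h0B' := h0B
      rw [hBxy, mem_insert, mem_singleton] at h0B'
      rcases h0B' with h | h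
      · exact ⟨y, fun e => hxy (h.symm.trans e.symm), by rw [hBxy, h]⟩
      · exact ⟨x, fun e => hxy (e.trans h), by rw [hBxy, ← h, pair_comm]⟩
    have hBAeq : B + A = A ∪ (b +ᵥ A) := by
      ext z
      rw [hBb, mem_union, mem_add, mem_vadd_finset]
      constructor
      · rintro ⟨u, hu, a, ha, rfl⟩
        rw [mem_insert, mem_singleton] at hu
        rcases hu with rfl | rfl
        · exact Or.inl (by rwa [zero_add])
        · exact Or.inr ⟨a, ha, rfl⟩
      · rintro (hz | ⟨a, ha, rfl⟩)
        · exact ⟨0, by simp, z, hz, zero_add z⟩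
        · exact ⟨b, by simp, a, ha, rfl⟩
    have h1 := card_union_add_card_inter A (b +ᵥ A)
    rw [← hBAeq, card_vadd_finset] at h1
    have h2 := hsid2 b hb0
    omega
  -- Theorem 21: `B` is a subgroup `K`
  obtain ⟨K, hK⟩ : ∃ K : AddSubgroup G, (K : Set G) = B := by
    rcases hB.exists_addSubgroup_or_card_eq_two_of_conn_le_add h0A (m := 0) (Nat.zero_le _)
      (by rw [add_zero]; exact hκ2) (by norm_num; omega) h0B with h | h
    · exact h
    · omega
  have hKf : ∀ g, g ∈ B ↔ g ∈ K := fun g => by rw [← Finset.mem_coe, ← hK, SetLike.mem_coe]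
  have hBcardK : Nat.card K = #B := natCard_eq_card_of_coe_eq hK
  have hBdvd : #B ∣ n := by
    rw [← hBcardK, hn, ← Nat.card_eq_fintype_card]; exact AddSubgroup.card_addSubgroup_dvd_card K
  have hBB : ∀ x ∈ B, ∀ y ∈ B, x + y ∈ B := fun x hx y hy =>
    (hKf _).2 (K.add_mem ((hKf x).1 hx) ((hKf y).1 hy))
  -- `A ⊄ B`
  have hAnB : ¬ A ⊆ B := by
    intro h
    have hKtop : K = ⊤ := by
      rw [eq_top_iff, ← hgenA, AddSubgroup.closure_le]
      exact fun a ha => (hKf a).1 (h (mem_coe.1 ha))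
    have hBu : B = univ := eq_univ_of_forall fun g => (hKf g).2 (by rw [hKtop]; trivial)
    rw [hBu, univ_subset_iff.1 (subset_add_left _ h0A), card_univ] at hBAn
    omega
  obtain ⟨a₁, ha₁A, ha₁B⟩ : ∃ a ∈ A, a ∉ B := not_subset.1 hAnB
  -- `|B + A| ≥ 3|A| − 6`
  obtain ⟨b₁, hb₁, b₂, hb₂, hb₁₂⟩ : ∃ b₁ ∈ B.erase 0, ∃ b₂ ∈ B.erase 0, b₁ ≠ b₂ :=
    one_lt_card.1 (by rw [card_erase_of_mem h0B]; omega)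
  rw [mem_erase] at hb₁ hb₂
  have h3A : 3 * #A ≤ #(B + A) + 6 := by
    have hsub : A ∪ (b₁ +ᵥ A) ∪ (b₂ +ᵥ A) ⊆ B + A := by
      rw [add_comm]
      refine union_subset (union_subset (subset_add_left A h0B) ?_) ?_
      · intro z hz
        obtain ⟨a, ha, rfl⟩ := mem_vadd_finset.1 hz
        exact mem_add.2 ⟨a, ha, b₁, hb₁.2, add_comm _ _⟩
      · intro z hz
        obtain ⟨a, ha, rfl⟩ := mem_vadd_finset.1 hz
        exact mem_add.2 ⟨a, ha, b₂, hb₂.2, add_comm _ _⟩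
    have i1 := card_union_add_card_inter A (b₁ +ᵥ A)
    have i2 := card_union_add_card_inter (A ∪ (b₁ +ᵥ A)) (b₂ +ᵥ A)
    have i3 : #((A ∪ (b₁ +ᵥ A)) ∩ (b₂ +ᵥ A)) ≤ 4 := by
      rw [union_inter_distrib_right]
      refine (card_union_le _ _).trans ?_
      have j1 := hsid2 b₂ hb₂.1
      have j2 : #((b₁ +ᵥ A) ∩ (b₂ +ᵥ A)) ≤ 2 := by
        have e : b₂ +ᵥ A = b₁ +ᵥ ((b₂ - b₁) +ᵥ A) := by rw [vadd_vadd, add_sub_cancel]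
        rw [e, ← vadd_finset_inter, card_vadd_finset]
        exact hsid2 _ (sub_ne_zero.2 (Ne.symm hb₁₂))
      omega
    have i4 := hsid2 b₁ hb₁.1
    rw [card_vadd_finset] at i1 i2
    have := card_le_card hsub
    omega
  -- two cosets of `B` meet `A`; `κ₂(A) ≥ |B|`
  set IA : Finset (G ⧸ K) := A.image (fun a : G => (a : G ⧸ K)) with hIA
  have hBAc' : #(B + A) = #IA * #B := by rw [add_comm]; exact card_add_eq_card_image_mul K B hKf A
  have h00 : ((0 : G) : G ⧸ K) = 0 := (QuotientAddGroup.eq_zero_iff _).2 K.zero_mem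
  have hc₁0 : (a₁ : G ⧸ K) ≠ 0 := fun h =>
    ha₁B ((hKf _).2 ((QuotientAddGroup.eq_zero_iff _).1 h))
  have h0IA : (0 : G ⧸ K) ∈ IA := mem_image.2 ⟨0, h0A, h00⟩
  have ha₁IA : (a₁ : G ⧸ K) ∈ IA := mem_image_of_mem _ ha₁A
  have hIA2 : 2 ≤ #IA := one_lt_card.2 ⟨_, ha₁IA, 0, h0IA, hc₁0⟩
  have hBleA : #B ≤ #A := by
    have : 2 * #B ≤ #IA * #B := Nat.mul_le_mul_right _ hIA2
    omega
  -- `|B| = |A| = 5`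
  have hB5 : #B = 5 := by
    rcases (show #B = 3 ∨ #B = 4 ∨ #B = 5 ∨ #B = 6 by omega) with h | h | h | h
    · exact absurd (h ▸ hBdvd) h3n
    · exact absurd (dvd_trans (by norm_num : 2 ∣ 4) (h ▸ hBdvd)) h2n
    · exact h
    · exact absurd (dvd_trans (by norm_num : 2 ∣ 6) (h ▸ hBdvd)) h2n
  have hA5' : #A = 5 := by omega
  have hIA2' : #IA = 2 := by
    have : #IA * 5 ≤ 10 := by rw [← hB5, ← hBAc']; omega
    omega
  -- `A ∖ B` lies in the coset `a₁ + B`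
  have hIAeq : IA = {0, (a₁ : G ⧸ K)} := by
    symm
    apply eq_of_subset_of_card_le
    · rw [insert_subset_iff, singleton_subset_iff]; exact ⟨h0IA, ha₁IA⟩
    · rw [card_pair hc₁0.symm, hIA2']
  have hA1 : A \ B ⊆ a₁ +ᵥ B := by
    intro a ha
    rw [mem_sdiff] at ha
    have hc : (a : G ⧸ K) ∈ IA := mem_image_of_mem _ ha.1
    rw [hIAeq, mem_insert, mem_singleton] at hc
    rcases hc with hc | hc
    · exact absurd ((hKf _).2 ((QuotientAddGroup.eq_zero_iff _).1 hc)) ha.2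
    · have h1 : -a₁ + a ∈ K := QuotientAddGroup.eq.1 hc.symm
      exact mem_vadd_finset.2 ⟨-a₁ + a, (hKf _).2 h1, by rw [vadd_eq_add, add_neg_cancel_left]⟩
  -- `|A ∩ B| ≤ 3` and `|A ∖ B| ≤ 3`
  have hsmall : ∀ X C : Finset G, X ⊆ A → X ⊆ C → b₁ +ᵥ X ⊆ C → #C = 5 → #X ≤ 3 := by
    intro X C hXA hXC hbXC hC5
    by_contra hlt
    have i1 := card_union_add_card_inter X (b₁ +ᵥ X)
    have i2 : #(X ∪ (b₁ +ᵥ X)) ≤ 5 := hC5 ▸ card_le_card (union_subset hXC hbXC)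
    have i3 : #(X ∩ (b₁ +ᵥ X)) ≤ 2 :=
      (card_le_card (inter_subset_inter hXA (vadd_finset_subset_vadd_finset hXA))).trans
        (hsid2 b₁ hb₁.1)
    rw [card_vadd_finset] at i1
    omega
  have hA0le : #(A ∩ B) ≤ 3 :=
    hsmall (A ∩ B) B inter_subset_left inter_subset_right (fun x hx => by
      obtain ⟨y, hy, rfl⟩ := mem_vadd_finset.1 hx
      exact hBB b₁ hb₁.2 y (mem_inter.1 hy).2) hB5
  have hA1le : #(A \ B) ≤ 3 :=
    hsmall (A \ B) (a₁ +ᵥ B) sdiff_subset hA1 (fun x hx => by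
      obtain ⟨y, hy, rfl⟩ := mem_vadd_finset.1 hx
      obtain ⟨k, hk, rfl⟩ := mem_vadd_finset.1 (hA1 hy)
      exact mem_vadd_finset.2 ⟨b₁ + k, hBB b₁ hb₁.2 k hk, by
        rw [vadd_eq_add, vadd_eq_add, vadd_eq_add]; abel⟩) (by rw [card_vadd_finset, hB5])
  have hsum : #(A ∩ B) + #(A \ B) = 5 := by rw [card_inter_add_card_sdiff, hA5']
  -- `S ∩ B = {0}`
  have hSK : ∀ s ∈ S, s ∈ B → s = 0 := by
    intro s hs hsB
    by_contra hs0
    have h1 := hord s hs hs0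
    have h2 := Nat.le_of_dvd Nat.card_pos (AddSubgroup.addOrderOf_dvd_natCard K ((hKf s).1 hsB))
    rw [hBcardK, hB5] at h2
    omega
  -- `|A + S| ≤ |G| − 5` (dual fragment)
  have hC5 : #(S + A) + 5 ≤ n := by
    rw [hSAc]
    by_contra hlt
    obtain ⟨hdual, -⟩ := hA.1.dual h0
    have hfr := hdual.neg
    rw [neg_neg] at hfr
    have h1 := hA.2 _ hfr
    rw [card_neg, card_univ_sdiff] at h1
    omega
  have hSA5 : #(S + A) = #S + 5 := by rw [hSAc, hAS, hA5', Nat.add_comm]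
  rcases (show #(A ∩ B) = 3 ∨ #(A ∩ B) = 2 by omega) with h3 | h2
  · exact exists_periodic_superset_erase_zero_of_two_cosets K B hKf hB5 h0 hSK hκ hord5 h0A hgenA
      hSA5 hC5 h3 hA1 (by omega)
  · -- translate `A` by `−a₁`: then `|A' ∩ B| = 3`
    set A' := (-a₁) +ᵥ A with hA'
    have hA'atom : IsAtom 3 S A' := hA.vadd (-a₁)
    have h0A' : (0 : G) ∈ A' := mem_vadd_finset.2 ⟨a₁, ha₁A, by rw [vadd_eq_add, neg_add_cancel]⟩
    have hgenA' : AddSubgroup.closure (A' : Set G) = ⊤ := by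
      rw [eq_top_iff, ← hgenA, AddSubgroup.closure_le]
      intro a ha
      have hna₁ : -a₁ ∈ AddSubgroup.closure (A' : Set G) :=
        AddSubgroup.subset_closure (mem_coe.2 (mem_vadd_finset.2 ⟨0, h0A, by
          rw [vadd_eq_add, add_zero]⟩))
      have h2 : -a₁ + a ∈ AddSubgroup.closure (A' : Set G) :=
        AddSubgroup.subset_closure (mem_coe.2 (mem_vadd_finset.2 ⟨a, mem_coe.1 ha, rfl⟩))
      have := AddSubgroup.sub_mem _ h2 hna₁
      rwa [show -a₁ + a - -a₁ = a by abel] at this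
    have hSA' : S + A' = (-a₁) +ᵥ (S + A) := by
      rw [hA', ← singleton_add, ← singleton_add, add_left_comm]
    have hSA'5 : #(S + A') = #S + 5 := by rw [hSA', card_vadd_finset, hSA5]
    have hC5' : #(S + A') + 5 ≤ n := by rw [hSA', card_vadd_finset]; exact hC5
    have hmemK : ∀ a ∈ A, (-a₁ + a ∈ B ↔ a ∉ B) := by
      intro a ha
      constructor
      · intro h haB
        apply ha₁B
        have := K.sub_mem ((hKf a).1 haB) ((hKf _).1 h)
        rw [show a - (-a₁ + a) = a₁ by abel] at this
        exact (hKf _).2 this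
      · intro haB
        obtain ⟨k, hk, he⟩ := mem_vadd_finset.1 (hA1 (mem_sdiff.2 ⟨ha, haB⟩))
        rw [← he, vadd_eq_add, neg_add_cancel_left]; exact hk
    have hI' : A' ∩ B = (-a₁) +ᵥ (A \ B) := by
      ext x
      rw [mem_inter, hA', mem_vadd_finset, mem_vadd_finset]
      constructor
      · rintro ⟨⟨a, ha, rfl⟩, hxB⟩
        exact ⟨a, mem_sdiff.2 ⟨ha, (hmemK a ha).1 hxB⟩, rfl⟩
      · rintro ⟨a, ha, rfl⟩
        rw [mem_sdiff] at ha
        exact ⟨⟨a, ha.1, rfl⟩, (hmemK a ha.1).2 ha.2⟩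
    have hD' : A' \ B = (-a₁) +ᵥ (A ∩ B) := by
      ext x
      rw [mem_sdiff, hA', mem_vadd_finset, mem_vadd_finset]
      constructor
      · rintro ⟨⟨a, ha, rfl⟩, hxB⟩
        refine ⟨a, mem_inter.2 ⟨ha, ?_⟩, rfl⟩
        by_contra haB
        exact hxB ((hmemK a ha).2 haB)
      · rintro ⟨a, ha, rfl⟩
        rw [mem_inter] at ha
        exact ⟨⟨a, ha.1, rfl⟩, fun h => (hmemK a ha.1).1 h ha.2⟩
    have h3' : #(A' ∩ B) = 3 := by rw [hI', card_vadd_finset]; omega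
    have h2' : #(A' \ B) = 2 := by rw [hD', card_vadd_finset, h2]
    have hA1' : A' \ B ⊆ (-a₁) +ᵥ B := by
      rw [hD']; exact vadd_finset_subset_vadd_finset inter_subset_right
    exact exists_periodic_superset_erase_zero_of_two_cosets K B hKf hB5 h0 hSK hκ hord5 h0A'
      hgenA' hSA'5 hC5' h3' hA1' h2'

/-! ### §8, Theorem 28 -/

/-- **[HamidouneSerraZemor2008, §8, Theorem 28] (the Hamidoune–Rødseth theorem for abelian
groups, isoperimetric formulation):** "Let `0 ∈ S` be a generating subset of a finite abelian group
`G` with `gcd(|G|, 6) = 1` and `4 ≤ |S| ≤ |G| − 7`.  Assume `S` to be `3`-separable and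
`κ₃(S) = |S|`.  If every element of `S ∖ {0}` has order at least `|S| + 1`, then either `S` is a
quasi-progression or `S ∖ {0}` is quasi-periodic."  Here "`S` is a quasi-progression" is rendered
as `S ⊆ {a, a + r, …, a + |S| r}` for a generator `r` of `G` (a progression or a
quasi-progression of difference `r`), and "`S ∖ {0}` is quasi-periodic" as `S ∖ {0} ⊆ P`,
`|P| = |S|`, `q + P = P` for some `q ≠ 0`.  Proof as printed: a `3`-atom `A ∋ 0` of `S` either
generates a proper subgroup (Claim 2, `exists_periodic_superset_erase_zero_of_closure_ne_top`),
or generates `G` with `|A| ≤ 4` (Cases 1–2,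
`exists_subset_apFinset_of_isAtom_three_of_card_le_four`) or with `|A| ≥ 5` (Case 3,
`exists_periodic_superset_erase_zero_of_five_le_card`).
[cite: HamidouneSerraZemor2008, §8, Theorem 28] -/
theorem exists_subset_apFinset_or_periodic_of_conn_three_eq_card {S : Finset G}
    (h0 : (0 : G) ∈ S) (hgen : AddSubgroup.closure (S : Set G) = ⊤)
    (hcop : (Fintype.card G).Coprime 6) (hS4 : 4 ≤ #S) (hSn : #S + 7 ≤ Fintype.card G)
    (hsep : IsSeparable 3 S) (hκ : conn 3 S = #S)
    (hord : ∀ s ∈ S, s ≠ 0 → #S + 1 ≤ addOrderOf s) :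
    (∃ r a : G, AddSubgroup.zmultiples r = ⊤ ∧ S ⊆ apFinset a r (#S + 1)) ∨
      ∃ P : Finset G, S.erase 0 ⊆ P ∧ #P = #S ∧ ∃ q : G, q ≠ 0 ∧ q +ᵥ P = P := by
  classical
  obtain ⟨A', hA'⟩ := exists_isAtom hsep
  obtain ⟨a0, ha0⟩ : A'.Nonempty := card_pos.1 (by have := hA'.1.1.1; omega)
  set A := (-a0) +ᵥ A' with hAdef
  have hA : IsAtom 3 S A := hA'.vadd (-a0)
  have h0A : (0 : G) ∈ A := mem_vadd_finset.2 ⟨a0, ha0, by rw [vadd_eq_add, neg_add_cancel]⟩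
  clear_value A
  by_cases hgenA : AddSubgroup.closure (A : Set G) = ⊤
  · rcases le_or_gt #A 4 with hle | hgt
    · exact Or.inl (exists_subset_apFinset_of_isAtom_three_of_card_le_four h0 hcop hS4 hSn hκ hA
        h0A hgenA hle)
    · exact Or.inr (exists_periodic_superset_erase_zero_of_five_le_card h0 hgen hcop hS4 hκ hord
        hA h0A hgenA hgt)
  · exact Or.inr (exists_periodic_superset_erase_zero_of_closure_ne_top h0 hgen
      (fun g hg => le_trans (by norm_num) (five_le_addOrderOf_of_coprime_six hcop hg)) hκ hord hA
      h0A hgenA)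

end Isoperimetric

end Literature.Combinatorics.Additive
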